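import Literature.Barriers.CriticalPhenomena.PlaquetteWalkHoleRootRingTurning
import HarnessLib

/-!
# Barrier catalogue (SAWScalingLimit): the CLASS DIRECTIONS and the CELL LAWS at the remaining ring cells of a hole root

Companion of `PlaquetteWalkHoleRootDiagonalCellTurning` (the `SW` diagonal cell: directions `diagDir`, the diagonal-cell
law) and `PlaquetteWalkHoleRootRingTurning` (turning rigidity and entry–exit exclusion at the cells `rootS w` (`SE`),
`rootN w` (`NE`), `farNW w` (`NW`) and the south lateral cell `latS w` (`LS`) of the ring of the hole root `w.side W`,
hole `holeFaceW w ∉ D`). With the prefix turning pinned, the companion files' `ΩG.classTerm_dichotomy` and the tree's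
twelve `backBracket_*` closed forms make the signed class term of every wound class-`B2a` walk at these cells EXPLICIT.

## Results (all unconditional; axioms `propext`, `Classical.choice`, `Quot.sound`)

For each cell `XX ∈ {SE, NE, NW, LS}`: the direction table `dirXX θ z₀ z₁ z₂` (a unit complex number, symmetric in
exit/return; junk `0` on excluded patterns), `turnAtXX θ z₀` (the pinned prefix turning of the companion file), the
algebra ★★ `dir_term_XX` (`phase(turnAtXX θ z₀)·ε(z₀; z₁, z₂)·backBracket(θ; z₀, z₁, z₂, z₃) = v(θ)·dirXX θ z₀ z₁ z₂`
for every realizable pattern; one orientation per class from the closed forms, the other by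
`ΩG.chordSign_mul_backBracket_swap`), `norm_dirXX`, ★★★ `ΩG.classTerm_XX` (`classTerm = v(θ)·ΩG.classTermXX`: zero if
unwound, `extWeight·dirXX` if wound), `ΩG.sum_classTerm_XX`, and ★★★★ `PlaquetteWalk.vertexFunctional_printed_XX_eq` —
**THE CELL LAW** `VF_D(w.side W, cell) = i·v(θ)·Σ_{B2a(cell)} classTermXX` on `[π/3, 2π/3]` — with the bound
`PlaquetteWalk.norm_vertexFunctional_printed_XX_le` (`‖VF‖ ≤ v(θ)·Σ extWeight`); and ★★★ THE CONE LAWS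
`PlaquetteWalk.vertexFunctional_printed_XX_ne_zero_of_<group>`: at every cell the class directions split into TWO
groups by first side, each inside a cone of opening `≤ π/4` (`re_rot_dirXX_pos_<group>`: `SE`: `{N,E}` in
`[−7π/8, −5π/8]` and `{S,W}` in `[π/8, 3π/8]`; `NE`: `{S,E}` in `[−3π/8, −π/8]` and `{N,W}` in `[5π/8, 7π/8]`; `NW`:
`{S,W}` in `[3π/4, π]` and `{N,E}` in `[−π/4, 0]`; `LS`: `E` and `W` singly), so on the open range `θ ∈ (π/3, 2π/3)`:
if every WOUND walk at the cell entered from one group and one wound walk exists, then `VF ≠ 0` (sufficient-half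
instances of the lane's encircling criterion at every ring cell; mixed groups can cancel — not claimed otherwise).

The direction tables (first side: {exit, return} ↦ direction):
* `SE` (`rootS`; turnings `θ − π`, `−π`, `2π + θ`, `2π`): `N`: {E,S} ↦ `e^{−i5π/8}`, {E,W} ↦ `e^{i(3θ/8 − 7π/8)}`,
  {S,W} ↦ `e^{−i3π/4}`; `E`: {S,W} ↦ `e^{i(3θ/8 + π)}`; `S`: {E,N} ↦ `e^{i3π/8}`; `W`: {E,N} ↦ `e^{i(3θ/8 + π/8)}`,
  {N,S} ↦ `e^{iπ/4}`, {E,S} ↦ `e^{i3θ/8}`.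
* `NE` (`rootN`; turnings `θ − 3π`, `π`, `θ`, `−2π`): `N`: {E,S} ↦ `e^{i5π/8}`; `E`: {N,W} ↦ `e^{i(3θ/8 − 3π/8)}`;
  `S`: {E,N} ↦ `e^{−i3π/8}`, {N,W} ↦ `e^{−iπ/4}`, {E,W} ↦ `e^{i(3θ/8 − π/2)}`; `W`: {E,N} ↦ `e^{i(3θ/8 + 5π/8)}`,
  {N,S} ↦ `e^{i3π/4}`, {E,S} ↦ `e^{i(3θ/8 + π/2)}`.
* `NW` (`farNW`; turnings `π + θ`, `π`, `θ − 2π`, `−2π`): `N`: {S,W} ↦ `1`; `E`: {N,S} ↦ `e^{−iπ/8}`,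
  {N,W} ↦ `e^{i(3θ/8 − 3π/8)}`, {S,W} ↦ `e^{i(3θ/8 − π/4)}`; `S`: {E,N} ↦ `e^{i7π/8}`, {N,W} ↦ `−1`,
  {E,W} ↦ `e^{i(3θ/8 + 3π/4)}`; `W`: {E,N} ↦ `e^{i(3θ/8 + 5π/8)}`.
* `LS` (`latS`; turnings `−π` (`E`), `2π` (`W`)): `E`: {S,W} ↦ `e^{i(3θ/8 + π)}`; `W`: {E,S} ↦ `e^{i3θ/8}`.
(These are the rows of the venture lane's float «RING DIRECTION TABLE» (seat b-step0 gen 18, `DESIGN-next-g18.md` §4,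
validated to `1e−16` against the directly computed functional on three domains) for the entries the census could
see, now theorems; `e^{iπ}`-type constants are written as phases.)

References, as printed: A. Glazman, I. Manolescu, arXiv:1708.00395v3, Lemma 2.1 (p. 6, «in the form given in
[Gl]») [GlazmanManolescu2019]; A. Glazman, Electron. Commun. Probab. 20 (2015) no. 86, Lemma 3.1 and its proof
pp. 6–7, eq. (1) (the weights) [Glazman2015WeightedSAW]; H. Duminil-Copin, S. Smirnov, Ann. of Math. 175 (2012),
Lemma 1, proof [DuminilCopinSmirnov2012]; H. Hopf, Compositio Math. 2 (1935) 50–62, Nr. 2 (p. 53), Nr. 4 eq. (22)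
(pp. 60–61) [Hopf1935]. Status: lane corollaries of the companion files' turning rigidity and the tree's closed
forms; not located in print. NOT claimed: signs or sizes of the class masses, positivity or vanishing of `VF` at
these cells, cells outside the ring. Written for the venture lane «pcv-sawmu» (Tier B, b-step0 gen 19; tables
generated by `code/step0/g19/ring/gen_laws.py` and re-derived in Lean).
-/

noncomputable section

/-! ## The lateral cell `latN` in the diagonal-cell frame (for the re-derivation of the lateral file's turning values) -/

namespace Literature.Probability.RandomPlanarGeometry.SAW.YangBaxter

open Real Complex

/-- `latN` in the diagonal-cell frame: base offset `(4, 8)`. [cite: GlazmanManolescu2019, §1 (the lattice of rhombi and its mid-edges)] -/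
theorem latN_base_farSW (w : Face) : (latN w).base = (farSW w).base + (4, 8) := by
  obtain ⟨k, j⟩ := w
  refine Prod.ext ?_ ?_
  · show 4 * (k - 1) = 4 * (k - 2) + 4
    omega
  · show 4 * (j + 1) = 4 * (j - 1) + 8
    omega

/-- Safe closing offsets for `latN` (the closing leaves through the midpoint of the dead side `S` into the hole). [folklore] -/
def safeOffsetsLN : List (ℤ × ℤ) := [(5, 9), (5, 11), (7, 9), (7, 11), (6, 10), (6, 8), (6, 7), (6, 6)]

/-- `x² + y² ≥ 5` from a linear case description. [folklore] -/
private theorem five_le_sq_add_sq_laws {x y : ℤ}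
    (h : 3 ≤ x ∨ x ≤ -3 ∨ 3 ≤ y ∨ y ≤ -3 ∨ ((2 ≤ x ∨ x ≤ -2) ∧ (1 ≤ y ∨ y ≤ -1)) ∨
      ((1 ≤ x ∨ x ≤ -1) ∧ (2 ≤ y ∨ y ≤ -2))) : 5 ≤ x ^ 2 + y ^ 2 := by
  rcases h with h | h | h | h | ⟨h1, h2⟩ | ⟨h1, h2⟩
  · nlinarith [sq_nonneg y, mul_nonneg (show (0:ℤ) ≤ x - 3 by omega) (show (0:ℤ) ≤ x + 3 by omega)]
  · nlinarith [sq_nonneg y, mul_nonneg (show (0:ℤ) ≤ -x - 3 by omega) (show (0:ℤ) ≤ -x + 3 by omega)]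
  · nlinarith [sq_nonneg x, mul_nonneg (show (0:ℤ) ≤ y - 3 by omega) (show (0:ℤ) ≤ y + 3 by omega)]
  · nlinarith [sq_nonneg x, mul_nonneg (show (0:ℤ) ≤ -y - 3 by omega) (show (0:ℤ) ≤ -y + 3 by omega)]
  · have hx : 4 ≤ x ^ 2 := by rcases h1 with h1 | h1 <;> nlinarith
    have hy : 1 ≤ y ^ 2 := by rcases h2 with h2 | h2 <;> nlinarith
    omega
  · have hx : 1 ≤ x ^ 2 := by rcases h1 with h1 | h1 <;> nlinarith
    have hy : 4 ≤ y ^ 2 := by rcases h2 with h2 | h2 <;> nlinarith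
    omega

/-- The inner offsets lie in `{1, 2, 3}²`, one coordinate being `2`. [folklore] -/
private theorem inOff_cases_laws (s : Side) :
    (s.inOff.1 = 2 ∧ (s.inOff.2 = 1 ∨ s.inOff.2 = 3)) ∨ (s.inOff.2 = 2 ∧ (s.inOff.1 = 1 ∨ s.inOff.1 = 3)) := by
  cases s <;> simp [Side.inOff, Side.offset, Side.nIn]

/-- ★ Inner points of faces other than `latN w` and the hole stay at squared distance `≥ 5` from `safeOffsetsLN`.
[cite: Hopf1935, Nr. 4 eq. (22) (curves with corners); lane plumbing] -/
theorem five_le_dsq_innerPt_safeOffsetsLN {w : Face} (g : Face) (s : Side) (hg : g ≠ latN w)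
    (hh : g ≠ holeFaceW w) (q : ℤ × ℤ) (hq : q ∈ safeOffsetsLN) : 5 ≤ dsq (innerPt g s) ((farSW w).base + q) := by
  obtain ⟨k, j⟩ := g
  obtain ⟨a, c⟩ := w
  have hne : ¬(k = a - 1 ∧ j = c + 1) := fun e => hg (Prod.ext e.1 e.2)
  have hne' : ¬(k = a - 1 ∧ j = c) := fun e => hh (Prod.ext e.1 e.2)
  have hs := inOff_cases_laws s
  simp only [dsq, innerPt, Face.base, farSW, Prod.fst_add, Prod.snd_add]
  set ox := s.inOff.1
  set oy := s.inOff.2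
  apply five_le_sq_add_sq_laws
  simp only [safeOffsetsLN, List.mem_cons, List.mem_nil_iff, or_false] at hq
  rcases hq with rfl | rfl | rfl | rfl | rfl | rfl | rfl | rfl <;> simp only <;> omega

namespace ΩG

/-- The prefix of a class-`B2a` walk at a cell not containing the root is not empty (copy of the ring file's private
lemma). [folklore] -/
private theorem fhC_pos_laws {D : Set Face} {w c : Face} (hc : ∀ t, c.side t ≠ w.side .W) (ω : ΩG D (w.side .W) c) :
    0 < ω.2.firstHitG := by
  by_contra h0
  push Not at h0
  have e := ω.2.nth_firstHitG
  rw [Nat.le_zero.1 h0, ω.2.nth_zero] at e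
  exact hc _ e.symm

end ΩG

end Literature.Probability.RandomPlanarGeometry.SAW.YangBaxter

/-! # The lateral cell `latN` re-derived by the engine (generated instances) -/

namespace Literature.Probability.RandomPlanarGeometry.SAW.YangBaxter

open Real Complex

/-! ## § Ring cell LN: the lateral cell NORTH of the hole (`latN`, dead side `S`; the lateral file's cell) — instances, pinning, assembly -/

namespace ΩG

variable {D : Set Face} {w : Face} {ω : ΩG D (w.side .W) (latN w)}

section CellLN

/-- ★★ **The prefix turns by one of two values** at the lateral cell NORTH of the hole (`latN`, dead side `S`; the lateral file's cell): `N`: `{3 * π / 2, -(5 * π / 2)}`; `E`: `{π, -(3 * π)}`; `W`: `{2 * π, -(2 * π)}`. [cite: Hopf1935, Nr. 2 (Umlaufsatz, p. 53) and Nr. 4 eq. (22) (curves with corners, pp. 60–61)] [cite: GlazmanManolescu2019, Lemma 2.1 (proof: [Gl])] -/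
theorem WP_LN_pi_div_two_mem (hh : holeFaceW w ∉ D) (h : ω.IsB2a) :
    (ω.2.firstSideG = .N → ω.WP (fun _ => π / 2) = 3 * π / 2 ∨ ω.WP (fun _ => π / 2) = -(5 * π / 2)) ∧
      (ω.2.firstSideG = .E → ω.WP (fun _ => π / 2) = π ∨ ω.WP (fun _ => π / 2) = -(3 * π)) ∧
      (ω.2.firstSideG = .W → ω.WP (fun _ => π / 2) = 2 * π ∨ ω.WP (fun _ => π / 2) = -(2 * π)) := by
  have hπ := Real.pi_pos
  refine ⟨fun hz => ?_, fun hz => ?_, fun hz => ?_⟩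
  · have key := WP_hopf_of_tables_cell (ω := ω) hh (latN_side_ne_root w) h (latN_base_farSW w) safeOffsetsLN
      five_le_dsq_innerPt_safeOffsetsLN [((6 : ℤ), (10 : ℤ)), (6, 8), (6, 6)] (by simp)
      (by rw [hz]; decide) (by decide) (by rw [hz]; decide) (by rw [hz]; decide) (by rw [hz]; decide)
    rw [hz] at key
    have e : triplesTurn (((4, 8) + (Side.N.offset - Side.N.nIn)) :: ((4, 8) + Side.N.offset) ::
        ([((6 : ℤ), (10 : ℤ)), (6, 8), (6, 6)] ++ [(8, 6), (9, 6)])) = 2 := by decide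
    rw [e] at key
    push_cast at key
    rcases key with k | k
    · left; linarith
    · right; linarith
  · have key := WP_hopf_of_tables_cell (ω := ω) hh (latN_side_ne_root w) h (latN_base_farSW w) safeOffsetsLN
      five_le_dsq_innerPt_safeOffsetsLN [((7 : ℤ), (9 : ℤ)), (6, 8), (6, 6)] (by simp)
      (by rw [hz]; decide) (by decide) (by rw [hz]; decide) (by rw [hz]; decide) (by rw [hz]; decide)
    rw [hz] at key
    have e : triplesTurn (((4, 8) + (Side.E.offset - Side.E.nIn)) :: ((4, 8) + Side.E.offset) ::
        ([((7 : ℤ), (9 : ℤ)), (6, 8), (6, 6)] ++ [(8, 6), (9, 6)])) = 4 := by decide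
    rw [e] at key
    push_cast at key
    rcases key with k | k
    · left; linarith
    · right; linarith
  · have key := WP_hopf_of_tables_cell (ω := ω) hh (latN_side_ne_root w) h (latN_base_farSW w) safeOffsetsLN
      five_le_dsq_innerPt_safeOffsetsLN [((5 : ℤ), (9 : ℤ)), (6, 8), (6, 6)] (by simp)
      (by rw [hz]; decide) (by decide) (by rw [hz]; decide) (by rw [hz]; decide) (by rw [hz]; decide)
    rw [hz] at key
    have e : triplesTurn (((4, 8) + (Side.W.offset - Side.W.nIn)) :: ((4, 8) + Side.W.offset) ::
        ([((5 : ℤ), (9 : ℤ)), (6, 8), (6, 6)] ++ [(8, 6), (9, 6)])) = 0 := by decide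
    rw [e] at key
    push_cast at key
    rcases key with k | k
    · left; linarith
    · right; linarith

/-- Whole-walk Umlaufsatz, cell LN, pattern `(N, E, W)`. [cite: Hopf1935, Nr. 2 (Umlaufsatz, p. 53) and Nr. 4 eq. (22) (curves with corners, pp. 60–61)] -/
theorem winding_LN_NEW (hh : holeFaceW w ∉ D) (hr : RootedFace D (w.side .W) (latN w)) (h : ω.IsB2a)
    (hz0 : ω.2.firstSideG = .N) (hz1 : ω.z1 hr h = .E) (hz2 : ω.1 = .W) :
    ω.2.winding (fun _ => π / 2) = 2 * π ∨ ω.2.winding (fun _ => π / 2) = -(2 * π) := by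
  have hπ := Real.pi_pos
  have key := winding_hopf_of_tables_cell hh hr h (latN_base_farSW w) safeOffsetsLN five_le_dsq_innerPt_safeOffsetsLN
    [((5 : ℤ), (9 : ℤ)), (6, 8), (6, 6)] (by simp)
    (by rw [hz0, hz1, hz2]; decide) (by decide) (by rw [hz0, hz1, hz2]; decide) (by rw [hz0, hz1, hz2]; decide)
    (by rw [hz2]; decide)
  have e : triplesTurn (((4, 8) + ((ω.1).offset - (ω.1).nIn)) :: ((4, 8) + (ω.1).offset) ::
      ([((5 : ℤ), (9 : ℤ)), (6, 8), (6, 6)] ++ [(8, 6), (9, 6)])) = 0 := by rw [hz2]; decide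
  rw [e] at key
  push_cast at key
  rcases key with k | k
  · left; linarith
  · right; linarith

/-- Whole-walk Umlaufsatz, cell LN, pattern `(N, W, E)`. [cite: Hopf1935, Nr. 2 (Umlaufsatz, p. 53) and Nr. 4 eq. (22) (curves with corners, pp. 60–61)] -/
theorem winding_LN_NWE (hh : holeFaceW w ∉ D) (hr : RootedFace D (w.side .W) (latN w)) (h : ω.IsB2a)
    (hz0 : ω.2.firstSideG = .N) (hz1 : ω.z1 hr h = .W) (hz2 : ω.1 = .E) :
    ω.2.winding (fun _ => π / 2) = π ∨ ω.2.winding (fun _ => π / 2) = -(3 * π) := by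
  have hπ := Real.pi_pos
  have key := winding_hopf_of_tables_cell hh hr h (latN_base_farSW w) safeOffsetsLN five_le_dsq_innerPt_safeOffsetsLN
    [((7 : ℤ), (9 : ℤ)), (6, 8), (6, 6)] (by simp)
    (by rw [hz0, hz1, hz2]; decide) (by decide) (by rw [hz0, hz1, hz2]; decide) (by rw [hz0, hz1, hz2]; decide)
    (by rw [hz2]; decide)
  have e : triplesTurn (((4, 8) + ((ω.1).offset - (ω.1).nIn)) :: ((4, 8) + (ω.1).offset) ::
      ([((7 : ℤ), (9 : ℤ)), (6, 8), (6, 6)] ++ [(8, 6), (9, 6)])) = 4 := by rw [hz2]; decide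
  rw [e] at key
  push_cast at key
  rcases key with k | k
  · left; linarith
  · right; linarith

/-- Whole-walk Umlaufsatz, cell LN, pattern `(E, N, W)`. [cite: Hopf1935, Nr. 2 (Umlaufsatz, p. 53) and Nr. 4 eq. (22) (curves with corners, pp. 60–61)] -/
theorem winding_LN_ENW (hh : holeFaceW w ∉ D) (hr : RootedFace D (w.side .W) (latN w)) (h : ω.IsB2a)
    (hz0 : ω.2.firstSideG = .E) (hz1 : ω.z1 hr h = .N) (hz2 : ω.1 = .W) :
    ω.2.winding (fun _ => π / 2) = 2 * π ∨ ω.2.winding (fun _ => π / 2) = -(2 * π) := by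
  have hπ := Real.pi_pos
  have key := winding_hopf_of_tables_cell hh hr h (latN_base_farSW w) safeOffsetsLN five_le_dsq_innerPt_safeOffsetsLN
    [((5 : ℤ), (9 : ℤ)), (6, 8), (6, 6)] (by simp)
    (by rw [hz0, hz1, hz2]; decide) (by decide) (by rw [hz0, hz1, hz2]; decide) (by rw [hz0, hz1, hz2]; decide)
    (by rw [hz2]; decide)
  have e : triplesTurn (((4, 8) + ((ω.1).offset - (ω.1).nIn)) :: ((4, 8) + (ω.1).offset) ::
      ([((5 : ℤ), (9 : ℤ)), (6, 8), (6, 6)] ++ [(8, 6), (9, 6)])) = 0 := by rw [hz2]; decide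
  rw [e] at key
  push_cast at key
  rcases key with k | k
  · left; linarith
  · right; linarith

/-- Whole-walk Umlaufsatz, cell LN, pattern `(W, N, E)`. [cite: Hopf1935, Nr. 2 (Umlaufsatz, p. 53) and Nr. 4 eq. (22) (curves with corners, pp. 60–61)] -/
theorem winding_LN_WNE (hh : holeFaceW w ∉ D) (hr : RootedFace D (w.side .W) (latN w)) (h : ω.IsB2a)
    (hz0 : ω.2.firstSideG = .W) (hz1 : ω.z1 hr h = .N) (hz2 : ω.1 = .E) :
    ω.2.winding (fun _ => π / 2) = π ∨ ω.2.winding (fun _ => π / 2) = -(3 * π) := by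
  have hπ := Real.pi_pos
  have key := winding_hopf_of_tables_cell hh hr h (latN_base_farSW w) safeOffsetsLN five_le_dsq_innerPt_safeOffsetsLN
    [((7 : ℤ), (9 : ℤ)), (6, 8), (6, 6)] (by simp)
    (by rw [hz0, hz1, hz2]; decide) (by decide) (by rw [hz0, hz1, hz2]; decide) (by rw [hz0, hz1, hz2]; decide)
    (by rw [hz2]; decide)
  have e : triplesTurn (((4, 8) + ((ω.1).offset - (ω.1).nIn)) :: ((4, 8) + (ω.1).offset) ::
      ([((7 : ℤ), (9 : ℤ)), (6, 8), (6, 6)] ++ [(8, 6), (9, 6)])) = 4 := by rw [hz2]; decide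
  rw [e] at key
  push_cast at key
  rcases key with k | k
  · left; linarith
  · right; linarith

/-- ★ Cell LN: pattern `(N, E, W)` is impossible (wound or not). [cite: GlazmanManolescu2019, Lemma 2.1 (proof: [Gl])] [cite: DuminilCopinSmirnov2012, proof of Lemma 1 (the winding bookkeeping)] -/
theorem no_LN_NEW (hh : holeFaceW w ∉ D) (hr : RootedFace D (w.side .W) (latN w)) (h : ω.IsB2a)
    (hz0 : ω.2.firstSideG = .N) (hz1 : ω.z1 hr h = .E) (hz2 : ω.1 = .W) : False := by
  have hπ := Real.pi_pos
  have hC := (WP_LN_pi_div_two_mem hh h).1 hz0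
  have hP := winding_LN_NEW hh hr h hz0 hz1 hz2
  rw [winding_eq_WP_add_cell hr h] at hP
  rw [hz0, hz1] at hP
  have haT : arcTurn ((fun _ : ℤ => π / 2) (latN w).1) Side.N Side.E = π - π / 2 := rfl
  have heW : excursionWinding (π / 2) Side.N Side.E Side.W = -2 * π := rfl
  have hcs : chordSign Side.N Side.E Side.W = 1 := by decide
  rw [haT] at hP
  rcases ω.sign_law hr h (π / 2) with ⟨hWE, -⟩ | ⟨hWE, -⟩ <;> rw [hz0, hz1, hz2, heW] at hWE
  · rcases hC with hC | hC <;> rcases hP with hP | hP <;> linarith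
  · rw [hcs] at hWE
    push_cast at hWE
    rcases hC with hC | hC <;> rcases hP with hP | hP <;> linarith

/-- ★ Cell LN: pattern `(N, W, E)` is impossible (wound or not). [cite: GlazmanManolescu2019, Lemma 2.1 (proof: [Gl])] [cite: DuminilCopinSmirnov2012, proof of Lemma 1 (the winding bookkeeping)] -/
theorem no_LN_NWE (hh : holeFaceW w ∉ D) (hr : RootedFace D (w.side .W) (latN w)) (h : ω.IsB2a)
    (hz0 : ω.2.firstSideG = .N) (hz1 : ω.z1 hr h = .W) (hz2 : ω.1 = .E) : False := by
  have hπ := Real.pi_pos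
  have hC := (WP_LN_pi_div_two_mem hh h).1 hz0
  have hP := winding_LN_NWE hh hr h hz0 hz1 hz2
  rw [winding_eq_WP_add_cell hr h] at hP
  rw [hz0, hz1] at hP
  have haT : arcTurn ((fun _ : ℤ => π / 2) (latN w).1) Side.N Side.W = -(π / 2) := rfl
  have heW : excursionWinding (π / 2) Side.N Side.W Side.E = 2 * π := rfl
  have hcs : chordSign Side.N Side.W Side.E = -1 := by decide
  rw [haT] at hP
  rcases ω.sign_law hr h (π / 2) with ⟨hWE, -⟩ | ⟨hWE, -⟩ <;> rw [hz0, hz1, hz2, heW] at hWE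
  · rcases hC with hC | hC <;> rcases hP with hP | hP <;> linarith
  · rw [hcs] at hWE
    push_cast at hWE
    rcases hC with hC | hC <;> rcases hP with hP | hP <;> linarith

/-- ★ Cell LN, pattern `(E, N, W)`, wound: `WP(π/2) = π`. [cite: GlazmanManolescu2019, Lemma 2.1 (proof: [Gl])] [cite: DuminilCopinSmirnov2012, proof of Lemma 1 (the winding bookkeeping)] -/
theorem WP_LN_ENW (hh : holeFaceW w ∉ D) (hr : RootedFace D (w.side .W) (latN w)) (h : ω.IsB2a)
    (hz0 : ω.2.firstSideG = .E) (hz1 : ω.z1 hr h = .N) (hz2 : ω.1 = .W)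
    (hW : ω.WE (fun _ => π / 2) ≠ excursionWinding (π / 2) ω.2.firstSideG (ω.z1 hr h) ω.1) :
    ω.WP (fun _ => π / 2) = π := by
  have hπ := Real.pi_pos
  have hC := (WP_LN_pi_div_two_mem hh h).2.1 hz0
  have hP := winding_LN_ENW hh hr h hz0 hz1 hz2
  rw [winding_eq_WP_add_cell hr h] at hP
  have hWE := WE_sub_eq_of_wound_cell hr h (π / 2) hW
  rw [hz0, hz1] at hP
  rw [hz0, hz1, hz2] at hWE
  have haT : arcTurn ((fun _ : ℤ => π / 2) (latN w).1) Side.E Side.N = π / 2 - π := rfl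
  have heW : excursionWinding (π / 2) Side.E Side.N Side.W = 2 * π - π / 2 := rfl
  have hcs : chordSign Side.E Side.N Side.W = -1 := by decide
  rw [haT] at hP
  rw [heW, hcs] at hWE
  push_cast at hWE
  rcases hC with hC | hC <;> rcases hP with hP | hP <;> first | exact hC | (exfalso; linarith)

/-- ★ Cell LN, pattern `(W, N, E)`, wound: `WP(π/2) = -(2 * π)`. [cite: GlazmanManolescu2019, Lemma 2.1 (proof: [Gl])] [cite: DuminilCopinSmirnov2012, proof of Lemma 1 (the winding bookkeeping)] -/
theorem WP_LN_WNE (hh : holeFaceW w ∉ D) (hr : RootedFace D (w.side .W) (latN w)) (h : ω.IsB2a)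
    (hz0 : ω.2.firstSideG = .W) (hz1 : ω.z1 hr h = .N) (hz2 : ω.1 = .E)
    (hW : ω.WE (fun _ => π / 2) ≠ excursionWinding (π / 2) ω.2.firstSideG (ω.z1 hr h) ω.1) :
    ω.WP (fun _ => π / 2) = -(2 * π) := by
  have hπ := Real.pi_pos
  have hC := (WP_LN_pi_div_two_mem hh h).2.2 hz0
  have hP := winding_LN_WNE hh hr h hz0 hz1 hz2
  rw [winding_eq_WP_add_cell hr h] at hP
  have hWE := WE_sub_eq_of_wound_cell hr h (π / 2) hW
  rw [hz0, hz1] at hP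
  rw [hz0, hz1, hz2] at hWE
  have haT : arcTurn ((fun _ : ℤ => π / 2) (latN w).1) Side.W Side.N = π / 2 := rfl
  have heW : excursionWinding (π / 2) Side.W Side.N Side.E = -π - π / 2 := rfl
  have hcs : chordSign Side.W Side.N Side.E = 1 := by decide
  rw [haT] at hP
  rw [heW, hcs] at hWE
  push_cast at hWE
  rcases hC with hC | hC <;> rcases hP with hP | hP <;> first | exact hC | (exfalso; linarith)

/-- **The forced prefix turning at cell LN**, by first side (at `θ = π/2`; junk `0` on the sides `S`, `N`, which do not
occur). [cite: GlazmanManolescu2019, Lemma 2.1 (proof: [Gl])] -/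
def ringTurnLN : Side → ℝ
  | .N => 0
  | .E => π
  | .S => 0
  | .W => -(2 * π)

/-- The directly treated patterns at cell LN. [folklore] -/
def ringPatternsLN : List (Side × Side × Side) :=
  [(.N, .E, .W), (.N, .W, .E), (.E, .N, .W), (.W, .N, .E)]

/-- Every pattern of three distinct sides avoiding the dead side `S` is treated directly or through its reversal. [folklore] -/
private theorem ringPatternsLN_cover : ∀ a b c : Side, a ≠ b → a ≠ c → b ≠ c → a ≠ .S → b ≠ .S → c ≠ .S →
    (a, b, c) ∈ ringPatternsLN ∨ (a, c, b) ∈ ringPatternsLN := by decide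

/-- ★ **The dead side**: no class-`B2a` walk at this cell first enters it from `S` (the face across `S` is the hole), and none
exits or returns through `S`. [cite: Glazman2015WeightedSAW, Lemma 3.1 (proof, pp. 6–7: the classes of walks through a rhombus)] -/
theorem LN_sides_ne_S (hh : holeFaceW w ∉ D) (hr : RootedFace D (w.side .W) (latN w)) (h : ω.IsB2a) :
    ω.2.firstSideG ≠ .S ∧ ω.z1 hr h ≠ .S ∧ ω.1 ≠ .S := by
  have hdoors := ω.exit_return_doors hr h
  refine ⟨fun hz => ?_, fun e => ?_, fun e => ?_⟩
  · obtain ⟨hs, ht⟩ := preC_sOut_last (ω := ω) hh (latN_side_ne_root w) h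
    obtain ⟨hD, hne, -⟩ := preC_fc (ω := ω) hh h (i := ω.2.firstHitG - 1)
      (by have := fhC_pos_laws (latN_side_ne_root w) ω; omega)
    rw [hz] at ht
    have hcases := (Face.exists_side_eq_iff _ _).1 ⟨_, ht⟩
    rw [latN_side_S_faces] at hcases
    rcases hcases with e | e
    · have e' : (ω.preC h).fc (ω.2.firstHitG - 1) = holeFaceW w := e
      rw [e'] at hD
      exact hh hD
    · exact hne e
  · rw [e, latN_side_S_faces] at hdoors; exact hh hdoors.1.1
  · rw [e, latN_side_S_faces] at hdoors; exact hh hdoors.2.1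

/-- ★★ The directly treated patterns at cell LN: wound ⇒ `WP(π/2) = ringTurnLN z₀`. [cite: Hopf1935, Nr. 2 (Umlaufsatz, p. 53) and Nr. 4 eq. (22) (curves with corners, pp. 60–61)] [cite: GlazmanManolescu2019, Lemma 2.1 (proof: [Gl])] -/
theorem WP_LN_eq_of_mem (hh : holeFaceW w ∉ D) (hr : RootedFace D (w.side .W) (latN w)) (h : ω.IsB2a)
    (hmem : (ω.2.firstSideG, ω.z1 hr h, ω.1) ∈ ringPatternsLN)
    (hW : ω.WE (fun _ => π / 2) ≠ excursionWinding (π / 2) ω.2.firstSideG (ω.z1 hr h) ω.1) :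
    ω.WP (fun _ => π / 2) = ringTurnLN ω.2.firstSideG := by
  simp only [ringPatternsLN, List.mem_cons, Prod.mk.injEq, List.mem_nil_iff, or_false] at hmem
  rcases hmem with ⟨h0, h1, h2⟩ | ⟨h0, h1, h2⟩ | ⟨h0, h1, h2⟩ | ⟨h0, h1, h2⟩
  · exact (no_LN_NEW hh hr h h0 h1 h2).elim
  · exact (no_LN_NWE hh hr h h0 h1 h2).elim
  · rw [WP_LN_ENW hh hr h h0 h1 h2 hW, h0]; rfl
  · rw [WP_LN_WNE hh hr h h0 h1 h2 hW, h0]; rfl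

/-- ★★★ **THE TURNING RIGIDITY AT THE LATERAL CELL LN (θ = π/2)**: for every WOUND class-`B2a` walk of the hole root
`w.side W` at `latN w`, `WP(π/2) = ringTurnLN z₀` (`E ↦ π`, `W ↦ -(2 * π)`). [cite: Hopf1935, Nr. 2 (Umlaufsatz, p. 53) and Nr. 4 eq. (22) (curves with corners, pp. 60–61)] [cite: GlazmanManolescu2019, Lemma 2.1 (proof: [Gl])] [cite: DuminilCopinSmirnov2012, proof of Lemma 1 (the winding bookkeeping)] -/
theorem WP_LN_pi_div_two_eq_of_wound (hh : holeFaceW w ∉ D) (hr : RootedFace D (w.side .W) (latN w))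
    (h : ω.IsB2a) (hW : ω.WE (fun _ => π / 2) ≠ excursionWinding (π / 2) ω.2.firstSideG (ω.z1 hr h) ω.1) :
    ω.WP (fun _ => π / 2) = ringTurnLN ω.2.firstSideG := by
  obtain ⟨hz01, hz02, hz12⟩ := ω.firstSide_exit_return_distinct hr h
  obtain ⟨hN0, hN1, hN2⟩ := LN_sides_ne_S hh hr h
  rcases ringPatternsLN_cover _ _ _ hz01 hz02 hz12 hN0 hN1 hN2 with hd | hd
  · exact WP_LN_eq_of_mem hh hr h hd hW
  · have h'' := ω.rev_isB2a hr h
    have e1 : (ω.rev hr).z1 hr h'' = ω.1 := by unfold ΩG.z1; exact ω.rev_exitSide hr h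
    have e2 : (ω.rev hr).1 = ω.z1 hr h := ω.rev_fst hr h
    have e0 : (ω.rev hr).2.firstSideG = ω.2.firstSideG := ω.rev_firstSide hr h
    have hWr : (ω.rev hr).WE (fun _ => π / 2) ≠
        excursionWinding (π / 2) (ω.rev hr).2.firstSideG ((ω.rev hr).z1 hr h'') (ω.rev hr).1 := by
      rw [ω.rev_WE (fun _ => π / 2) hr h, e0, e1, e2, excursionWinding_swap]
      intro e; apply hW; linarith
    have key := WP_LN_eq_of_mem (ω := ω.rev hr) hh hr h'' (by rw [e0, e1, e2]; exact hd) hWr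
    rwa [ω.rev_WP (fun _ => π / 2) hr h, e0] at key

/-- ★★ **AT THE LATERAL CELL LN EVERY class-`B2a` WALK ENTERS FROM `E` OR FROM `W`** (wound or not; the companion
files' (R1) needed woundness): a `N`-entry would need an excursion joining the `E` and `W` sides of the cell, which the
two Umlaufsätze exclude. [cite: Hopf1935, Nr. 2 (Umlaufsatz, p. 53) and Nr. 4 eq. (22) (curves with corners, pp. 60–61)] [cite: GlazmanManolescu2019, Lemma 2.1 (proof: [Gl])] -/
theorem LN_firstSide_eq_E_or_W (hh : holeFaceW w ∉ D) (hr : RootedFace D (w.side .W) (latN w)) (h : ω.IsB2a) :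
    ω.2.firstSideG = .E ∨ ω.2.firstSideG = .W := by
  obtain ⟨hz01, hz02, hz12⟩ := ω.firstSide_exit_return_distinct hr h
  obtain ⟨hN0, hN1, hN2⟩ := LN_sides_ne_S hh hr h
  rcases hz0 : ω.2.firstSideG with _ | _ | _ | _
  · exact Or.inr rfl
  · exact Or.inl rfl
  · exact absurd hz0 hN0
  · exfalso
    rw [hz0] at hz01 hz02
    rcases hω1 : ω.z1 hr h with _ | _ | _ | _
    · rcases hω2 : ω.1 with _ | _ | _ | _
      · rw [hω1, hω2] at hz12; exact hz12 rfl
      · exact no_LN_NWE hh hr h hz0 hω1 hω2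
      · exact hN2 hω2
      · exact hz02 hω2.symm
    · rcases hω2 : ω.1 with _ | _ | _ | _
      · exact no_LN_NEW hh hr h hz0 hω1 hω2
      · rw [hω1, hω2] at hz12; exact hz12 rfl
      · exact hN2 hω2
      · exact hz02 hω2.symm
    · exact hN1 hω1
    · exact hz01 hω1.symm

/-- ★★★ **THE TURNING RIGIDITY AT THE LATERAL CELL LN, every angle**: wound ⇒ `E ↦ π`, `W ↦ -(2 * π)`. [cite: Hopf1935, Nr. 2 (Umlaufsatz, p. 53) and Nr. 4 eq. (22) (curves with corners, pp. 60–61)] [cite: GlazmanManolescu2019, Lemma 2.1 (proof: [Gl])] [cite: DuminilCopinSmirnov2012, proof of Lemma 1 (the winding bookkeeping)] -/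
theorem WP_LN_eq_of_wound (hh : holeFaceW w ∉ D) (hr : RootedFace D (w.side .W) (latN w)) (h : ω.IsB2a)
    (θ : ℝ) (hW : ω.WE (fun _ => θ) ≠ excursionWinding θ ω.2.firstSideG (ω.z1 hr h) ω.1) :
    (ω.2.firstSideG = .E → ω.WP (fun _ => θ) = π) ∧ (ω.2.firstSideG = .W → ω.WP (fun _ => θ) = -(2 * π)) := by
  have hW' : ω.WE (fun _ => π / 2) ≠ excursionWinding (π / 2) ω.2.firstSideG (ω.z1 hr h) ω.1 := by
    intro e; apply hW
    have := WE_sub_excursionWinding_const_cell (ω := ω) hr h θ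
    linarith
  have key := WP_LN_pi_div_two_eq_of_wound hh hr h hW'
  have htr := WP_cell_of_pinned (ω := ω) h θ key
  refine ⟨fun hz => ?_, fun hz => ?_⟩ <;> rw [htr, hz] <;> simp only [ringTurnLN, Side.slantInd] <;> ring

end CellLN

end ΩG

end Literature.Probability.RandomPlanarGeometry.SAW.YangBaxter


namespace Literature.Probability.RandomPlanarGeometry.SAW.YangBaxter

open Real Complex

section LawHelpersR

/-- Two phases multiply by adding the angles. [folklore] -/
private theorem cexp_mul_cexpR (a b : ℝ) :
    Complex.exp (((a : ℝ) : ℂ) * Complex.I) * Complex.exp (((b : ℝ) : ℂ) * Complex.I) =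
      Complex.exp ((((a + b : ℝ)) : ℂ) * Complex.I) := by
  rw [← Complex.exp_add]; congr 1; push_cast; ring

/-- Angles differing by a multiple of `2π` give the same phase. [folklore] -/
private theorem cexp_I_eq_of_intR (a b : ℝ) (n : ℤ) (h : a = b + n * (2 * π)) :
    Complex.exp (((a : ℝ) : ℂ) * Complex.I) = Complex.exp (((b : ℝ) : ℂ) * Complex.I) := by
  rw [Complex.exp_eq_exp_iff_exists_int]
  exact ⟨n, by rw [h]; push_cast; ring⟩

/-- `e^{iπ/2} = i`. [folklore] -/
private theorem cexp_pi_div_twoR : Complex.exp ((((π / 2 : ℝ)) : ℂ) * Complex.I) = Complex.I := by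
  rw [Complex.exp_mul_I]; push_cast
  rw [Complex.cos_pi_div_two, Complex.sin_pi_div_two]; simp

/-- `i · e^{ix} = e^{i(x + π/2)}`. [folklore] -/
private theorem I_mul_cexpR (x : ℝ) :
    Complex.I * Complex.exp (((x : ℝ) : ℂ) * Complex.I) = Complex.exp ((((x + π / 2 : ℝ)) : ℂ) * Complex.I) := by
  rw [show (((x + π / 2 : ℝ)) : ℂ) * Complex.I = ((x : ℝ) : ℂ) * Complex.I + (((π / 2 : ℝ)) : ℂ) * Complex.I by
    push_cast; ring, Complex.exp_add, cexp_pi_div_twoR]; ring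

/-- `−e^{ix} = e^{i(x + π)}`. [folklore] -/
private theorem neg_cexpR (x : ℝ) :
    -Complex.exp (((x : ℝ) : ℂ) * Complex.I) = Complex.exp ((((x + π : ℝ)) : ℂ) * Complex.I) := by
  rw [show (((x + π : ℝ)) : ℂ) * Complex.I = ((x : ℝ) : ℂ) * Complex.I + ((π : ℝ) : ℂ) * Complex.I by
    push_cast; ring, Complex.exp_add, Complex.exp_pi_mul_I]; ring

/-- `Re(e^{ia}·e^{ix}) = cos(a + x)`. [folklore] -/
private theorem re_cexp_mul_cexpR (a x : ℝ) :
    (Complex.exp (((a : ℝ) : ℂ) * Complex.I) * Complex.exp (((x : ℝ) : ℂ) * Complex.I)).re = Real.cos (a + x) := by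
  rw [← Complex.exp_add, show ((a : ℝ) : ℂ) * Complex.I + ((x : ℝ) : ℂ) * Complex.I = (((a + x : ℝ)) : ℂ) * Complex.I by
    push_cast; ring, Complex.exp_ofReal_mul_I_re]

/-- On the OPEN range every local weight of a walk is positive (private twin, to keep this leaf light). [cite: GlazmanManolescu2019, §1, eq. (1) and Fig. 1] -/
private theorem localWeight_kindsIn_posR {θ : ℝ} (hθ : θ ∈ Set.Ioo (π / 3) (2 * π / 3)) {D : Set Face}
    {a z : MidEdge} (γ : YBWalk D a z) (f : Face) : 0 < localWeight θ (γ.kindsIn f) := by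
  have hθ' : θ ∈ Set.Ioo 0 π := ⟨by linarith [hθ.1, Real.pi_pos], by linarith [hθ.2, Real.pi_pos]⟩
  have e : γ.kindsIn f = Literature.Barriers.CriticalPhenomena.PlaquetteWalk.kindsL γ.mids f := rfl
  rw [e]
  rcases Literature.Barriers.CriticalPhenomena.PlaquetteWalk.kindsL_shape γ f with h | h | h | h | h | h <;> rw [h] <;>
    simp only [localWeight]
  · exact one_pos
  · exact weightU1_pos_of_mem_Ioo hθ'
  · exact weightU2_pos_of_mem_Ioo hθ'
  · exact weightV_pos_of_mem_Ioo hθ'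
  · rw [weightW1_eq_weightU1_mul]
    refine mul_pos (weightU1_pos_of_mem_Ioo hθ') (sub_pos.2 ?_)
    rw [← Real.sin_pi_div_two_sub]
    exact Real.sin_lt_sin_of_lt_of_le_pi_div_two (by linarith [hθ.1, Real.pi_pos]) (by linarith [hθ.1, Real.pi_pos])
      (by linarith [hθ.2])
  · rw [weightW2_eq_sqrt_two_mul]
    refine mul_pos (mul_pos (Real.sqrt_pos.2 (by norm_num)) (weightU2_pos_of_mem_Ioo hθ')) ?_
    exact Real.sin_pos_of_pos_of_lt_pi (by linarith [hθ.1]) (by linarith [hθ.2, Real.pi_pos])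

end LawHelpersR

/-! ## § Cell SE — the cell south of the root plaquette (`SE` of the hole): class directions and the cell law -/

section LawSE

/-- **The class directions at cell SE** (symmetric in exit/return; junk `0` on the excluded and degenerate patterns):
`N`: {E,S} ↦ `e^{i(-(5 * π / 8))}`; `N`: {E,W} ↦ `e^{i(3 * θ / 8 - 7 * π / 8)}`; `N`: {W,S} ↦ `e^{i(-(3 * π / 4))}`; `E`: {S,W} ↦ `e^{i(3 * θ / 8 + π)}`; `S`: {E,N} ↦ `e^{i(3 * π / 8)}`; `W`: {E,N} ↦ `e^{i(3 * θ / 8 + π / 8)}`; `W`: {S,N} ↦ `e^{i(π / 4)}`; `W`: {E,S} ↦ `e^{i(3 * θ / 8)}`. [cite: GlazmanManolescu2019, Lemma 2.1 (statement, "in the form given in [Gl]")] [cite: Glazman2015WeightedSAW, Lemma 3.1, eq. (1) (the weight v(θ))] -/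
def dirSE (θ : ℝ) : Side → Side → Side → ℂ
  | .N, .E, .S => Complex.exp ((((-(5 * π / 8) : ℝ)) : ℂ) * Complex.I)
  | .N, .S, .E => Complex.exp ((((-(5 * π / 8) : ℝ)) : ℂ) * Complex.I)
  | .N, .E, .W => Complex.exp ((((3 * θ / 8 - 7 * π / 8 : ℝ)) : ℂ) * Complex.I)
  | .N, .W, .E => Complex.exp ((((3 * θ / 8 - 7 * π / 8 : ℝ)) : ℂ) * Complex.I)
  | .N, .W, .S => Complex.exp ((((-(3 * π / 4) : ℝ)) : ℂ) * Complex.I)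
  | .N, .S, .W => Complex.exp ((((-(3 * π / 4) : ℝ)) : ℂ) * Complex.I)
  | .E, .S, .W => Complex.exp ((((3 * θ / 8 + π : ℝ)) : ℂ) * Complex.I)
  | .E, .W, .S => Complex.exp ((((3 * θ / 8 + π : ℝ)) : ℂ) * Complex.I)
  | .S, .E, .N => Complex.exp ((((3 * π / 8 : ℝ)) : ℂ) * Complex.I)
  | .S, .N, .E => Complex.exp ((((3 * π / 8 : ℝ)) : ℂ) * Complex.I)
  | .W, .E, .N => Complex.exp ((((3 * θ / 8 + π / 8 : ℝ)) : ℂ) * Complex.I)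
  | .W, .N, .E => Complex.exp ((((3 * θ / 8 + π / 8 : ℝ)) : ℂ) * Complex.I)
  | .W, .S, .N => Complex.exp ((((π / 4 : ℝ)) : ℂ) * Complex.I)
  | .W, .N, .S => Complex.exp ((((π / 4 : ℝ)) : ℂ) * Complex.I)
  | .W, .E, .S => Complex.exp ((((3 * θ / 8 : ℝ)) : ℂ) * Complex.I)
  | .W, .S, .E => Complex.exp ((((3 * θ / 8 : ℝ)) : ℂ) * Complex.I)
  | _, _, _ => 0

/-- The class directions at cell SE are symmetric in the exit and return sides. [folklore] -/
private theorem dirSE_swap (θ : ℝ) (z₀ z₁ z₂ : Side) : dirSE θ z₀ z₂ z₁ = dirSE θ z₀ z₁ z₂ := by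
  cases z₀ <;> cases z₁ <;> cases z₂ <;> rfl

/-- The prefix turning at angle `θ` at cell SE, by first side (junk `0` on sides that do not occur). [cite: GlazmanManolescu2019, Lemma 2.1 (proof: [Gl])] -/
def turnAtSE (θ : ℝ) : Side → ℝ
  | .N => θ - π
  | .E => -π
  | .S => θ + 2 * π
  | .W => 2 * π

/-- Cell SE, first side `N`, class `{E, S}`: `phase(WP)·ε·backBracket = v(θ)·e^{i(-(5 * π / 8))}` (private: the same
identity recurs at every cell with the same pinned turning; the public form is `dir_term_SE`). [cite: Glazman2015WeightedSAW, Lemma 3.1, eq. (1) (the weight v(θ))] [cite: GlazmanManolescu2019, Lemma 2.1 (proof: [Gl])] -/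
private theorem dir_term_SE_N_E_S (θ : ℝ) :
    phase (θ - π) * ((chordSign .N .E .S : ℂ) * backBracket θ .N .E .S .W) =
      (weightV θ : ℂ) * Complex.exp ((((-(5 * π / 8) : ℝ)) : ℂ) * Complex.I) := by
  have hcs : ((chordSign .N .E .S : ℤ) : ℂ) = 1 := by
    rw [show chordSign .N .E .S = 1 by decide]; simp
  rw [backBracket_N_E_S_W, phase, hcs]
  have f : Complex.exp ((((-(5 / 8 * (θ - π))) : ℝ) : ℂ) * Complex.I) * Complex.exp ((((5 * θ / 8 - 5 * π / 4 : ℝ)) : ℂ) * Complex.I) = Complex.exp ((((-(5 * π / 8) : ℝ)) : ℂ) * Complex.I) := by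
    rw [cexp_mul_cexpR]; exact cexp_I_eq_of_intR _ _ (0) (by push_cast; ring)
  linear_combination (weightV θ : ℂ) * f

/-- Cell SE, first side `N`, class `{E, W}`: `phase(WP)·ε·backBracket = v(θ)·e^{i(3 * θ / 8 - 7 * π / 8)}` (private: the same
identity recurs at every cell with the same pinned turning; the public form is `dir_term_SE`). [cite: Glazman2015WeightedSAW, Lemma 3.1, eq. (1) (the weight v(θ))] [cite: GlazmanManolescu2019, Lemma 2.1 (proof: [Gl])] -/
private theorem dir_term_SE_N_E_W (θ : ℝ) :
    phase (θ - π) * ((chordSign .N .E .W : ℂ) * backBracket θ .N .E .W .S) =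
      (weightV θ : ℂ) * Complex.exp ((((3 * θ / 8 - 7 * π / 8 : ℝ)) : ℂ) * Complex.I) := by
  have hcs : ((chordSign .N .E .W : ℤ) : ℂ) = 1 := by
    rw [show chordSign .N .E .W = 1 by decide]; simp
  rw [backBracket_N_E_W_S, phase, hcs]
  have f : Complex.I * (Complex.exp ((((-(5 / 8 * (θ - π))) : ℝ) : ℂ) * Complex.I) * Complex.exp ((θ : ℂ) * Complex.I)) = Complex.exp ((((3 * θ / 8 - 7 * π / 8 : ℝ)) : ℂ) * Complex.I) := by
    rw [cexp_mul_cexpR, I_mul_cexpR]; exact cexp_I_eq_of_intR _ _ (1) (by push_cast; ring)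
  linear_combination (weightV θ : ℂ) * f

/-- Cell SE, first side `N`, class `{W, S}`: `phase(WP)·ε·backBracket = v(θ)·e^{i(-(3 * π / 4))}` (private: the same
identity recurs at every cell with the same pinned turning; the public form is `dir_term_SE`). [cite: Glazman2015WeightedSAW, Lemma 3.1, eq. (1) (the weight v(θ))] [cite: GlazmanManolescu2019, Lemma 2.1 (proof: [Gl])] -/
private theorem dir_term_SE_N_W_S (θ : ℝ) :
    phase (θ - π) * ((chordSign .N .W .S : ℂ) * backBracket θ .N .W .S .E) =
      (weightV θ : ℂ) * Complex.exp ((((-(3 * π / 4) : ℝ)) : ℂ) * Complex.I) := by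
  have hcs : ((chordSign .N .W .S : ℤ) : ℂ) = -1 := by
    rw [show chordSign .N .W .S = -1 by decide]; simp
  rw [backBracket_N_W_S_E, phase, hcs]
  have f : Complex.exp ((((-(5 / 8 * (θ - π))) : ℝ) : ℂ) * Complex.I) * Complex.exp ((((5 * θ / 8 + 5 * π / 8 : ℝ)) : ℂ) * Complex.I) = Complex.exp ((((-(3 * π / 4) : ℝ)) : ℂ) * Complex.I) := by
    rw [cexp_mul_cexpR]; exact cexp_I_eq_of_intR _ _ (1) (by push_cast; ring)
  linear_combination (weightV θ : ℂ) * f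

/-- Cell SE, first side `E`, class `{S, W}`: `phase(WP)·ε·backBracket = v(θ)·e^{i(3 * θ / 8 + π)}` (private: the same
identity recurs at every cell with the same pinned turning; the public form is `dir_term_SE`). [cite: Glazman2015WeightedSAW, Lemma 3.1, eq. (1) (the weight v(θ))] [cite: GlazmanManolescu2019, Lemma 2.1 (proof: [Gl])] -/
private theorem dir_term_SE_E_S_W (θ : ℝ) :
    phase (-π) * ((chordSign .E .S .W : ℂ) * backBracket θ .E .S .W .N) =
      (weightV θ : ℂ) * Complex.exp ((((3 * θ / 8 + π : ℝ)) : ℂ) * Complex.I) := by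
  have hcs : ((chordSign .E .S .W : ℤ) : ℂ) = 1 := by
    rw [show chordSign .E .S .W = 1 by decide]; simp
  rw [backBracket_E_S_W_N, phase, hcs]
  have f : -(Complex.exp ((((-(5 / 8 * (-π))) : ℝ) : ℂ) * Complex.I) * Complex.exp ((((3 * θ / 8 - 5 * π / 8 : ℝ)) : ℂ) * Complex.I)) = Complex.exp ((((3 * θ / 8 + π : ℝ)) : ℂ) * Complex.I) := by
    rw [cexp_mul_cexpR, neg_cexpR]; exact cexp_I_eq_of_intR _ _ (0) (by push_cast; ring)
  linear_combination (weightV θ : ℂ) * f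

/-- Cell SE, first side `S`, class `{E, N}`: `phase(WP)·ε·backBracket = v(θ)·e^{i(3 * π / 8)}` (private: the same
identity recurs at every cell with the same pinned turning; the public form is `dir_term_SE`). [cite: Glazman2015WeightedSAW, Lemma 3.1, eq. (1) (the weight v(θ))] [cite: GlazmanManolescu2019, Lemma 2.1 (proof: [Gl])] -/
private theorem dir_term_SE_S_E_N (θ : ℝ) :
    phase (θ + 2 * π) * ((chordSign .S .E .N : ℂ) * backBracket θ .S .E .N .W) =
      (weightV θ : ℂ) * Complex.exp ((((3 * π / 8 : ℝ)) : ℂ) * Complex.I) := by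
  have hcs : ((chordSign .S .E .N : ℤ) : ℂ) = -1 := by
    rw [show chordSign .S .E .N = -1 by decide]; simp
  rw [backBracket_S_E_N_W, phase, hcs]
  have f : -(Complex.exp ((((-(5 / 8 * (θ + 2 * π))) : ℝ) : ℂ) * Complex.I) * Complex.exp ((((5 * θ / 8 + 5 * π / 8 : ℝ)) : ℂ) * Complex.I)) = Complex.exp ((((3 * π / 8 : ℝ)) : ℂ) * Complex.I) := by
    rw [cexp_mul_cexpR, neg_cexpR]; exact cexp_I_eq_of_intR _ _ (0) (by push_cast; ring)
  linear_combination (weightV θ : ℂ) * f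

/-- Cell SE, first side `W`, class `{E, N}`: `phase(WP)·ε·backBracket = v(θ)·e^{i(3 * θ / 8 + π / 8)}` (private: the same
identity recurs at every cell with the same pinned turning; the public form is `dir_term_SE`). [cite: Glazman2015WeightedSAW, Lemma 3.1, eq. (1) (the weight v(θ))] [cite: GlazmanManolescu2019, Lemma 2.1 (proof: [Gl])] -/
private theorem dir_term_SE_W_E_N (θ : ℝ) :
    phase (2 * π) * ((chordSign .W .E .N : ℂ) * backBracket θ .W .E .N .S) =
      (weightV θ : ℂ) * Complex.exp ((((3 * θ / 8 + π / 8 : ℝ)) : ℂ) * Complex.I) := by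
  have hcs : ((chordSign .W .E .N : ℤ) : ℂ) = -1 := by
    rw [show chordSign .W .E .N = -1 by decide]; simp
  rw [backBracket_W_E_N_S, phase, hcs]
  have f : -(Complex.I * (Complex.exp ((((-(5 / 8 * (2 * π))) : ℝ) : ℂ) * Complex.I) * Complex.exp ((((3 * θ / 8 - π / 8 : ℝ)) : ℂ) * Complex.I))) = Complex.exp ((((3 * θ / 8 + π / 8 : ℝ)) : ℂ) * Complex.I) := by
    rw [cexp_mul_cexpR, I_mul_cexpR, neg_cexpR]; exact cexp_I_eq_of_intR _ _ (0) (by push_cast; ring)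
  linear_combination (weightV θ : ℂ) * f

/-- Cell SE, first side `W`, class `{S, N}`: `phase(WP)·ε·backBracket = v(θ)·e^{i(π / 4)}` (private: the same
identity recurs at every cell with the same pinned turning; the public form is `dir_term_SE`). [cite: Glazman2015WeightedSAW, Lemma 3.1, eq. (1) (the weight v(θ))] [cite: GlazmanManolescu2019, Lemma 2.1 (proof: [Gl])] -/
private theorem dir_term_SE_W_S_N (θ : ℝ) :
    phase (2 * π) * ((chordSign .W .S .N : ℂ) * backBracket θ .W .S .N .E) =
      (weightV θ : ℂ) * Complex.exp ((((π / 4 : ℝ)) : ℂ) * Complex.I) := by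
  have hcs : ((chordSign .W .S .N : ℤ) : ℂ) = -1 := by
    rw [show chordSign .W .S .N = -1 by decide]; simp
  rw [backBracket_W_S_N_E, phase, hcs]
  have f : -(Complex.I * Complex.exp ((((-(5 / 8 * (2 * π))) : ℝ) : ℂ) * Complex.I)) = Complex.exp ((((π / 4 : ℝ)) : ℂ) * Complex.I) := by
    rw [I_mul_cexpR, neg_cexpR]; exact cexp_I_eq_of_intR _ _ (0) (by push_cast; ring)
  linear_combination (weightV θ : ℂ) * f

/-- Cell SE, first side `W`, class `{E, S}`: `phase(WP)·ε·backBracket = v(θ)·e^{i(3 * θ / 8)}` (private: the same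
identity recurs at every cell with the same pinned turning; the public form is `dir_term_SE`). [cite: Glazman2015WeightedSAW, Lemma 3.1, eq. (1) (the weight v(θ))] [cite: GlazmanManolescu2019, Lemma 2.1 (proof: [Gl])] -/
private theorem dir_term_SE_W_E_S (θ : ℝ) :
    phase (2 * π) * ((chordSign .W .E .S : ℂ) * backBracket θ .W .E .S .N) =
      (weightV θ : ℂ) * Complex.exp ((((3 * θ / 8 : ℝ)) : ℂ) * Complex.I) := by
  have hcs : ((chordSign .W .E .S : ℤ) : ℂ) = 1 := by
    rw [show chordSign .W .E .S = 1 by decide]; simp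
  rw [backBracket_W_E_S_N, phase, hcs]
  have f : -(Complex.I * (Complex.exp ((((-(5 / 8 * (2 * π))) : ℝ) : ℂ) * Complex.I) * Complex.exp ((((3 * θ / 8 - π / 4 : ℝ)) : ℂ) * Complex.I))) = Complex.exp ((((3 * θ / 8 : ℝ)) : ℂ) * Complex.I) := by
    rw [cexp_mul_cexpR, I_mul_cexpR, neg_cexpR]; exact cexp_I_eq_of_intR _ _ (0) (by push_cast; ring)
  linear_combination (weightV θ : ℂ) * f

/-- The directly listed realizable patterns at cell SE. [folklore] -/
def dirPatternsSE : List (Side × Side × Side) := [(.N, .E, .S), (.N, .E, .W), (.N, .W, .S), (.E, .S, .W), (.S, .E, .N), (.W, .E, .N), (.W, .S, .N), (.W, .E, .S)]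

/-- ★ The class term algebra at cell SE, listed patterns. [cite: GlazmanManolescu2019, Lemma 2.1 (statement, "in the form given in [Gl]")] [cite: Glazman2015WeightedSAW, Lemma 3.1, eq. (1) (the weight v(θ))] -/
theorem dir_term_SE_of_mem (θ : ℝ) {z₀ z₁ z₂ z₃ : Side} (hmem : (z₀, z₁, z₂) ∈ dirPatternsSE)
    (h3 : z₃ ≠ z₀ ∧ z₃ ≠ z₁ ∧ z₃ ≠ z₂) :
    phase (turnAtSE θ z₀) * ((chordSign z₀ z₁ z₂ : ℂ) * backBracket θ z₀ z₁ z₂ z₃) = (weightV θ : ℂ) * dirSE θ z₀ z₁ z₂ := by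
  obtain ⟨h3a, h3b, h3c⟩ := h3
  simp only [dirPatternsSE, List.mem_cons, Prod.mk.injEq, List.mem_nil_iff, or_false] at hmem
  rcases hmem with ⟨rfl, rfl, rfl⟩ | ⟨rfl, rfl, rfl⟩ | ⟨rfl, rfl, rfl⟩ | ⟨rfl, rfl, rfl⟩ | ⟨rfl, rfl, rfl⟩ | ⟨rfl, rfl, rfl⟩ | ⟨rfl, rfl, rfl⟩ | ⟨rfl, rfl, rfl⟩
  · obtain rfl : z₃ = .W := by revert h3a h3b h3c; cases z₃ <;> simp
    exact dir_term_SE_N_E_S θ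
  · obtain rfl : z₃ = .S := by revert h3a h3b h3c; cases z₃ <;> simp
    exact dir_term_SE_N_E_W θ
  · obtain rfl : z₃ = .E := by revert h3a h3b h3c; cases z₃ <;> simp
    exact dir_term_SE_N_W_S θ
  · obtain rfl : z₃ = .N := by revert h3a h3b h3c; cases z₃ <;> simp
    exact dir_term_SE_E_S_W θ
  · obtain rfl : z₃ = .W := by revert h3a h3b h3c; cases z₃ <;> simp
    exact dir_term_SE_S_E_N θ
  · obtain rfl : z₃ = .S := by revert h3a h3b h3c; cases z₃ <;> simp
    exact dir_term_SE_W_E_N θ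
  · obtain rfl : z₃ = .E := by revert h3a h3b h3c; cases z₃ <;> simp
    exact dir_term_SE_W_S_N θ
  · obtain rfl : z₃ = .N := by revert h3a h3b h3c; cases z₃ <;> simp
    exact dir_term_SE_W_E_S θ

/-- Every non-excluded pattern at cell SE is listed directly or reversed. [folklore] -/
private theorem dirPatternsSE_cover : ∀ a b c : Side, a ≠ b → a ≠ c → b ≠ c →
    (a, b, c) ∈ dirPatternsSE ∨ (a, c, b) ∈ dirPatternsSE ∨ (a = .E ∧ (b = .N ∨ c = .N)) ∨ (a = .S ∧ (b = .W ∨ c = .W)) := by decide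

/-- ★★ **The class term algebra at cell SE, all realizable patterns.** [cite: GlazmanManolescu2019, Lemma 2.1 (statement, "in the form given in [Gl]")] [cite: Glazman2015WeightedSAW, Lemma 3.1, eq. (1) (the weight v(θ))] -/
theorem dir_term_SE (θ : ℝ) {z₀ z₁ z₂ z₃ : Side} (h01 : z₀ ≠ z₁) (h02 : z₀ ≠ z₂) (h12 : z₁ ≠ z₂)
    (h3 : z₃ ≠ z₀ ∧ z₃ ≠ z₁ ∧ z₃ ≠ z₂) (hEx : z₀ = .E → z₁ ≠ .N ∧ z₂ ≠ .N) (hSx : z₀ = .S → z₁ ≠ .W ∧ z₂ ≠ .W) :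
    phase (turnAtSE θ z₀) * ((chordSign z₀ z₁ z₂ : ℂ) * backBracket θ z₀ z₁ z₂ z₃) = (weightV θ : ℂ) * dirSE θ z₀ z₁ z₂ := by
  rcases dirPatternsSE_cover _ _ _ h01 h02 h12 with hd | hd | hx | hx
  · exact dir_term_SE_of_mem θ hd h3
  · rw [← ΩG.chordSign_mul_backBracket_swap θ h01 h02 (Ne.symm h3.1) h12 (Ne.symm h3.2.1) (Ne.symm h3.2.2),
      ← dirSE_swap]
    exact dir_term_SE_of_mem θ hd ⟨h3.1, h3.2.2, h3.2.1⟩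
  · rcases hx.2 with e | e
    · exact absurd e (hEx hx.1).1
    · exact absurd e (hEx hx.1).2
  · rcases hx.2 with e | e
    · exact absurd e (hSx hx.1).1
    · exact absurd e (hSx hx.1).2

/-- The realizable class directions at cell SE have modulus `1`. [cite: Glazman2015WeightedSAW, Lemma 3.1, eq. (1) (the weight v(θ))] -/
theorem norm_dirSE {θ : ℝ} {z₀ z₁ z₂ : Side} (h01 : z₀ ≠ z₁) (h02 : z₀ ≠ z₂) (h12 : z₁ ≠ z₂) (hEx : z₀ = .E → z₁ ≠ .N ∧ z₂ ≠ .N) (hSx : z₀ = .S → z₁ ≠ .W ∧ z₂ ≠ .W) :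
    ‖dirSE θ z₀ z₁ z₂‖ = 1 := by
  cases z₀ <;> cases z₁ <;> cases z₂ <;> simp only [dirSE] <;>
    first
    | exact absurd rfl h01
    | exact absurd rfl h02
    | exact absurd rfl h12
    | exact absurd rfl (hEx rfl).1
    | exact absurd rfl (hEx rfl).2
    | exact absurd rfl (hSx rfl).1
    | exact absurd rfl (hSx rfl).2
    | exact Complex.norm_exp_ofReal_mul_I _

end LawSE

/-! ### Cones at cell SE -/

section ConeSE

/-- ★ **The `N/E` cone at cell SE**: after rotation by `e^{i(3 * π / 4)}` every class direction of a walk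
that entered from `N` or `E` has positive real part (`θ ∈ [π/3, 2π/3]`). [cite: Glazman2015WeightedSAW, Lemma 3.1, eq. (1) (the weight v(θ))] -/
theorem re_rot_dirSE_pos_NE {θ : ℝ} (hθ : θ ∈ Set.Icc (π / 3) (2 * π / 3)) {z₀ z₁ z₂ : Side}
    (h01 : z₀ ≠ z₁) (h02 : z₀ ≠ z₂) (h12 : z₁ ≠ z₂) (hEx : z₀ = .E → z₁ ≠ .N ∧ z₂ ≠ .N) (hSx : z₀ = .S → z₁ ≠ .W ∧ z₂ ≠ .W) (hz : z₀ = .N ∨ z₀ = .E) :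
    0 < (Complex.exp ((((3 * π / 4 : ℝ)) : ℂ) * Complex.I) * dirSE θ z₀ z₁ z₂).re := by
  have hπ := Real.pi_pos
  obtain ⟨h1, h2⟩ := hθ
  have c1 : 0 < (Complex.exp ((((3 * π / 4 : ℝ)) : ℂ) * Complex.I) * Complex.exp ((((-(5 * π / 8) : ℝ)) : ℂ) * Complex.I)).re := by
    rw [re_cexp_mul_cexpR]; exact Real.cos_pos_of_mem_Ioo ⟨by linarith, by linarith⟩
  have c2 : 0 < (Complex.exp ((((3 * π / 4 : ℝ)) : ℂ) * Complex.I) * Complex.exp ((((3 * θ / 8 - 7 * π / 8 : ℝ)) : ℂ) * Complex.I)).re := by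
    rw [re_cexp_mul_cexpR]; exact Real.cos_pos_of_mem_Ioo ⟨by linarith, by linarith⟩
  have c3 : 0 < (Complex.exp ((((3 * π / 4 : ℝ)) : ℂ) * Complex.I) * Complex.exp ((((-(3 * π / 4) : ℝ)) : ℂ) * Complex.I)).re := by
    rw [re_cexp_mul_cexpR]; exact Real.cos_pos_of_mem_Ioo ⟨by linarith, by linarith⟩
  have c4 : 0 < (Complex.exp ((((3 * π / 4 : ℝ)) : ℂ) * Complex.I) * Complex.exp ((((3 * θ / 8 + π : ℝ)) : ℂ) * Complex.I)).re := by
    rw [re_cexp_mul_cexpR, show (3 * π / 4 : ℝ) + (3 * θ / 8 + π) = (3 * θ / 8 - π / 4) + ((1 : ℤ) : ℝ) * (2 * π) by push_cast; ring,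
      Real.cos_add_int_mul_two_pi]
    exact Real.cos_pos_of_mem_Ioo ⟨by linarith, by linarith⟩
  cases z₀ <;> cases z₁ <;> cases z₂ <;> simp only [dirSE] <;>
    first
    | exact absurd rfl h01
    | exact absurd rfl h02
    | exact absurd rfl h12
    | exact absurd rfl (hEx rfl).1
    | exact absurd rfl (hEx rfl).2
    | exact absurd rfl (hSx rfl).1
    | exact absurd rfl (hSx rfl).2
    | (exfalso; rcases hz with e | e <;> exact absurd e (by decide))
    | exact c1
    | exact c2
    | exact c3
    | exact c4

/-- ★ **The `S/W` cone at cell SE**: after rotation by `e^{i(-(π / 4))}` every class direction of a walk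
that entered from `S` or `W` has positive real part (`θ ∈ [π/3, 2π/3]`). [cite: Glazman2015WeightedSAW, Lemma 3.1, eq. (1) (the weight v(θ))] -/
theorem re_rot_dirSE_pos_SW {θ : ℝ} (hθ : θ ∈ Set.Icc (π / 3) (2 * π / 3)) {z₀ z₁ z₂ : Side}
    (h01 : z₀ ≠ z₁) (h02 : z₀ ≠ z₂) (h12 : z₁ ≠ z₂) (hEx : z₀ = .E → z₁ ≠ .N ∧ z₂ ≠ .N) (hSx : z₀ = .S → z₁ ≠ .W ∧ z₂ ≠ .W) (hz : z₀ = .S ∨ z₀ = .W) :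
    0 < (Complex.exp ((((-(π / 4) : ℝ)) : ℂ) * Complex.I) * dirSE θ z₀ z₁ z₂).re := by
  have hπ := Real.pi_pos
  obtain ⟨h1, h2⟩ := hθ
  have c1 : 0 < (Complex.exp ((((-(π / 4) : ℝ)) : ℂ) * Complex.I) * Complex.exp ((((3 * π / 8 : ℝ)) : ℂ) * Complex.I)).re := by
    rw [re_cexp_mul_cexpR]; exact Real.cos_pos_of_mem_Ioo ⟨by linarith, by linarith⟩
  have c2 : 0 < (Complex.exp ((((-(π / 4) : ℝ)) : ℂ) * Complex.I) * Complex.exp ((((3 * θ / 8 + π / 8 : ℝ)) : ℂ) * Complex.I)).re := by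
    rw [re_cexp_mul_cexpR]; exact Real.cos_pos_of_mem_Ioo ⟨by linarith, by linarith⟩
  have c3 : 0 < (Complex.exp ((((-(π / 4) : ℝ)) : ℂ) * Complex.I) * Complex.exp ((((π / 4 : ℝ)) : ℂ) * Complex.I)).re := by
    rw [re_cexp_mul_cexpR]; exact Real.cos_pos_of_mem_Ioo ⟨by linarith, by linarith⟩
  have c4 : 0 < (Complex.exp ((((-(π / 4) : ℝ)) : ℂ) * Complex.I) * Complex.exp ((((3 * θ / 8 : ℝ)) : ℂ) * Complex.I)).re := by
    rw [re_cexp_mul_cexpR]; exact Real.cos_pos_of_mem_Ioo ⟨by linarith, by linarith⟩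
  cases z₀ <;> cases z₁ <;> cases z₂ <;> simp only [dirSE] <;>
    first
    | exact absurd rfl h01
    | exact absurd rfl h02
    | exact absurd rfl h12
    | exact absurd rfl (hEx rfl).1
    | exact absurd rfl (hEx rfl).2
    | exact absurd rfl (hSx rfl).1
    | exact absurd rfl (hSx rfl).2
    | (exfalso; rcases hz with e | e <;> exact absurd e (by decide))
    | exact c1
    | exact c2
    | exact c3
    | exact c4

end ConeSE

namespace ΩG

section ClassTermSE

variable {D : Set Face} {w : Face}

open Classical in
/-- **The class term of a walk at cell SE**: for a WOUND class-`B2a` walk, its exterior weight times its class direction;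
else `0`. [cite: GlazmanManolescu2019, Lemma 2.1 (statement, "in the form given in [Gl]")] [cite: Glazman2015WeightedSAW, Lemma 3.1 (proof, pp. 6–7)] -/
noncomputable def classTermSE (θ : ℝ) (hr : RootedFace D (w.side .W) (rootS w)) (ω : ΩG D (w.side .W) (rootS w)) : ℂ :=
  if h : ω.IsB2a then
    (if ω.WE (fun _ => θ) ≠ excursionWinding θ ω.2.firstSideG (ω.z1 hr h) ω.1 then
      (ω.2.extWeight (fun _ => θ) (rootS w) : ℂ) * dirSE θ ω.2.firstSideG (ω.z1 hr h) ω.1 else 0)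
  else 0

/-- ★★★ **THE CLASS TERM AT CELL SE IS EXPLICIT**: `classTerm = v(θ) · classTermSE`. [cite: GlazmanManolescu2019, Lemma 2.1 (statement, "in the form given in [Gl]")] [cite: Glazman2015WeightedSAW, Lemma 3.1 (proof, pp. 6–7)] [cite: Hopf1935, Nr. 2 (Umlaufsatz, p. 53) and Nr. 4 eq. (22) (curves with corners, pp. 60–61)] -/
theorem classTerm_SE (hh : holeFaceW w ∉ D) {θ : ℝ} (ω : ΩG D (w.side .W) (rootS w))
    (hr : RootedFace D (w.side .W) (rootS w)) (h : ω.IsB2a) :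
    ω.classTerm (fun _ => θ) hr = (weightV θ : ℂ) * classTermSE θ hr ω := by
  rcases ω.classTerm_dichotomy hr h θ with ⟨hWE, h0⟩ | ⟨hWE, hct⟩
  · rw [h0, classTermSE, dif_pos h, if_neg (fun H => H hWE)]; simp
  · obtain ⟨hz01, hz02, hz12⟩ := ω.firstSide_exit_return_distinct hr h
    have h3 := ω.z₃_spec hr h
    obtain ⟨hx1, hx2⟩ := SE_entry_exit_exclusion hh hr h
    have hWP : ω.WP (fun _ => θ) = turnAtSE θ ω.2.firstSideG := by
      obtain ⟨hN, hE, hS, hW⟩ := WP_SE_eq_of_wound hh hr h θ hWE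
      rcases hz : ω.2.firstSideG with _ | _ | _ | _
      · rw [hW hz]; rfl
      · rw [hE hz]; rfl
      · rw [hS hz]; rfl
      · rw [hN hz]; rfl
    rw [hct, classTermSE, dif_pos h, if_pos hWE, hWP, mul_assoc, mul_assoc,
      dir_term_SE θ hz01 hz02 hz12 ⟨h3.1, h3.2.1, h3.2.2⟩ hx1 hx2]
    ring

/-- The modulus of the class term of a class-`B2a` walk at cell SE is at most its exterior weight. [cite: GlazmanManolescu2019, eq. (1) (the weights are non-negative)] -/
theorem norm_classTermSE_le (hh : holeFaceW w ∉ D) {θ : ℝ} (hθ : θ ∈ Set.Icc (π / 3) (2 * π / 3))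
    (hr : RootedFace D (w.side .W) (rootS w)) (ω : ΩG D (w.side .W) (rootS w)) (h : ω.IsB2a) :
    ‖classTermSE θ hr ω‖ ≤ ω.2.extWeight (fun _ => θ) (rootS w) := by
  have hext : 0 ≤ ω.2.extWeight (fun _ => θ) (rootS w) := Finset.prod_nonneg fun _ _ => localWeight_nonneg hθ _
  unfold classTermSE
  rw [dif_pos h]
  split_ifs with hWE
  · obtain ⟨hz01, hz02, hz12⟩ := ω.firstSide_exit_return_distinct hr h
    obtain ⟨hx1, hx2⟩ := SE_entry_exit_exclusion hh hr h
    rw [norm_mul, norm_dirSE hz01 hz02 hz12 hx1 hx2, mul_one, Complex.norm_real, Real.norm_eq_abs, abs_of_nonneg hext]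
  · simpa using hext


/-- ★ The rotated class term at cell SE of a wound walk entering from `N` or `E` has positive real part;
an unwound walk contributes `0`. [cite: GlazmanManolescu2019, Lemma 2.1 (statement, "in the form given in [Gl]")] [cite: Glazman2015WeightedSAW, Lemma 3.1, eq. (1) (the weight v(θ))] -/
theorem re_rot_classTermSE_NE (hh : holeFaceW w ∉ D) {θ : ℝ} (hθ : θ ∈ Set.Ioo (π / 3) (2 * π / 3))
    (hr : RootedFace D (w.side .W) (rootS w)) (ω : ΩG D (w.side .W) (rootS w)) (h : ω.IsB2a) (hz : ω.2.firstSideG = .N ∨ ω.2.firstSideG = .E) :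
    0 ≤ (Complex.exp ((((3 * π / 4 : ℝ)) : ℂ) * Complex.I) * classTermSE θ hr ω).re ∧
      (ω.WE (fun _ => θ) ≠ excursionWinding θ ω.2.firstSideG (ω.z1 hr h) ω.1 →
        0 < (Complex.exp ((((3 * π / 4 : ℝ)) : ℂ) * Complex.I) * classTermSE θ hr ω).re) := by
  have hθ' : θ ∈ Set.Icc (π / 3) (2 * π / 3) := Set.Ioo_subset_Icc_self hθ
  obtain ⟨hz01, hz02, hz12⟩ := ω.firstSide_exit_return_distinct hr h
  obtain ⟨hx1, hx2⟩ := SE_entry_exit_exclusion hh hr h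
  have hext : 0 < ω.2.extWeight (fun _ => θ) (rootS w) := Finset.prod_pos fun g _ => localWeight_kindsIn_posR hθ ω.2 g
  have hdir := re_rot_dirSE_pos_NE hθ' hz01 hz02 hz12 hx1 hx2 hz
  have key : ∀ hw : ω.WE (fun _ => θ) ≠ excursionWinding θ ω.2.firstSideG (ω.z1 hr h) ω.1,
      (Complex.exp ((((3 * π / 4 : ℝ)) : ℂ) * Complex.I) * classTermSE θ hr ω).re =
        ω.2.extWeight (fun _ => θ) (rootS w) *
          (Complex.exp ((((3 * π / 4 : ℝ)) : ℂ) * Complex.I) * dirSE θ ω.2.firstSideG (ω.z1 hr h) ω.1).re := by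
    intro hw
    rw [classTermSE, dif_pos h, if_pos hw, show Complex.exp ((((3 * π / 4 : ℝ)) : ℂ) * Complex.I) *
        ((ω.2.extWeight (fun _ => θ) (rootS w) : ℂ) * dirSE θ ω.2.firstSideG (ω.z1 hr h) ω.1) =
        (ω.2.extWeight (fun _ => θ) (rootS w) : ℂ) *
          (Complex.exp ((((3 * π / 4 : ℝ)) : ℂ) * Complex.I) * dirSE θ ω.2.firstSideG (ω.z1 hr h) ω.1) by ring,
      Complex.re_ofReal_mul]
  constructor
  · by_cases hw : ω.WE (fun _ => θ) ≠ excursionWinding θ ω.2.firstSideG (ω.z1 hr h) ω.1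
    · rw [key hw]; exact (mul_pos hext hdir).le
    · rw [classTermSE, dif_pos h, if_neg hw, mul_zero, Complex.zero_re]
  · intro hw
    rw [key hw]; exact mul_pos hext hdir

/-- ★ The rotated class term at cell SE of a wound walk entering from `S` or `W` has positive real part;
an unwound walk contributes `0`. [cite: GlazmanManolescu2019, Lemma 2.1 (statement, "in the form given in [Gl]")] [cite: Glazman2015WeightedSAW, Lemma 3.1, eq. (1) (the weight v(θ))] -/
theorem re_rot_classTermSE_SW (hh : holeFaceW w ∉ D) {θ : ℝ} (hθ : θ ∈ Set.Ioo (π / 3) (2 * π / 3))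
    (hr : RootedFace D (w.side .W) (rootS w)) (ω : ΩG D (w.side .W) (rootS w)) (h : ω.IsB2a) (hz : ω.2.firstSideG = .S ∨ ω.2.firstSideG = .W) :
    0 ≤ (Complex.exp ((((-(π / 4) : ℝ)) : ℂ) * Complex.I) * classTermSE θ hr ω).re ∧
      (ω.WE (fun _ => θ) ≠ excursionWinding θ ω.2.firstSideG (ω.z1 hr h) ω.1 →
        0 < (Complex.exp ((((-(π / 4) : ℝ)) : ℂ) * Complex.I) * classTermSE θ hr ω).re) := by
  have hθ' : θ ∈ Set.Icc (π / 3) (2 * π / 3) := Set.Ioo_subset_Icc_self hθ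
  obtain ⟨hz01, hz02, hz12⟩ := ω.firstSide_exit_return_distinct hr h
  obtain ⟨hx1, hx2⟩ := SE_entry_exit_exclusion hh hr h
  have hext : 0 < ω.2.extWeight (fun _ => θ) (rootS w) := Finset.prod_pos fun g _ => localWeight_kindsIn_posR hθ ω.2 g
  have hdir := re_rot_dirSE_pos_SW hθ' hz01 hz02 hz12 hx1 hx2 hz
  have key : ∀ hw : ω.WE (fun _ => θ) ≠ excursionWinding θ ω.2.firstSideG (ω.z1 hr h) ω.1,
      (Complex.exp ((((-(π / 4) : ℝ)) : ℂ) * Complex.I) * classTermSE θ hr ω).re =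
        ω.2.extWeight (fun _ => θ) (rootS w) *
          (Complex.exp ((((-(π / 4) : ℝ)) : ℂ) * Complex.I) * dirSE θ ω.2.firstSideG (ω.z1 hr h) ω.1).re := by
    intro hw
    rw [classTermSE, dif_pos h, if_pos hw, show Complex.exp ((((-(π / 4) : ℝ)) : ℂ) * Complex.I) *
        ((ω.2.extWeight (fun _ => θ) (rootS w) : ℂ) * dirSE θ ω.2.firstSideG (ω.z1 hr h) ω.1) =
        (ω.2.extWeight (fun _ => θ) (rootS w) : ℂ) *
          (Complex.exp ((((-(π / 4) : ℝ)) : ℂ) * Complex.I) * dirSE θ ω.2.firstSideG (ω.z1 hr h) ω.1) by ring,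
      Complex.re_ofReal_mul]
  constructor
  · by_cases hw : ω.WE (fun _ => θ) ≠ excursionWinding θ ω.2.firstSideG (ω.z1 hr h) ω.1
    · rw [key hw]; exact (mul_pos hext hdir).le
    · rw [classTermSE, dif_pos h, if_neg hw, mul_zero, Complex.zero_re]
  · intro hw
    rw [key hw]; exact mul_pos hext hdir

variable [Finite D]

/-- ★★ The grouped sum at cell SE. [cite: GlazmanManolescu2019, Lemma 2.1 (statement, "in the form given in [Gl]")] [cite: Glazman2015WeightedSAW, Lemma 3.1 (proof, pp. 6–7)] -/
theorem sum_classTerm_SE (hh : holeFaceW w ∉ D) {θ : ℝ} (hr : RootedFace D (w.side .W) (rootS w)) :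
    ∑ ω ∈ setB2a D (w.side .W) (rootS w), ω.classTerm (fun _ => θ) hr =
      (weightV θ : ℂ) * ∑ ω ∈ setB2a D (w.side .W) (rootS w), classTermSE θ hr ω := by
  rw [Finset.mul_sum]
  refine Finset.sum_congr rfl fun ω hω => ?_
  simp only [setB2a, Finset.mem_filter, Finset.mem_univ, true_and] at hω
  exact ω.classTerm_SE hh hr hω

end ClassTermSE

end ΩG

/-! ## § Cell NE — the cell north of the root plaquette (`NE` of the hole): class directions and the cell law -/

section LawNE

/-- **The class directions at cell NE** (symmetric in exit/return; junk `0` on the excluded and degenerate patterns):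
`N`: {E,S} ↦ `e^{i(5 * π / 8)}`; `E`: {N,W} ↦ `e^{i(3 * θ / 8 - 3 * π / 8)}`; `S`: {W,N} ↦ `e^{i(-(π / 4))}`; `S`: {E,N} ↦ `e^{i(-(3 * π / 8))}`; `S`: {W,E} ↦ `e^{i(3 * θ / 8 - π / 2)}`; `W`: {E,N} ↦ `e^{i(3 * θ / 8 + 5 * π / 8)}`; `W`: {S,N} ↦ `e^{i(3 * π / 4)}`; `W`: {E,S} ↦ `e^{i(3 * θ / 8 + π / 2)}`. [cite: GlazmanManolescu2019, Lemma 2.1 (statement, "in the form given in [Gl]")] [cite: Glazman2015WeightedSAW, Lemma 3.1, eq. (1) (the weight v(θ))] -/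
def dirNE (θ : ℝ) : Side → Side → Side → ℂ
  | .N, .E, .S => Complex.exp ((((5 * π / 8 : ℝ)) : ℂ) * Complex.I)
  | .N, .S, .E => Complex.exp ((((5 * π / 8 : ℝ)) : ℂ) * Complex.I)
  | .E, .N, .W => Complex.exp ((((3 * θ / 8 - 3 * π / 8 : ℝ)) : ℂ) * Complex.I)
  | .E, .W, .N => Complex.exp ((((3 * θ / 8 - 3 * π / 8 : ℝ)) : ℂ) * Complex.I)
  | .S, .W, .N => Complex.exp ((((-(π / 4) : ℝ)) : ℂ) * Complex.I)
  | .S, .N, .W => Complex.exp ((((-(π / 4) : ℝ)) : ℂ) * Complex.I)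
  | .S, .E, .N => Complex.exp ((((-(3 * π / 8) : ℝ)) : ℂ) * Complex.I)
  | .S, .N, .E => Complex.exp ((((-(3 * π / 8) : ℝ)) : ℂ) * Complex.I)
  | .S, .W, .E => Complex.exp ((((3 * θ / 8 - π / 2 : ℝ)) : ℂ) * Complex.I)
  | .S, .E, .W => Complex.exp ((((3 * θ / 8 - π / 2 : ℝ)) : ℂ) * Complex.I)
  | .W, .E, .N => Complex.exp ((((3 * θ / 8 + 5 * π / 8 : ℝ)) : ℂ) * Complex.I)
  | .W, .N, .E => Complex.exp ((((3 * θ / 8 + 5 * π / 8 : ℝ)) : ℂ) * Complex.I)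
  | .W, .S, .N => Complex.exp ((((3 * π / 4 : ℝ)) : ℂ) * Complex.I)
  | .W, .N, .S => Complex.exp ((((3 * π / 4 : ℝ)) : ℂ) * Complex.I)
  | .W, .E, .S => Complex.exp ((((3 * θ / 8 + π / 2 : ℝ)) : ℂ) * Complex.I)
  | .W, .S, .E => Complex.exp ((((3 * θ / 8 + π / 2 : ℝ)) : ℂ) * Complex.I)
  | _, _, _ => 0

/-- The class directions at cell NE are symmetric in the exit and return sides. [folklore] -/
private theorem dirNE_swap (θ : ℝ) (z₀ z₁ z₂ : Side) : dirNE θ z₀ z₂ z₁ = dirNE θ z₀ z₁ z₂ := by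
  cases z₀ <;> cases z₁ <;> cases z₂ <;> rfl

/-- The prefix turning at angle `θ` at cell NE, by first side (junk `0` on sides that do not occur). [cite: GlazmanManolescu2019, Lemma 2.1 (proof: [Gl])] -/
def turnAtNE (θ : ℝ) : Side → ℝ
  | .N => θ - 3 * π
  | .E => π
  | .S => θ
  | .W => -(2 * π)

/-- Cell NE, first side `N`, class `{E, S}`: `phase(WP)·ε·backBracket = v(θ)·e^{i(5 * π / 8)}` (private: the same
identity recurs at every cell with the same pinned turning; the public form is `dir_term_NE`). [cite: Glazman2015WeightedSAW, Lemma 3.1, eq. (1) (the weight v(θ))] [cite: GlazmanManolescu2019, Lemma 2.1 (proof: [Gl])] -/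
private theorem dir_term_NE_N_E_S (θ : ℝ) :
    phase (θ - 3 * π) * ((chordSign .N .E .S : ℂ) * backBracket θ .N .E .S .W) =
      (weightV θ : ℂ) * Complex.exp ((((5 * π / 8 : ℝ)) : ℂ) * Complex.I) := by
  have hcs : ((chordSign .N .E .S : ℤ) : ℂ) = 1 := by
    rw [show chordSign .N .E .S = 1 by decide]; simp
  rw [backBracket_N_E_S_W, phase, hcs]
  have f : Complex.exp ((((-(5 / 8 * (θ - 3 * π))) : ℝ) : ℂ) * Complex.I) * Complex.exp ((((5 * θ / 8 - 5 * π / 4 : ℝ)) : ℂ) * Complex.I) = Complex.exp ((((5 * π / 8 : ℝ)) : ℂ) * Complex.I) := by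
    rw [cexp_mul_cexpR]; exact cexp_I_eq_of_intR _ _ (0) (by push_cast; ring)
  linear_combination (weightV θ : ℂ) * f

/-- Cell NE, first side `E`, class `{N, W}`: `phase(WP)·ε·backBracket = v(θ)·e^{i(3 * θ / 8 - 3 * π / 8)}` (private: the same
identity recurs at every cell with the same pinned turning; the public form is `dir_term_NE`). [cite: Glazman2015WeightedSAW, Lemma 3.1, eq. (1) (the weight v(θ))] [cite: GlazmanManolescu2019, Lemma 2.1 (proof: [Gl])] -/
private theorem dir_term_NE_E_N_W (θ : ℝ) :
    phase (π) * ((chordSign .E .N .W : ℂ) * backBracket θ .E .N .W .S) =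
      (weightV θ : ℂ) * Complex.exp ((((3 * θ / 8 - 3 * π / 8 : ℝ)) : ℂ) * Complex.I) := by
  have hcs : ((chordSign .E .N .W : ℤ) : ℂ) = -1 := by
    rw [show chordSign .E .N .W = -1 by decide]; simp
  rw [backBracket_E_N_W_S, phase, hcs]
  have f : -(Complex.exp ((((-(5 / 8 * (π))) : ℝ) : ℂ) * Complex.I) * Complex.exp ((((3 * θ / 8 + 5 * π / 4 : ℝ)) : ℂ) * Complex.I)) = Complex.exp ((((3 * θ / 8 - 3 * π / 8 : ℝ)) : ℂ) * Complex.I) := by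
    rw [cexp_mul_cexpR, neg_cexpR]; exact cexp_I_eq_of_intR _ _ (1) (by push_cast; ring)
  linear_combination (weightV θ : ℂ) * f

/-- Cell NE, first side `S`, class `{W, N}`: `phase(WP)·ε·backBracket = v(θ)·e^{i(-(π / 4))}` (private: the same
identity recurs at every cell with the same pinned turning; the public form is `dir_term_NE`). [cite: Glazman2015WeightedSAW, Lemma 3.1, eq. (1) (the weight v(θ))] [cite: GlazmanManolescu2019, Lemma 2.1 (proof: [Gl])] -/
private theorem dir_term_NE_S_W_N (θ : ℝ) :
    phase (θ) * ((chordSign .S .W .N : ℂ) * backBracket θ .S .W .N .E) =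
      (weightV θ : ℂ) * Complex.exp ((((-(π / 4) : ℝ)) : ℂ) * Complex.I) := by
  have hcs : ((chordSign .S .W .N : ℤ) : ℂ) = 1 := by
    rw [show chordSign .S .W .N = 1 by decide]; simp
  rw [backBracket_S_W_N_E, phase, hcs]
  have f : -(Complex.exp ((((-(5 / 8 * (θ))) : ℝ) : ℂ) * Complex.I) * Complex.exp ((((5 * θ / 8 - 5 * π / 4 : ℝ)) : ℂ) * Complex.I)) = Complex.exp ((((-(π / 4) : ℝ)) : ℂ) * Complex.I) := by
    rw [cexp_mul_cexpR, neg_cexpR]; exact cexp_I_eq_of_intR _ _ (0) (by push_cast; ring)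
  linear_combination (weightV θ : ℂ) * f

/-- Cell NE, first side `S`, class `{E, N}`: `phase(WP)·ε·backBracket = v(θ)·e^{i(-(3 * π / 8))}` (private: the same
identity recurs at every cell with the same pinned turning; the public form is `dir_term_NE`). [cite: Glazman2015WeightedSAW, Lemma 3.1, eq. (1) (the weight v(θ))] [cite: GlazmanManolescu2019, Lemma 2.1 (proof: [Gl])] -/
private theorem dir_term_NE_S_E_N (θ : ℝ) :
    phase (θ) * ((chordSign .S .E .N : ℂ) * backBracket θ .S .E .N .W) =
      (weightV θ : ℂ) * Complex.exp ((((-(3 * π / 8) : ℝ)) : ℂ) * Complex.I) := by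
  have hcs : ((chordSign .S .E .N : ℤ) : ℂ) = -1 := by
    rw [show chordSign .S .E .N = -1 by decide]; simp
  rw [backBracket_S_E_N_W, phase, hcs]
  have f : -(Complex.exp ((((-(5 / 8 * (θ))) : ℝ) : ℂ) * Complex.I) * Complex.exp ((((5 * θ / 8 + 5 * π / 8 : ℝ)) : ℂ) * Complex.I)) = Complex.exp ((((-(3 * π / 8) : ℝ)) : ℂ) * Complex.I) := by
    rw [cexp_mul_cexpR, neg_cexpR]; exact cexp_I_eq_of_intR _ _ (1) (by push_cast; ring)
  linear_combination (weightV θ : ℂ) * f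

/-- Cell NE, first side `S`, class `{W, E}`: `phase(WP)·ε·backBracket = v(θ)·e^{i(3 * θ / 8 - π / 2)}` (private: the same
identity recurs at every cell with the same pinned turning; the public form is `dir_term_NE`). [cite: Glazman2015WeightedSAW, Lemma 3.1, eq. (1) (the weight v(θ))] [cite: GlazmanManolescu2019, Lemma 2.1 (proof: [Gl])] -/
private theorem dir_term_NE_S_W_E (θ : ℝ) :
    phase (θ) * ((chordSign .S .W .E : ℂ) * backBracket θ .S .W .E .N) =
      (weightV θ : ℂ) * Complex.exp ((((3 * θ / 8 - π / 2 : ℝ)) : ℂ) * Complex.I) := by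
  have hcs : ((chordSign .S .W .E : ℤ) : ℂ) = 1 := by
    rw [show chordSign .S .W .E = 1 by decide]; simp
  rw [backBracket_S_W_E_N, phase, hcs]
  have f : -(Complex.I * (Complex.exp ((((-(5 / 8 * (θ))) : ℝ) : ℂ) * Complex.I) * Complex.exp ((θ : ℂ) * Complex.I))) = Complex.exp ((((3 * θ / 8 - π / 2 : ℝ)) : ℂ) * Complex.I) := by
    rw [cexp_mul_cexpR, I_mul_cexpR, neg_cexpR]; exact cexp_I_eq_of_intR _ _ (1) (by push_cast; ring)
  linear_combination (weightV θ : ℂ) * f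

/-- Cell NE, first side `W`, class `{E, N}`: `phase(WP)·ε·backBracket = v(θ)·e^{i(3 * θ / 8 + 5 * π / 8)}` (private: the same
identity recurs at every cell with the same pinned turning; the public form is `dir_term_NE`). [cite: Glazman2015WeightedSAW, Lemma 3.1, eq. (1) (the weight v(θ))] [cite: GlazmanManolescu2019, Lemma 2.1 (proof: [Gl])] -/
private theorem dir_term_NE_W_E_N (θ : ℝ) :
    phase (-(2 * π)) * ((chordSign .W .E .N : ℂ) * backBracket θ .W .E .N .S) =
      (weightV θ : ℂ) * Complex.exp ((((3 * θ / 8 + 5 * π / 8 : ℝ)) : ℂ) * Complex.I) := by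
  have hcs : ((chordSign .W .E .N : ℤ) : ℂ) = -1 := by
    rw [show chordSign .W .E .N = -1 by decide]; simp
  rw [backBracket_W_E_N_S, phase, hcs]
  have f : -(Complex.I * (Complex.exp ((((-(5 / 8 * (-(2 * π)))) : ℝ) : ℂ) * Complex.I) * Complex.exp ((((3 * θ / 8 - π / 8 : ℝ)) : ℂ) * Complex.I))) = Complex.exp ((((3 * θ / 8 + 5 * π / 8 : ℝ)) : ℂ) * Complex.I) := by
    rw [cexp_mul_cexpR, I_mul_cexpR, neg_cexpR]; exact cexp_I_eq_of_intR _ _ (1) (by push_cast; ring)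
  linear_combination (weightV θ : ℂ) * f

/-- Cell NE, first side `W`, class `{S, N}`: `phase(WP)·ε·backBracket = v(θ)·e^{i(3 * π / 4)}` (private: the same
identity recurs at every cell with the same pinned turning; the public form is `dir_term_NE`). [cite: Glazman2015WeightedSAW, Lemma 3.1, eq. (1) (the weight v(θ))] [cite: GlazmanManolescu2019, Lemma 2.1 (proof: [Gl])] -/
private theorem dir_term_NE_W_S_N (θ : ℝ) :
    phase (-(2 * π)) * ((chordSign .W .S .N : ℂ) * backBracket θ .W .S .N .E) =
      (weightV θ : ℂ) * Complex.exp ((((3 * π / 4 : ℝ)) : ℂ) * Complex.I) := by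
  have hcs : ((chordSign .W .S .N : ℤ) : ℂ) = -1 := by
    rw [show chordSign .W .S .N = -1 by decide]; simp
  rw [backBracket_W_S_N_E, phase, hcs]
  have f : -(Complex.I * Complex.exp ((((-(5 / 8 * (-(2 * π)))) : ℝ) : ℂ) * Complex.I)) = Complex.exp ((((3 * π / 4 : ℝ)) : ℂ) * Complex.I) := by
    rw [I_mul_cexpR, neg_cexpR]; exact cexp_I_eq_of_intR _ _ (1) (by push_cast; ring)
  linear_combination (weightV θ : ℂ) * f

/-- Cell NE, first side `W`, class `{E, S}`: `phase(WP)·ε·backBracket = v(θ)·e^{i(3 * θ / 8 + π / 2)}` (private: the same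
identity recurs at every cell with the same pinned turning; the public form is `dir_term_NE`). [cite: Glazman2015WeightedSAW, Lemma 3.1, eq. (1) (the weight v(θ))] [cite: GlazmanManolescu2019, Lemma 2.1 (proof: [Gl])] -/
private theorem dir_term_NE_W_E_S (θ : ℝ) :
    phase (-(2 * π)) * ((chordSign .W .E .S : ℂ) * backBracket θ .W .E .S .N) =
      (weightV θ : ℂ) * Complex.exp ((((3 * θ / 8 + π / 2 : ℝ)) : ℂ) * Complex.I) := by
  have hcs : ((chordSign .W .E .S : ℤ) : ℂ) = 1 := by
    rw [show chordSign .W .E .S = 1 by decide]; simp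
  rw [backBracket_W_E_S_N, phase, hcs]
  have f : -(Complex.I * (Complex.exp ((((-(5 / 8 * (-(2 * π)))) : ℝ) : ℂ) * Complex.I) * Complex.exp ((((3 * θ / 8 - π / 4 : ℝ)) : ℂ) * Complex.I))) = Complex.exp ((((3 * θ / 8 + π / 2 : ℝ)) : ℂ) * Complex.I) := by
    rw [cexp_mul_cexpR, I_mul_cexpR, neg_cexpR]; exact cexp_I_eq_of_intR _ _ (1) (by push_cast; ring)
  linear_combination (weightV θ : ℂ) * f

/-- The directly listed realizable patterns at cell NE. [folklore] -/
def dirPatternsNE : List (Side × Side × Side) := [(.N, .E, .S), (.E, .N, .W), (.S, .W, .N), (.S, .E, .N), (.S, .W, .E), (.W, .E, .N), (.W, .S, .N), (.W, .E, .S)]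

/-- ★ The class term algebra at cell NE, listed patterns. [cite: GlazmanManolescu2019, Lemma 2.1 (statement, "in the form given in [Gl]")] [cite: Glazman2015WeightedSAW, Lemma 3.1, eq. (1) (the weight v(θ))] -/
theorem dir_term_NE_of_mem (θ : ℝ) {z₀ z₁ z₂ z₃ : Side} (hmem : (z₀, z₁, z₂) ∈ dirPatternsNE)
    (h3 : z₃ ≠ z₀ ∧ z₃ ≠ z₁ ∧ z₃ ≠ z₂) :
    phase (turnAtNE θ z₀) * ((chordSign z₀ z₁ z₂ : ℂ) * backBracket θ z₀ z₁ z₂ z₃) = (weightV θ : ℂ) * dirNE θ z₀ z₁ z₂ := by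
  obtain ⟨h3a, h3b, h3c⟩ := h3
  simp only [dirPatternsNE, List.mem_cons, Prod.mk.injEq, List.mem_nil_iff, or_false] at hmem
  rcases hmem with ⟨rfl, rfl, rfl⟩ | ⟨rfl, rfl, rfl⟩ | ⟨rfl, rfl, rfl⟩ | ⟨rfl, rfl, rfl⟩ | ⟨rfl, rfl, rfl⟩ | ⟨rfl, rfl, rfl⟩ | ⟨rfl, rfl, rfl⟩ | ⟨rfl, rfl, rfl⟩
  · obtain rfl : z₃ = .W := by revert h3a h3b h3c; cases z₃ <;> simp
    exact dir_term_NE_N_E_S θ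
  · obtain rfl : z₃ = .S := by revert h3a h3b h3c; cases z₃ <;> simp
    exact dir_term_NE_E_N_W θ
  · obtain rfl : z₃ = .E := by revert h3a h3b h3c; cases z₃ <;> simp
    exact dir_term_NE_S_W_N θ
  · obtain rfl : z₃ = .W := by revert h3a h3b h3c; cases z₃ <;> simp
    exact dir_term_NE_S_E_N θ
  · obtain rfl : z₃ = .N := by revert h3a h3b h3c; cases z₃ <;> simp
    exact dir_term_NE_S_W_E θ
  · obtain rfl : z₃ = .S := by revert h3a h3b h3c; cases z₃ <;> simp
    exact dir_term_NE_W_E_N θ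
  · obtain rfl : z₃ = .E := by revert h3a h3b h3c; cases z₃ <;> simp
    exact dir_term_NE_W_S_N θ
  · obtain rfl : z₃ = .N := by revert h3a h3b h3c; cases z₃ <;> simp
    exact dir_term_NE_W_E_S θ

/-- Every non-excluded pattern at cell NE is listed directly or reversed. [folklore] -/
private theorem dirPatternsNE_cover : ∀ a b c : Side, a ≠ b → a ≠ c → b ≠ c →
    (a, b, c) ∈ dirPatternsNE ∨ (a, c, b) ∈ dirPatternsNE ∨ (a = .E ∧ (b = .S ∨ c = .S)) ∨ (a = .N ∧ (b = .W ∨ c = .W)) := by decide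

/-- ★★ **The class term algebra at cell NE, all realizable patterns.** [cite: GlazmanManolescu2019, Lemma 2.1 (statement, "in the form given in [Gl]")] [cite: Glazman2015WeightedSAW, Lemma 3.1, eq. (1) (the weight v(θ))] -/
theorem dir_term_NE (θ : ℝ) {z₀ z₁ z₂ z₃ : Side} (h01 : z₀ ≠ z₁) (h02 : z₀ ≠ z₂) (h12 : z₁ ≠ z₂)
    (h3 : z₃ ≠ z₀ ∧ z₃ ≠ z₁ ∧ z₃ ≠ z₂) (hEx : z₀ = .E → z₁ ≠ .S ∧ z₂ ≠ .S) (hNx : z₀ = .N → z₁ ≠ .W ∧ z₂ ≠ .W) :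
    phase (turnAtNE θ z₀) * ((chordSign z₀ z₁ z₂ : ℂ) * backBracket θ z₀ z₁ z₂ z₃) = (weightV θ : ℂ) * dirNE θ z₀ z₁ z₂ := by
  rcases dirPatternsNE_cover _ _ _ h01 h02 h12 with hd | hd | hx | hx
  · exact dir_term_NE_of_mem θ hd h3
  · rw [← ΩG.chordSign_mul_backBracket_swap θ h01 h02 (Ne.symm h3.1) h12 (Ne.symm h3.2.1) (Ne.symm h3.2.2),
      ← dirNE_swap]
    exact dir_term_NE_of_mem θ hd ⟨h3.1, h3.2.2, h3.2.1⟩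
  · rcases hx.2 with e | e
    · exact absurd e (hEx hx.1).1
    · exact absurd e (hEx hx.1).2
  · rcases hx.2 with e | e
    · exact absurd e (hNx hx.1).1
    · exact absurd e (hNx hx.1).2

/-- The realizable class directions at cell NE have modulus `1`. [cite: Glazman2015WeightedSAW, Lemma 3.1, eq. (1) (the weight v(θ))] -/
theorem norm_dirNE {θ : ℝ} {z₀ z₁ z₂ : Side} (h01 : z₀ ≠ z₁) (h02 : z₀ ≠ z₂) (h12 : z₁ ≠ z₂) (hEx : z₀ = .E → z₁ ≠ .S ∧ z₂ ≠ .S) (hNx : z₀ = .N → z₁ ≠ .W ∧ z₂ ≠ .W) :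
    ‖dirNE θ z₀ z₁ z₂‖ = 1 := by
  cases z₀ <;> cases z₁ <;> cases z₂ <;> simp only [dirNE] <;>
    first
    | exact absurd rfl h01
    | exact absurd rfl h02
    | exact absurd rfl h12
    | exact absurd rfl (hEx rfl).1
    | exact absurd rfl (hEx rfl).2
    | exact absurd rfl (hNx rfl).1
    | exact absurd rfl (hNx rfl).2
    | exact Complex.norm_exp_ofReal_mul_I _

end LawNE

/-! ### Cones at cell NE -/

section ConeNE

/-- ★ **The `S/E` cone at cell NE**: after rotation by `e^{i(π / 4)}` every class direction of a walk
that entered from `S` or `E` has positive real part (`θ ∈ [π/3, 2π/3]`). [cite: Glazman2015WeightedSAW, Lemma 3.1, eq. (1) (the weight v(θ))] -/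
theorem re_rot_dirNE_pos_SE {θ : ℝ} (hθ : θ ∈ Set.Icc (π / 3) (2 * π / 3)) {z₀ z₁ z₂ : Side}
    (h01 : z₀ ≠ z₁) (h02 : z₀ ≠ z₂) (h12 : z₁ ≠ z₂) (hEx : z₀ = .E → z₁ ≠ .S ∧ z₂ ≠ .S) (hNx : z₀ = .N → z₁ ≠ .W ∧ z₂ ≠ .W) (hz : z₀ = .S ∨ z₀ = .E) :
    0 < (Complex.exp ((((π / 4 : ℝ)) : ℂ) * Complex.I) * dirNE θ z₀ z₁ z₂).re := by
  have hπ := Real.pi_pos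
  obtain ⟨h1, h2⟩ := hθ
  have c1 : 0 < (Complex.exp ((((π / 4 : ℝ)) : ℂ) * Complex.I) * Complex.exp ((((-(π / 4) : ℝ)) : ℂ) * Complex.I)).re := by
    rw [re_cexp_mul_cexpR]; exact Real.cos_pos_of_mem_Ioo ⟨by linarith, by linarith⟩
  have c2 : 0 < (Complex.exp ((((π / 4 : ℝ)) : ℂ) * Complex.I) * Complex.exp ((((-(3 * π / 8) : ℝ)) : ℂ) * Complex.I)).re := by
    rw [re_cexp_mul_cexpR]; exact Real.cos_pos_of_mem_Ioo ⟨by linarith, by linarith⟩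
  have c3 : 0 < (Complex.exp ((((π / 4 : ℝ)) : ℂ) * Complex.I) * Complex.exp ((((3 * θ / 8 - π / 2 : ℝ)) : ℂ) * Complex.I)).re := by
    rw [re_cexp_mul_cexpR]; exact Real.cos_pos_of_mem_Ioo ⟨by linarith, by linarith⟩
  have c4 : 0 < (Complex.exp ((((π / 4 : ℝ)) : ℂ) * Complex.I) * Complex.exp ((((3 * θ / 8 - 3 * π / 8 : ℝ)) : ℂ) * Complex.I)).re := by
    rw [re_cexp_mul_cexpR]; exact Real.cos_pos_of_mem_Ioo ⟨by linarith, by linarith⟩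
  cases z₀ <;> cases z₁ <;> cases z₂ <;> simp only [dirNE] <;>
    first
    | exact absurd rfl h01
    | exact absurd rfl h02
    | exact absurd rfl h12
    | exact absurd rfl (hEx rfl).1
    | exact absurd rfl (hEx rfl).2
    | exact absurd rfl (hNx rfl).1
    | exact absurd rfl (hNx rfl).2
    | (exfalso; rcases hz with e | e <;> exact absurd e (by decide))
    | exact c1
    | exact c2
    | exact c3
    | exact c4

/-- ★ **The `N/W` cone at cell NE**: after rotation by `e^{i(-(3 * π / 4))}` every class direction of a walk
that entered from `N` or `W` has positive real part (`θ ∈ [π/3, 2π/3]`). [cite: Glazman2015WeightedSAW, Lemma 3.1, eq. (1) (the weight v(θ))] -/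
theorem re_rot_dirNE_pos_NW {θ : ℝ} (hθ : θ ∈ Set.Icc (π / 3) (2 * π / 3)) {z₀ z₁ z₂ : Side}
    (h01 : z₀ ≠ z₁) (h02 : z₀ ≠ z₂) (h12 : z₁ ≠ z₂) (hEx : z₀ = .E → z₁ ≠ .S ∧ z₂ ≠ .S) (hNx : z₀ = .N → z₁ ≠ .W ∧ z₂ ≠ .W) (hz : z₀ = .N ∨ z₀ = .W) :
    0 < (Complex.exp ((((-(3 * π / 4) : ℝ)) : ℂ) * Complex.I) * dirNE θ z₀ z₁ z₂).re := by
  have hπ := Real.pi_pos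
  obtain ⟨h1, h2⟩ := hθ
  have c1 : 0 < (Complex.exp ((((-(3 * π / 4) : ℝ)) : ℂ) * Complex.I) * Complex.exp ((((5 * π / 8 : ℝ)) : ℂ) * Complex.I)).re := by
    rw [re_cexp_mul_cexpR]; exact Real.cos_pos_of_mem_Ioo ⟨by linarith, by linarith⟩
  have c2 : 0 < (Complex.exp ((((-(3 * π / 4) : ℝ)) : ℂ) * Complex.I) * Complex.exp ((((3 * θ / 8 + 5 * π / 8 : ℝ)) : ℂ) * Complex.I)).re := by
    rw [re_cexp_mul_cexpR]; exact Real.cos_pos_of_mem_Ioo ⟨by linarith, by linarith⟩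
  have c3 : 0 < (Complex.exp ((((-(3 * π / 4) : ℝ)) : ℂ) * Complex.I) * Complex.exp ((((3 * π / 4 : ℝ)) : ℂ) * Complex.I)).re := by
    rw [re_cexp_mul_cexpR]; exact Real.cos_pos_of_mem_Ioo ⟨by linarith, by linarith⟩
  have c4 : 0 < (Complex.exp ((((-(3 * π / 4) : ℝ)) : ℂ) * Complex.I) * Complex.exp ((((3 * θ / 8 + π / 2 : ℝ)) : ℂ) * Complex.I)).re := by
    rw [re_cexp_mul_cexpR]; exact Real.cos_pos_of_mem_Ioo ⟨by linarith, by linarith⟩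
  cases z₀ <;> cases z₁ <;> cases z₂ <;> simp only [dirNE] <;>
    first
    | exact absurd rfl h01
    | exact absurd rfl h02
    | exact absurd rfl h12
    | exact absurd rfl (hEx rfl).1
    | exact absurd rfl (hEx rfl).2
    | exact absurd rfl (hNx rfl).1
    | exact absurd rfl (hNx rfl).2
    | (exfalso; rcases hz with e | e <;> exact absurd e (by decide))
    | exact c1
    | exact c2
    | exact c3
    | exact c4

end ConeNE

namespace ΩG

section ClassTermNE

variable {D : Set Face} {w : Face}

open Classical in
/-- **The class term of a walk at cell NE**: for a WOUND class-`B2a` walk, its exterior weight times its class direction;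
else `0`. [cite: GlazmanManolescu2019, Lemma 2.1 (statement, "in the form given in [Gl]")] [cite: Glazman2015WeightedSAW, Lemma 3.1 (proof, pp. 6–7)] -/
noncomputable def classTermNE (θ : ℝ) (hr : RootedFace D (w.side .W) (rootN w)) (ω : ΩG D (w.side .W) (rootN w)) : ℂ :=
  if h : ω.IsB2a then
    (if ω.WE (fun _ => θ) ≠ excursionWinding θ ω.2.firstSideG (ω.z1 hr h) ω.1 then
      (ω.2.extWeight (fun _ => θ) (rootN w) : ℂ) * dirNE θ ω.2.firstSideG (ω.z1 hr h) ω.1 else 0)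
  else 0

/-- ★★★ **THE CLASS TERM AT CELL NE IS EXPLICIT**: `classTerm = v(θ) · classTermNE`. [cite: GlazmanManolescu2019, Lemma 2.1 (statement, "in the form given in [Gl]")] [cite: Glazman2015WeightedSAW, Lemma 3.1 (proof, pp. 6–7)] [cite: Hopf1935, Nr. 2 (Umlaufsatz, p. 53) and Nr. 4 eq. (22) (curves with corners, pp. 60–61)] -/
theorem classTerm_NE (hh : holeFaceW w ∉ D) {θ : ℝ} (ω : ΩG D (w.side .W) (rootN w))
    (hr : RootedFace D (w.side .W) (rootN w)) (h : ω.IsB2a) :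
    ω.classTerm (fun _ => θ) hr = (weightV θ : ℂ) * classTermNE θ hr ω := by
  rcases ω.classTerm_dichotomy hr h θ with ⟨hWE, h0⟩ | ⟨hWE, hct⟩
  · rw [h0, classTermNE, dif_pos h, if_neg (fun H => H hWE)]; simp
  · obtain ⟨hz01, hz02, hz12⟩ := ω.firstSide_exit_return_distinct hr h
    have h3 := ω.z₃_spec hr h
    obtain ⟨hx1, hx2⟩ := NE_entry_exit_exclusion hh hr h
    have hWP : ω.WP (fun _ => θ) = turnAtNE θ ω.2.firstSideG := by
      obtain ⟨hN, hE, hS, hW⟩ := WP_NE_eq_of_wound hh hr h θ hWE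
      rcases hz : ω.2.firstSideG with _ | _ | _ | _
      · rw [hW hz]; rfl
      · rw [hE hz]; rfl
      · rw [hS hz]; rfl
      · rw [hN hz]; rfl
    rw [hct, classTermNE, dif_pos h, if_pos hWE, hWP, mul_assoc, mul_assoc,
      dir_term_NE θ hz01 hz02 hz12 ⟨h3.1, h3.2.1, h3.2.2⟩ hx1 hx2]
    ring

/-- The modulus of the class term of a class-`B2a` walk at cell NE is at most its exterior weight. [cite: GlazmanManolescu2019, eq. (1) (the weights are non-negative)] -/
theorem norm_classTermNE_le (hh : holeFaceW w ∉ D) {θ : ℝ} (hθ : θ ∈ Set.Icc (π / 3) (2 * π / 3))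
    (hr : RootedFace D (w.side .W) (rootN w)) (ω : ΩG D (w.side .W) (rootN w)) (h : ω.IsB2a) :
    ‖classTermNE θ hr ω‖ ≤ ω.2.extWeight (fun _ => θ) (rootN w) := by
  have hext : 0 ≤ ω.2.extWeight (fun _ => θ) (rootN w) := Finset.prod_nonneg fun _ _ => localWeight_nonneg hθ _
  unfold classTermNE
  rw [dif_pos h]
  split_ifs with hWE
  · obtain ⟨hz01, hz02, hz12⟩ := ω.firstSide_exit_return_distinct hr h
    obtain ⟨hx1, hx2⟩ := NE_entry_exit_exclusion hh hr h
    rw [norm_mul, norm_dirNE hz01 hz02 hz12 hx1 hx2, mul_one, Complex.norm_real, Real.norm_eq_abs, abs_of_nonneg hext]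
  · simpa using hext


/-- ★ The rotated class term at cell NE of a wound walk entering from `S` or `E` has positive real part;
an unwound walk contributes `0`. [cite: GlazmanManolescu2019, Lemma 2.1 (statement, "in the form given in [Gl]")] [cite: Glazman2015WeightedSAW, Lemma 3.1, eq. (1) (the weight v(θ))] -/
theorem re_rot_classTermNE_SE (hh : holeFaceW w ∉ D) {θ : ℝ} (hθ : θ ∈ Set.Ioo (π / 3) (2 * π / 3))
    (hr : RootedFace D (w.side .W) (rootN w)) (ω : ΩG D (w.side .W) (rootN w)) (h : ω.IsB2a) (hz : ω.2.firstSideG = .S ∨ ω.2.firstSideG = .E) :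
    0 ≤ (Complex.exp ((((π / 4 : ℝ)) : ℂ) * Complex.I) * classTermNE θ hr ω).re ∧
      (ω.WE (fun _ => θ) ≠ excursionWinding θ ω.2.firstSideG (ω.z1 hr h) ω.1 →
        0 < (Complex.exp ((((π / 4 : ℝ)) : ℂ) * Complex.I) * classTermNE θ hr ω).re) := by
  have hθ' : θ ∈ Set.Icc (π / 3) (2 * π / 3) := Set.Ioo_subset_Icc_self hθ
  obtain ⟨hz01, hz02, hz12⟩ := ω.firstSide_exit_return_distinct hr h
  obtain ⟨hx1, hx2⟩ := NE_entry_exit_exclusion hh hr h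
  have hext : 0 < ω.2.extWeight (fun _ => θ) (rootN w) := Finset.prod_pos fun g _ => localWeight_kindsIn_posR hθ ω.2 g
  have hdir := re_rot_dirNE_pos_SE hθ' hz01 hz02 hz12 hx1 hx2 hz
  have key : ∀ hw : ω.WE (fun _ => θ) ≠ excursionWinding θ ω.2.firstSideG (ω.z1 hr h) ω.1,
      (Complex.exp ((((π / 4 : ℝ)) : ℂ) * Complex.I) * classTermNE θ hr ω).re =
        ω.2.extWeight (fun _ => θ) (rootN w) *
          (Complex.exp ((((π / 4 : ℝ)) : ℂ) * Complex.I) * dirNE θ ω.2.firstSideG (ω.z1 hr h) ω.1).re := by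
    intro hw
    rw [classTermNE, dif_pos h, if_pos hw, show Complex.exp ((((π / 4 : ℝ)) : ℂ) * Complex.I) *
        ((ω.2.extWeight (fun _ => θ) (rootN w) : ℂ) * dirNE θ ω.2.firstSideG (ω.z1 hr h) ω.1) =
        (ω.2.extWeight (fun _ => θ) (rootN w) : ℂ) *
          (Complex.exp ((((π / 4 : ℝ)) : ℂ) * Complex.I) * dirNE θ ω.2.firstSideG (ω.z1 hr h) ω.1) by ring,
      Complex.re_ofReal_mul]
  constructor
  · by_cases hw : ω.WE (fun _ => θ) ≠ excursionWinding θ ω.2.firstSideG (ω.z1 hr h) ω.1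
    · rw [key hw]; exact (mul_pos hext hdir).le
    · rw [classTermNE, dif_pos h, if_neg hw, mul_zero, Complex.zero_re]
  · intro hw
    rw [key hw]; exact mul_pos hext hdir

/-- ★ The rotated class term at cell NE of a wound walk entering from `N` or `W` has positive real part;
an unwound walk contributes `0`. [cite: GlazmanManolescu2019, Lemma 2.1 (statement, "in the form given in [Gl]")] [cite: Glazman2015WeightedSAW, Lemma 3.1, eq. (1) (the weight v(θ))] -/
theorem re_rot_classTermNE_NW (hh : holeFaceW w ∉ D) {θ : ℝ} (hθ : θ ∈ Set.Ioo (π / 3) (2 * π / 3))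
    (hr : RootedFace D (w.side .W) (rootN w)) (ω : ΩG D (w.side .W) (rootN w)) (h : ω.IsB2a) (hz : ω.2.firstSideG = .N ∨ ω.2.firstSideG = .W) :
    0 ≤ (Complex.exp ((((-(3 * π / 4) : ℝ)) : ℂ) * Complex.I) * classTermNE θ hr ω).re ∧
      (ω.WE (fun _ => θ) ≠ excursionWinding θ ω.2.firstSideG (ω.z1 hr h) ω.1 →
        0 < (Complex.exp ((((-(3 * π / 4) : ℝ)) : ℂ) * Complex.I) * classTermNE θ hr ω).re) := by
  have hθ' : θ ∈ Set.Icc (π / 3) (2 * π / 3) := Set.Ioo_subset_Icc_self hθ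
  obtain ⟨hz01, hz02, hz12⟩ := ω.firstSide_exit_return_distinct hr h
  obtain ⟨hx1, hx2⟩ := NE_entry_exit_exclusion hh hr h
  have hext : 0 < ω.2.extWeight (fun _ => θ) (rootN w) := Finset.prod_pos fun g _ => localWeight_kindsIn_posR hθ ω.2 g
  have hdir := re_rot_dirNE_pos_NW hθ' hz01 hz02 hz12 hx1 hx2 hz
  have key : ∀ hw : ω.WE (fun _ => θ) ≠ excursionWinding θ ω.2.firstSideG (ω.z1 hr h) ω.1,
      (Complex.exp ((((-(3 * π / 4) : ℝ)) : ℂ) * Complex.I) * classTermNE θ hr ω).re =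
        ω.2.extWeight (fun _ => θ) (rootN w) *
          (Complex.exp ((((-(3 * π / 4) : ℝ)) : ℂ) * Complex.I) * dirNE θ ω.2.firstSideG (ω.z1 hr h) ω.1).re := by
    intro hw
    rw [classTermNE, dif_pos h, if_pos hw, show Complex.exp ((((-(3 * π / 4) : ℝ)) : ℂ) * Complex.I) *
        ((ω.2.extWeight (fun _ => θ) (rootN w) : ℂ) * dirNE θ ω.2.firstSideG (ω.z1 hr h) ω.1) =
        (ω.2.extWeight (fun _ => θ) (rootN w) : ℂ) *
          (Complex.exp ((((-(3 * π / 4) : ℝ)) : ℂ) * Complex.I) * dirNE θ ω.2.firstSideG (ω.z1 hr h) ω.1) by ring,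
      Complex.re_ofReal_mul]
  constructor
  · by_cases hw : ω.WE (fun _ => θ) ≠ excursionWinding θ ω.2.firstSideG (ω.z1 hr h) ω.1
    · rw [key hw]; exact (mul_pos hext hdir).le
    · rw [classTermNE, dif_pos h, if_neg hw, mul_zero, Complex.zero_re]
  · intro hw
    rw [key hw]; exact mul_pos hext hdir

variable [Finite D]

/-- ★★ The grouped sum at cell NE. [cite: GlazmanManolescu2019, Lemma 2.1 (statement, "in the form given in [Gl]")] [cite: Glazman2015WeightedSAW, Lemma 3.1 (proof, pp. 6–7)] -/
theorem sum_classTerm_NE (hh : holeFaceW w ∉ D) {θ : ℝ} (hr : RootedFace D (w.side .W) (rootN w)) :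
    ∑ ω ∈ setB2a D (w.side .W) (rootN w), ω.classTerm (fun _ => θ) hr =
      (weightV θ : ℂ) * ∑ ω ∈ setB2a D (w.side .W) (rootN w), classTermNE θ hr ω := by
  rw [Finset.mul_sum]
  refine Finset.sum_congr rfl fun ω hω => ?_
  simp only [setB2a, Finset.mem_filter, Finset.mem_univ, true_and] at hω
  exact ω.classTerm_NE hh hr hω

end ClassTermNE

end ΩG

/-! ## § Cell NW — the `NW` diagonal cell of the hole: class directions and the cell law -/

section LawNW

/-- **The class directions at cell NW** (symmetric in exit/return; junk `0` on the excluded and degenerate patterns):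
`N`: {W,S} ↦ `e^{i(0)}`; `E`: {N,S} ↦ `e^{i(-(π / 8))}`; `E`: {N,W} ↦ `e^{i(3 * θ / 8 - 3 * π / 8)}`; `E`: {S,W} ↦ `e^{i(3 * θ / 8 - π / 4)}`; `S`: {E,N} ↦ `e^{i(7 * π / 8)}`; `S`: {W,N} ↦ `e^{i(π)}`; `S`: {W,E} ↦ `e^{i(3 * θ / 8 + 3 * π / 4)}`; `W`: {E,N} ↦ `e^{i(3 * θ / 8 + 5 * π / 8)}`. [cite: GlazmanManolescu2019, Lemma 2.1 (statement, "in the form given in [Gl]")] [cite: Glazman2015WeightedSAW, Lemma 3.1, eq. (1) (the weight v(θ))] -/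
def dirNW (θ : ℝ) : Side → Side → Side → ℂ
  | .N, .W, .S => Complex.exp ((((0 : ℝ)) : ℂ) * Complex.I)
  | .N, .S, .W => Complex.exp ((((0 : ℝ)) : ℂ) * Complex.I)
  | .E, .N, .S => Complex.exp ((((-(π / 8) : ℝ)) : ℂ) * Complex.I)
  | .E, .S, .N => Complex.exp ((((-(π / 8) : ℝ)) : ℂ) * Complex.I)
  | .E, .N, .W => Complex.exp ((((3 * θ / 8 - 3 * π / 8 : ℝ)) : ℂ) * Complex.I)
  | .E, .W, .N => Complex.exp ((((3 * θ / 8 - 3 * π / 8 : ℝ)) : ℂ) * Complex.I)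
  | .E, .S, .W => Complex.exp ((((3 * θ / 8 - π / 4 : ℝ)) : ℂ) * Complex.I)
  | .E, .W, .S => Complex.exp ((((3 * θ / 8 - π / 4 : ℝ)) : ℂ) * Complex.I)
  | .S, .E, .N => Complex.exp ((((7 * π / 8 : ℝ)) : ℂ) * Complex.I)
  | .S, .N, .E => Complex.exp ((((7 * π / 8 : ℝ)) : ℂ) * Complex.I)
  | .S, .W, .N => Complex.exp ((((π : ℝ)) : ℂ) * Complex.I)
  | .S, .N, .W => Complex.exp ((((π : ℝ)) : ℂ) * Complex.I)
  | .S, .W, .E => Complex.exp ((((3 * θ / 8 + 3 * π / 4 : ℝ)) : ℂ) * Complex.I)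
  | .S, .E, .W => Complex.exp ((((3 * θ / 8 + 3 * π / 4 : ℝ)) : ℂ) * Complex.I)
  | .W, .E, .N => Complex.exp ((((3 * θ / 8 + 5 * π / 8 : ℝ)) : ℂ) * Complex.I)
  | .W, .N, .E => Complex.exp ((((3 * θ / 8 + 5 * π / 8 : ℝ)) : ℂ) * Complex.I)
  | _, _, _ => 0

/-- The class directions at cell NW are symmetric in the exit and return sides. [folklore] -/
private theorem dirNW_swap (θ : ℝ) (z₀ z₁ z₂ : Side) : dirNW θ z₀ z₂ z₁ = dirNW θ z₀ z₁ z₂ := by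
  cases z₀ <;> cases z₁ <;> cases z₂ <;> rfl

/-- The prefix turning at angle `θ` at cell NW, by first side (junk `0` on sides that do not occur). [cite: GlazmanManolescu2019, Lemma 2.1 (proof: [Gl])] -/
def turnAtNW (θ : ℝ) : Side → ℝ
  | .N => θ + π
  | .E => π
  | .S => θ - 2 * π
  | .W => -(2 * π)

/-- Cell NW, first side `N`, class `{W, S}`: `phase(WP)·ε·backBracket = v(θ)·e^{i(0)}` (private: the same
identity recurs at every cell with the same pinned turning; the public form is `dir_term_NW`). [cite: Glazman2015WeightedSAW, Lemma 3.1, eq. (1) (the weight v(θ))] [cite: GlazmanManolescu2019, Lemma 2.1 (proof: [Gl])] -/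
private theorem dir_term_NW_N_W_S (θ : ℝ) :
    phase (θ + π) * ((chordSign .N .W .S : ℂ) * backBracket θ .N .W .S .E) =
      (weightV θ : ℂ) * Complex.exp ((((0 : ℝ)) : ℂ) * Complex.I) := by
  have hcs : ((chordSign .N .W .S : ℤ) : ℂ) = -1 := by
    rw [show chordSign .N .W .S = -1 by decide]; simp
  rw [backBracket_N_W_S_E, phase, hcs]
  have f : Complex.exp ((((-(5 / 8 * (θ + π))) : ℝ) : ℂ) * Complex.I) * Complex.exp ((((5 * θ / 8 + 5 * π / 8 : ℝ)) : ℂ) * Complex.I) = Complex.exp ((((0 : ℝ)) : ℂ) * Complex.I) := by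
    rw [cexp_mul_cexpR]; exact cexp_I_eq_of_intR _ _ (0) (by push_cast; ring)
  linear_combination (weightV θ : ℂ) * f

/-- Cell NW, first side `E`, class `{N, S}`: `phase(WP)·ε·backBracket = v(θ)·e^{i(-(π / 8))}` (private: the same
identity recurs at every cell with the same pinned turning; the public form is `dir_term_NW`). [cite: Glazman2015WeightedSAW, Lemma 3.1, eq. (1) (the weight v(θ))] [cite: GlazmanManolescu2019, Lemma 2.1 (proof: [Gl])] -/
private theorem dir_term_NW_E_N_S (θ : ℝ) :
    phase (π) * ((chordSign .E .N .S : ℂ) * backBracket θ .E .N .S .W) =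
      (weightV θ : ℂ) * Complex.exp ((((-(π / 8) : ℝ)) : ℂ) * Complex.I) := by
  have hcs : ((chordSign .E .N .S : ℤ) : ℂ) = -1 := by
    rw [show chordSign .E .N .S = -1 by decide]; simp
  rw [backBracket_E_N_S_W, phase, hcs]
  have f : Complex.I * Complex.exp ((((-(5 / 8 * (π))) : ℝ) : ℂ) * Complex.I) = Complex.exp ((((-(π / 8) : ℝ)) : ℂ) * Complex.I) := by
    rw [I_mul_cexpR]; exact cexp_I_eq_of_intR _ _ (0) (by push_cast; ring)
  linear_combination (weightV θ : ℂ) * f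

/-- Cell NW, first side `E`, class `{N, W}`: `phase(WP)·ε·backBracket = v(θ)·e^{i(3 * θ / 8 - 3 * π / 8)}` (private: the same
identity recurs at every cell with the same pinned turning; the public form is `dir_term_NW`). [cite: Glazman2015WeightedSAW, Lemma 3.1, eq. (1) (the weight v(θ))] [cite: GlazmanManolescu2019, Lemma 2.1 (proof: [Gl])] -/
private theorem dir_term_NW_E_N_W (θ : ℝ) :
    phase (π) * ((chordSign .E .N .W : ℂ) * backBracket θ .E .N .W .S) =
      (weightV θ : ℂ) * Complex.exp ((((3 * θ / 8 - 3 * π / 8 : ℝ)) : ℂ) * Complex.I) := by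
  have hcs : ((chordSign .E .N .W : ℤ) : ℂ) = -1 := by
    rw [show chordSign .E .N .W = -1 by decide]; simp
  rw [backBracket_E_N_W_S, phase, hcs]
  have f : -(Complex.exp ((((-(5 / 8 * (π))) : ℝ) : ℂ) * Complex.I) * Complex.exp ((((3 * θ / 8 + 5 * π / 4 : ℝ)) : ℂ) * Complex.I)) = Complex.exp ((((3 * θ / 8 - 3 * π / 8 : ℝ)) : ℂ) * Complex.I) := by
    rw [cexp_mul_cexpR, neg_cexpR]; exact cexp_I_eq_of_intR _ _ (1) (by push_cast; ring)
  linear_combination (weightV θ : ℂ) * f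

/-- Cell NW, first side `E`, class `{S, W}`: `phase(WP)·ε·backBracket = v(θ)·e^{i(3 * θ / 8 - π / 4)}` (private: the same
identity recurs at every cell with the same pinned turning; the public form is `dir_term_NW`). [cite: Glazman2015WeightedSAW, Lemma 3.1, eq. (1) (the weight v(θ))] [cite: GlazmanManolescu2019, Lemma 2.1 (proof: [Gl])] -/
private theorem dir_term_NW_E_S_W (θ : ℝ) :
    phase (π) * ((chordSign .E .S .W : ℂ) * backBracket θ .E .S .W .N) =
      (weightV θ : ℂ) * Complex.exp ((((3 * θ / 8 - π / 4 : ℝ)) : ℂ) * Complex.I) := by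
  have hcs : ((chordSign .E .S .W : ℤ) : ℂ) = 1 := by
    rw [show chordSign .E .S .W = 1 by decide]; simp
  rw [backBracket_E_S_W_N, phase, hcs]
  have f : -(Complex.exp ((((-(5 / 8 * (π))) : ℝ) : ℂ) * Complex.I) * Complex.exp ((((3 * θ / 8 - 5 * π / 8 : ℝ)) : ℂ) * Complex.I)) = Complex.exp ((((3 * θ / 8 - π / 4 : ℝ)) : ℂ) * Complex.I) := by
    rw [cexp_mul_cexpR, neg_cexpR]; exact cexp_I_eq_of_intR _ _ (0) (by push_cast; ring)
  linear_combination (weightV θ : ℂ) * f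

/-- Cell NW, first side `S`, class `{E, N}`: `phase(WP)·ε·backBracket = v(θ)·e^{i(7 * π / 8)}` (private: the same
identity recurs at every cell with the same pinned turning; the public form is `dir_term_NW`). [cite: Glazman2015WeightedSAW, Lemma 3.1, eq. (1) (the weight v(θ))] [cite: GlazmanManolescu2019, Lemma 2.1 (proof: [Gl])] -/
private theorem dir_term_NW_S_E_N (θ : ℝ) :
    phase (θ - 2 * π) * ((chordSign .S .E .N : ℂ) * backBracket θ .S .E .N .W) =
      (weightV θ : ℂ) * Complex.exp ((((7 * π / 8 : ℝ)) : ℂ) * Complex.I) := by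
  have hcs : ((chordSign .S .E .N : ℤ) : ℂ) = -1 := by
    rw [show chordSign .S .E .N = -1 by decide]; simp
  rw [backBracket_S_E_N_W, phase, hcs]
  have f : -(Complex.exp ((((-(5 / 8 * (θ - 2 * π))) : ℝ) : ℂ) * Complex.I) * Complex.exp ((((5 * θ / 8 + 5 * π / 8 : ℝ)) : ℂ) * Complex.I)) = Complex.exp ((((7 * π / 8 : ℝ)) : ℂ) * Complex.I) := by
    rw [cexp_mul_cexpR, neg_cexpR]; exact cexp_I_eq_of_intR _ _ (1) (by push_cast; ring)
  linear_combination (weightV θ : ℂ) * f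

/-- Cell NW, first side `S`, class `{W, N}`: `phase(WP)·ε·backBracket = v(θ)·e^{i(π)}` (private: the same
identity recurs at every cell with the same pinned turning; the public form is `dir_term_NW`). [cite: Glazman2015WeightedSAW, Lemma 3.1, eq. (1) (the weight v(θ))] [cite: GlazmanManolescu2019, Lemma 2.1 (proof: [Gl])] -/
private theorem dir_term_NW_S_W_N (θ : ℝ) :
    phase (θ - 2 * π) * ((chordSign .S .W .N : ℂ) * backBracket θ .S .W .N .E) =
      (weightV θ : ℂ) * Complex.exp ((((π : ℝ)) : ℂ) * Complex.I) := by
  have hcs : ((chordSign .S .W .N : ℤ) : ℂ) = 1 := by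
    rw [show chordSign .S .W .N = 1 by decide]; simp
  rw [backBracket_S_W_N_E, phase, hcs]
  have f : -(Complex.exp ((((-(5 / 8 * (θ - 2 * π))) : ℝ) : ℂ) * Complex.I) * Complex.exp ((((5 * θ / 8 - 5 * π / 4 : ℝ)) : ℂ) * Complex.I)) = Complex.exp ((((π : ℝ)) : ℂ) * Complex.I) := by
    rw [cexp_mul_cexpR, neg_cexpR]; exact cexp_I_eq_of_intR _ _ (0) (by push_cast; ring)
  linear_combination (weightV θ : ℂ) * f

/-- Cell NW, first side `S`, class `{W, E}`: `phase(WP)·ε·backBracket = v(θ)·e^{i(3 * θ / 8 + 3 * π / 4)}` (private: the same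
identity recurs at every cell with the same pinned turning; the public form is `dir_term_NW`). [cite: Glazman2015WeightedSAW, Lemma 3.1, eq. (1) (the weight v(θ))] [cite: GlazmanManolescu2019, Lemma 2.1 (proof: [Gl])] -/
private theorem dir_term_NW_S_W_E (θ : ℝ) :
    phase (θ - 2 * π) * ((chordSign .S .W .E : ℂ) * backBracket θ .S .W .E .N) =
      (weightV θ : ℂ) * Complex.exp ((((3 * θ / 8 + 3 * π / 4 : ℝ)) : ℂ) * Complex.I) := by
  have hcs : ((chordSign .S .W .E : ℤ) : ℂ) = 1 := by
    rw [show chordSign .S .W .E = 1 by decide]; simp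
  rw [backBracket_S_W_E_N, phase, hcs]
  have f : -(Complex.I * (Complex.exp ((((-(5 / 8 * (θ - 2 * π))) : ℝ) : ℂ) * Complex.I) * Complex.exp ((θ : ℂ) * Complex.I))) = Complex.exp ((((3 * θ / 8 + 3 * π / 4 : ℝ)) : ℂ) * Complex.I) := by
    rw [cexp_mul_cexpR, I_mul_cexpR, neg_cexpR]; exact cexp_I_eq_of_intR _ _ (1) (by push_cast; ring)
  linear_combination (weightV θ : ℂ) * f

/-- Cell NW, first side `W`, class `{E, N}`: `phase(WP)·ε·backBracket = v(θ)·e^{i(3 * θ / 8 + 5 * π / 8)}` (private: the same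
identity recurs at every cell with the same pinned turning; the public form is `dir_term_NW`). [cite: Glazman2015WeightedSAW, Lemma 3.1, eq. (1) (the weight v(θ))] [cite: GlazmanManolescu2019, Lemma 2.1 (proof: [Gl])] -/
private theorem dir_term_NW_W_E_N (θ : ℝ) :
    phase (-(2 * π)) * ((chordSign .W .E .N : ℂ) * backBracket θ .W .E .N .S) =
      (weightV θ : ℂ) * Complex.exp ((((3 * θ / 8 + 5 * π / 8 : ℝ)) : ℂ) * Complex.I) := by
  have hcs : ((chordSign .W .E .N : ℤ) : ℂ) = -1 := by
    rw [show chordSign .W .E .N = -1 by decide]; simp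
  rw [backBracket_W_E_N_S, phase, hcs]
  have f : -(Complex.I * (Complex.exp ((((-(5 / 8 * (-(2 * π)))) : ℝ) : ℂ) * Complex.I) * Complex.exp ((((3 * θ / 8 - π / 8 : ℝ)) : ℂ) * Complex.I))) = Complex.exp ((((3 * θ / 8 + 5 * π / 8 : ℝ)) : ℂ) * Complex.I) := by
    rw [cexp_mul_cexpR, I_mul_cexpR, neg_cexpR]; exact cexp_I_eq_of_intR _ _ (1) (by push_cast; ring)
  linear_combination (weightV θ : ℂ) * f

/-- The directly listed realizable patterns at cell NW. [folklore] -/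
def dirPatternsNW : List (Side × Side × Side) := [(.N, .W, .S), (.E, .N, .S), (.E, .N, .W), (.E, .S, .W), (.S, .E, .N), (.S, .W, .N), (.S, .W, .E), (.W, .E, .N)]

/-- ★ The class term algebra at cell NW, listed patterns. [cite: GlazmanManolescu2019, Lemma 2.1 (statement, "in the form given in [Gl]")] [cite: Glazman2015WeightedSAW, Lemma 3.1, eq. (1) (the weight v(θ))] -/
theorem dir_term_NW_of_mem (θ : ℝ) {z₀ z₁ z₂ z₃ : Side} (hmem : (z₀, z₁, z₂) ∈ dirPatternsNW)
    (h3 : z₃ ≠ z₀ ∧ z₃ ≠ z₁ ∧ z₃ ≠ z₂) :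
    phase (turnAtNW θ z₀) * ((chordSign z₀ z₁ z₂ : ℂ) * backBracket θ z₀ z₁ z₂ z₃) = (weightV θ : ℂ) * dirNW θ z₀ z₁ z₂ := by
  obtain ⟨h3a, h3b, h3c⟩ := h3
  simp only [dirPatternsNW, List.mem_cons, Prod.mk.injEq, List.mem_nil_iff, or_false] at hmem
  rcases hmem with ⟨rfl, rfl, rfl⟩ | ⟨rfl, rfl, rfl⟩ | ⟨rfl, rfl, rfl⟩ | ⟨rfl, rfl, rfl⟩ | ⟨rfl, rfl, rfl⟩ | ⟨rfl, rfl, rfl⟩ | ⟨rfl, rfl, rfl⟩ | ⟨rfl, rfl, rfl⟩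
  · obtain rfl : z₃ = .E := by revert h3a h3b h3c; cases z₃ <;> simp
    exact dir_term_NW_N_W_S θ
  · obtain rfl : z₃ = .W := by revert h3a h3b h3c; cases z₃ <;> simp
    exact dir_term_NW_E_N_S θ
  · obtain rfl : z₃ = .S := by revert h3a h3b h3c; cases z₃ <;> simp
    exact dir_term_NW_E_N_W θ
  · obtain rfl : z₃ = .N := by revert h3a h3b h3c; cases z₃ <;> simp
    exact dir_term_NW_E_S_W θ
  · obtain rfl : z₃ = .W := by revert h3a h3b h3c; cases z₃ <;> simp
    exact dir_term_NW_S_E_N θ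
  · obtain rfl : z₃ = .E := by revert h3a h3b h3c; cases z₃ <;> simp
    exact dir_term_NW_S_W_N θ
  · obtain rfl : z₃ = .N := by revert h3a h3b h3c; cases z₃ <;> simp
    exact dir_term_NW_S_W_E θ
  · obtain rfl : z₃ = .S := by revert h3a h3b h3c; cases z₃ <;> simp
    exact dir_term_NW_W_E_N θ

/-- Every non-excluded pattern at cell NW is listed directly or reversed. [folklore] -/
private theorem dirPatternsNW_cover : ∀ a b c : Side, a ≠ b → a ≠ c → b ≠ c →
    (a, b, c) ∈ dirPatternsNW ∨ (a, c, b) ∈ dirPatternsNW ∨ (a = .N ∧ (b = .E ∨ c = .E)) ∨ (a = .W ∧ (b = .S ∨ c = .S)) := by decide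

/-- ★★ **The class term algebra at cell NW, all realizable patterns.** [cite: GlazmanManolescu2019, Lemma 2.1 (statement, "in the form given in [Gl]")] [cite: Glazman2015WeightedSAW, Lemma 3.1, eq. (1) (the weight v(θ))] -/
theorem dir_term_NW (θ : ℝ) {z₀ z₁ z₂ z₃ : Side} (h01 : z₀ ≠ z₁) (h02 : z₀ ≠ z₂) (h12 : z₁ ≠ z₂)
    (h3 : z₃ ≠ z₀ ∧ z₃ ≠ z₁ ∧ z₃ ≠ z₂) (hNx : z₀ = .N → z₁ ≠ .E ∧ z₂ ≠ .E) (hWx : z₀ = .W → z₁ ≠ .S ∧ z₂ ≠ .S) :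
    phase (turnAtNW θ z₀) * ((chordSign z₀ z₁ z₂ : ℂ) * backBracket θ z₀ z₁ z₂ z₃) = (weightV θ : ℂ) * dirNW θ z₀ z₁ z₂ := by
  rcases dirPatternsNW_cover _ _ _ h01 h02 h12 with hd | hd | hx | hx
  · exact dir_term_NW_of_mem θ hd h3
  · rw [← ΩG.chordSign_mul_backBracket_swap θ h01 h02 (Ne.symm h3.1) h12 (Ne.symm h3.2.1) (Ne.symm h3.2.2),
      ← dirNW_swap]
    exact dir_term_NW_of_mem θ hd ⟨h3.1, h3.2.2, h3.2.1⟩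
  · rcases hx.2 with e | e
    · exact absurd e (hNx hx.1).1
    · exact absurd e (hNx hx.1).2
  · rcases hx.2 with e | e
    · exact absurd e (hWx hx.1).1
    · exact absurd e (hWx hx.1).2

/-- The realizable class directions at cell NW have modulus `1`. [cite: Glazman2015WeightedSAW, Lemma 3.1, eq. (1) (the weight v(θ))] -/
theorem norm_dirNW {θ : ℝ} {z₀ z₁ z₂ : Side} (h01 : z₀ ≠ z₁) (h02 : z₀ ≠ z₂) (h12 : z₁ ≠ z₂) (hNx : z₀ = .N → z₁ ≠ .E ∧ z₂ ≠ .E) (hWx : z₀ = .W → z₁ ≠ .S ∧ z₂ ≠ .S) :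
    ‖dirNW θ z₀ z₁ z₂‖ = 1 := by
  cases z₀ <;> cases z₁ <;> cases z₂ <;> simp only [dirNW] <;>
    first
    | exact absurd rfl h01
    | exact absurd rfl h02
    | exact absurd rfl h12
    | exact absurd rfl (hNx rfl).1
    | exact absurd rfl (hNx rfl).2
    | exact absurd rfl (hWx rfl).1
    | exact absurd rfl (hWx rfl).2
    | exact Complex.norm_exp_ofReal_mul_I _

end LawNW

/-! ### Cones at cell NW -/

section ConeNW

/-- ★ **The `S/W` cone at cell NW**: after rotation by `e^{i(-(7 * π / 8))}` every class direction of a walk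
that entered from `S` or `W` has positive real part (`θ ∈ [π/3, 2π/3]`). [cite: Glazman2015WeightedSAW, Lemma 3.1, eq. (1) (the weight v(θ))] -/
theorem re_rot_dirNW_pos_SW {θ : ℝ} (hθ : θ ∈ Set.Icc (π / 3) (2 * π / 3)) {z₀ z₁ z₂ : Side}
    (h01 : z₀ ≠ z₁) (h02 : z₀ ≠ z₂) (h12 : z₁ ≠ z₂) (hNx : z₀ = .N → z₁ ≠ .E ∧ z₂ ≠ .E) (hWx : z₀ = .W → z₁ ≠ .S ∧ z₂ ≠ .S) (hz : z₀ = .S ∨ z₀ = .W) :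
    0 < (Complex.exp ((((-(7 * π / 8) : ℝ)) : ℂ) * Complex.I) * dirNW θ z₀ z₁ z₂).re := by
  have hπ := Real.pi_pos
  obtain ⟨h1, h2⟩ := hθ
  have c1 : 0 < (Complex.exp ((((-(7 * π / 8) : ℝ)) : ℂ) * Complex.I) * Complex.exp ((((7 * π / 8 : ℝ)) : ℂ) * Complex.I)).re := by
    rw [re_cexp_mul_cexpR]; exact Real.cos_pos_of_mem_Ioo ⟨by linarith, by linarith⟩
  have c2 : 0 < (Complex.exp ((((-(7 * π / 8) : ℝ)) : ℂ) * Complex.I) * Complex.exp ((((π : ℝ)) : ℂ) * Complex.I)).re := by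
    rw [re_cexp_mul_cexpR]; exact Real.cos_pos_of_mem_Ioo ⟨by linarith, by linarith⟩
  have c3 : 0 < (Complex.exp ((((-(7 * π / 8) : ℝ)) : ℂ) * Complex.I) * Complex.exp ((((3 * θ / 8 + 3 * π / 4 : ℝ)) : ℂ) * Complex.I)).re := by
    rw [re_cexp_mul_cexpR]; exact Real.cos_pos_of_mem_Ioo ⟨by linarith, by linarith⟩
  have c4 : 0 < (Complex.exp ((((-(7 * π / 8) : ℝ)) : ℂ) * Complex.I) * Complex.exp ((((3 * θ / 8 + 5 * π / 8 : ℝ)) : ℂ) * Complex.I)).re := by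
    rw [re_cexp_mul_cexpR]; exact Real.cos_pos_of_mem_Ioo ⟨by linarith, by linarith⟩
  cases z₀ <;> cases z₁ <;> cases z₂ <;> simp only [dirNW] <;>
    first
    | exact absurd rfl h01
    | exact absurd rfl h02
    | exact absurd rfl h12
    | exact absurd rfl (hNx rfl).1
    | exact absurd rfl (hNx rfl).2
    | exact absurd rfl (hWx rfl).1
    | exact absurd rfl (hWx rfl).2
    | (exfalso; rcases hz with e | e <;> exact absurd e (by decide))
    | exact c1
    | exact c2
    | exact c3
    | exact c4

/-- ★ **The `N/E` cone at cell NW**: after rotation by `e^{i(π / 8)}` every class direction of a walk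
that entered from `N` or `E` has positive real part (`θ ∈ [π/3, 2π/3]`). [cite: Glazman2015WeightedSAW, Lemma 3.1, eq. (1) (the weight v(θ))] -/
theorem re_rot_dirNW_pos_NEgrp {θ : ℝ} (hθ : θ ∈ Set.Icc (π / 3) (2 * π / 3)) {z₀ z₁ z₂ : Side}
    (h01 : z₀ ≠ z₁) (h02 : z₀ ≠ z₂) (h12 : z₁ ≠ z₂) (hNx : z₀ = .N → z₁ ≠ .E ∧ z₂ ≠ .E) (hWx : z₀ = .W → z₁ ≠ .S ∧ z₂ ≠ .S) (hz : z₀ = .N ∨ z₀ = .E) :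
    0 < (Complex.exp ((((π / 8 : ℝ)) : ℂ) * Complex.I) * dirNW θ z₀ z₁ z₂).re := by
  have hπ := Real.pi_pos
  obtain ⟨h1, h2⟩ := hθ
  have c1 : 0 < (Complex.exp ((((π / 8 : ℝ)) : ℂ) * Complex.I) * Complex.exp ((((0 : ℝ)) : ℂ) * Complex.I)).re := by
    rw [re_cexp_mul_cexpR]; exact Real.cos_pos_of_mem_Ioo ⟨by linarith, by linarith⟩
  have c2 : 0 < (Complex.exp ((((π / 8 : ℝ)) : ℂ) * Complex.I) * Complex.exp ((((-(π / 8) : ℝ)) : ℂ) * Complex.I)).re := by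
    rw [re_cexp_mul_cexpR]; exact Real.cos_pos_of_mem_Ioo ⟨by linarith, by linarith⟩
  have c3 : 0 < (Complex.exp ((((π / 8 : ℝ)) : ℂ) * Complex.I) * Complex.exp ((((3 * θ / 8 - 3 * π / 8 : ℝ)) : ℂ) * Complex.I)).re := by
    rw [re_cexp_mul_cexpR]; exact Real.cos_pos_of_mem_Ioo ⟨by linarith, by linarith⟩
  have c4 : 0 < (Complex.exp ((((π / 8 : ℝ)) : ℂ) * Complex.I) * Complex.exp ((((3 * θ / 8 - π / 4 : ℝ)) : ℂ) * Complex.I)).re := by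
    rw [re_cexp_mul_cexpR]; exact Real.cos_pos_of_mem_Ioo ⟨by linarith, by linarith⟩
  cases z₀ <;> cases z₁ <;> cases z₂ <;> simp only [dirNW] <;>
    first
    | exact absurd rfl h01
    | exact absurd rfl h02
    | exact absurd rfl h12
    | exact absurd rfl (hNx rfl).1
    | exact absurd rfl (hNx rfl).2
    | exact absurd rfl (hWx rfl).1
    | exact absurd rfl (hWx rfl).2
    | (exfalso; rcases hz with e | e <;> exact absurd e (by decide))
    | exact c1
    | exact c2
    | exact c3
    | exact c4

end ConeNW

namespace ΩG

section ClassTermNW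

variable {D : Set Face} {w : Face}

open Classical in
/-- **The class term of a walk at cell NW**: for a WOUND class-`B2a` walk, its exterior weight times its class direction;
else `0`. [cite: GlazmanManolescu2019, Lemma 2.1 (statement, "in the form given in [Gl]")] [cite: Glazman2015WeightedSAW, Lemma 3.1 (proof, pp. 6–7)] -/
noncomputable def classTermNW (θ : ℝ) (hr : RootedFace D (w.side .W) (farNW w)) (ω : ΩG D (w.side .W) (farNW w)) : ℂ :=
  if h : ω.IsB2a then
    (if ω.WE (fun _ => θ) ≠ excursionWinding θ ω.2.firstSideG (ω.z1 hr h) ω.1 then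
      (ω.2.extWeight (fun _ => θ) (farNW w) : ℂ) * dirNW θ ω.2.firstSideG (ω.z1 hr h) ω.1 else 0)
  else 0

/-- ★★★ **THE CLASS TERM AT CELL NW IS EXPLICIT**: `classTerm = v(θ) · classTermNW`. [cite: GlazmanManolescu2019, Lemma 2.1 (statement, "in the form given in [Gl]")] [cite: Glazman2015WeightedSAW, Lemma 3.1 (proof, pp. 6–7)] [cite: Hopf1935, Nr. 2 (Umlaufsatz, p. 53) and Nr. 4 eq. (22) (curves with corners, pp. 60–61)] -/
theorem classTerm_NW (hh : holeFaceW w ∉ D) {θ : ℝ} (ω : ΩG D (w.side .W) (farNW w))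
    (hr : RootedFace D (w.side .W) (farNW w)) (h : ω.IsB2a) :
    ω.classTerm (fun _ => θ) hr = (weightV θ : ℂ) * classTermNW θ hr ω := by
  rcases ω.classTerm_dichotomy hr h θ with ⟨hWE, h0⟩ | ⟨hWE, hct⟩
  · rw [h0, classTermNW, dif_pos h, if_neg (fun H => H hWE)]; simp
  · obtain ⟨hz01, hz02, hz12⟩ := ω.firstSide_exit_return_distinct hr h
    have h3 := ω.z₃_spec hr h
    obtain ⟨hx1, hx2⟩ := NW_entry_exit_exclusion hh hr h
    have hWP : ω.WP (fun _ => θ) = turnAtNW θ ω.2.firstSideG := by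
      obtain ⟨hN, hE, hS, hW⟩ := WP_NW_eq_of_wound hh hr h θ hWE
      rcases hz : ω.2.firstSideG with _ | _ | _ | _
      · rw [hW hz]; rfl
      · rw [hE hz]; rfl
      · rw [hS hz]; rfl
      · rw [hN hz]; rfl
    rw [hct, classTermNW, dif_pos h, if_pos hWE, hWP, mul_assoc, mul_assoc,
      dir_term_NW θ hz01 hz02 hz12 ⟨h3.1, h3.2.1, h3.2.2⟩ hx1 hx2]
    ring

/-- The modulus of the class term of a class-`B2a` walk at cell NW is at most its exterior weight. [cite: GlazmanManolescu2019, eq. (1) (the weights are non-negative)] -/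
theorem norm_classTermNW_le (hh : holeFaceW w ∉ D) {θ : ℝ} (hθ : θ ∈ Set.Icc (π / 3) (2 * π / 3))
    (hr : RootedFace D (w.side .W) (farNW w)) (ω : ΩG D (w.side .W) (farNW w)) (h : ω.IsB2a) :
    ‖classTermNW θ hr ω‖ ≤ ω.2.extWeight (fun _ => θ) (farNW w) := by
  have hext : 0 ≤ ω.2.extWeight (fun _ => θ) (farNW w) := Finset.prod_nonneg fun _ _ => localWeight_nonneg hθ _
  unfold classTermNW
  rw [dif_pos h]
  split_ifs with hWE
  · obtain ⟨hz01, hz02, hz12⟩ := ω.firstSide_exit_return_distinct hr h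
    obtain ⟨hx1, hx2⟩ := NW_entry_exit_exclusion hh hr h
    rw [norm_mul, norm_dirNW hz01 hz02 hz12 hx1 hx2, mul_one, Complex.norm_real, Real.norm_eq_abs, abs_of_nonneg hext]
  · simpa using hext


/-- ★ The rotated class term at cell NW of a wound walk entering from `S` or `W` has positive real part;
an unwound walk contributes `0`. [cite: GlazmanManolescu2019, Lemma 2.1 (statement, "in the form given in [Gl]")] [cite: Glazman2015WeightedSAW, Lemma 3.1, eq. (1) (the weight v(θ))] -/
theorem re_rot_classTermNW_SW (hh : holeFaceW w ∉ D) {θ : ℝ} (hθ : θ ∈ Set.Ioo (π / 3) (2 * π / 3))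
    (hr : RootedFace D (w.side .W) (farNW w)) (ω : ΩG D (w.side .W) (farNW w)) (h : ω.IsB2a) (hz : ω.2.firstSideG = .S ∨ ω.2.firstSideG = .W) :
    0 ≤ (Complex.exp ((((-(7 * π / 8) : ℝ)) : ℂ) * Complex.I) * classTermNW θ hr ω).re ∧
      (ω.WE (fun _ => θ) ≠ excursionWinding θ ω.2.firstSideG (ω.z1 hr h) ω.1 →
        0 < (Complex.exp ((((-(7 * π / 8) : ℝ)) : ℂ) * Complex.I) * classTermNW θ hr ω).re) := by
  have hθ' : θ ∈ Set.Icc (π / 3) (2 * π / 3) := Set.Ioo_subset_Icc_self hθ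
  obtain ⟨hz01, hz02, hz12⟩ := ω.firstSide_exit_return_distinct hr h
  obtain ⟨hx1, hx2⟩ := NW_entry_exit_exclusion hh hr h
  have hext : 0 < ω.2.extWeight (fun _ => θ) (farNW w) := Finset.prod_pos fun g _ => localWeight_kindsIn_posR hθ ω.2 g
  have hdir := re_rot_dirNW_pos_SW hθ' hz01 hz02 hz12 hx1 hx2 hz
  have key : ∀ hw : ω.WE (fun _ => θ) ≠ excursionWinding θ ω.2.firstSideG (ω.z1 hr h) ω.1,
      (Complex.exp ((((-(7 * π / 8) : ℝ)) : ℂ) * Complex.I) * classTermNW θ hr ω).re =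
        ω.2.extWeight (fun _ => θ) (farNW w) *
          (Complex.exp ((((-(7 * π / 8) : ℝ)) : ℂ) * Complex.I) * dirNW θ ω.2.firstSideG (ω.z1 hr h) ω.1).re := by
    intro hw
    rw [classTermNW, dif_pos h, if_pos hw, show Complex.exp ((((-(7 * π / 8) : ℝ)) : ℂ) * Complex.I) *
        ((ω.2.extWeight (fun _ => θ) (farNW w) : ℂ) * dirNW θ ω.2.firstSideG (ω.z1 hr h) ω.1) =
        (ω.2.extWeight (fun _ => θ) (farNW w) : ℂ) *
          (Complex.exp ((((-(7 * π / 8) : ℝ)) : ℂ) * Complex.I) * dirNW θ ω.2.firstSideG (ω.z1 hr h) ω.1) by ring,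
      Complex.re_ofReal_mul]
  constructor
  · by_cases hw : ω.WE (fun _ => θ) ≠ excursionWinding θ ω.2.firstSideG (ω.z1 hr h) ω.1
    · rw [key hw]; exact (mul_pos hext hdir).le
    · rw [classTermNW, dif_pos h, if_neg hw, mul_zero, Complex.zero_re]
  · intro hw
    rw [key hw]; exact mul_pos hext hdir

/-- ★ The rotated class term at cell NW of a wound walk entering from `N` or `E` has positive real part;
an unwound walk contributes `0`. [cite: GlazmanManolescu2019, Lemma 2.1 (statement, "in the form given in [Gl]")] [cite: Glazman2015WeightedSAW, Lemma 3.1, eq. (1) (the weight v(θ))] -/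
theorem re_rot_classTermNW_NEgrp (hh : holeFaceW w ∉ D) {θ : ℝ} (hθ : θ ∈ Set.Ioo (π / 3) (2 * π / 3))
    (hr : RootedFace D (w.side .W) (farNW w)) (ω : ΩG D (w.side .W) (farNW w)) (h : ω.IsB2a) (hz : ω.2.firstSideG = .N ∨ ω.2.firstSideG = .E) :
    0 ≤ (Complex.exp ((((π / 8 : ℝ)) : ℂ) * Complex.I) * classTermNW θ hr ω).re ∧
      (ω.WE (fun _ => θ) ≠ excursionWinding θ ω.2.firstSideG (ω.z1 hr h) ω.1 →
        0 < (Complex.exp ((((π / 8 : ℝ)) : ℂ) * Complex.I) * classTermNW θ hr ω).re) := by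
  have hθ' : θ ∈ Set.Icc (π / 3) (2 * π / 3) := Set.Ioo_subset_Icc_self hθ
  obtain ⟨hz01, hz02, hz12⟩ := ω.firstSide_exit_return_distinct hr h
  obtain ⟨hx1, hx2⟩ := NW_entry_exit_exclusion hh hr h
  have hext : 0 < ω.2.extWeight (fun _ => θ) (farNW w) := Finset.prod_pos fun g _ => localWeight_kindsIn_posR hθ ω.2 g
  have hdir := re_rot_dirNW_pos_NEgrp hθ' hz01 hz02 hz12 hx1 hx2 hz
  have key : ∀ hw : ω.WE (fun _ => θ) ≠ excursionWinding θ ω.2.firstSideG (ω.z1 hr h) ω.1,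
      (Complex.exp ((((π / 8 : ℝ)) : ℂ) * Complex.I) * classTermNW θ hr ω).re =
        ω.2.extWeight (fun _ => θ) (farNW w) *
          (Complex.exp ((((π / 8 : ℝ)) : ℂ) * Complex.I) * dirNW θ ω.2.firstSideG (ω.z1 hr h) ω.1).re := by
    intro hw
    rw [classTermNW, dif_pos h, if_pos hw, show Complex.exp ((((π / 8 : ℝ)) : ℂ) * Complex.I) *
        ((ω.2.extWeight (fun _ => θ) (farNW w) : ℂ) * dirNW θ ω.2.firstSideG (ω.z1 hr h) ω.1) =
        (ω.2.extWeight (fun _ => θ) (farNW w) : ℂ) *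
          (Complex.exp ((((π / 8 : ℝ)) : ℂ) * Complex.I) * dirNW θ ω.2.firstSideG (ω.z1 hr h) ω.1) by ring,
      Complex.re_ofReal_mul]
  constructor
  · by_cases hw : ω.WE (fun _ => θ) ≠ excursionWinding θ ω.2.firstSideG (ω.z1 hr h) ω.1
    · rw [key hw]; exact (mul_pos hext hdir).le
    · rw [classTermNW, dif_pos h, if_neg hw, mul_zero, Complex.zero_re]
  · intro hw
    rw [key hw]; exact mul_pos hext hdir

variable [Finite D]

/-- ★★ The grouped sum at cell NW. [cite: GlazmanManolescu2019, Lemma 2.1 (statement, "in the form given in [Gl]")] [cite: Glazman2015WeightedSAW, Lemma 3.1 (proof, pp. 6–7)] -/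
theorem sum_classTerm_NW (hh : holeFaceW w ∉ D) {θ : ℝ} (hr : RootedFace D (w.side .W) (farNW w)) :
    ∑ ω ∈ setB2a D (w.side .W) (farNW w), ω.classTerm (fun _ => θ) hr =
      (weightV θ : ℂ) * ∑ ω ∈ setB2a D (w.side .W) (farNW w), classTermNW θ hr ω := by
  rw [Finset.mul_sum]
  refine Finset.sum_congr rfl fun ω hω => ?_
  simp only [setB2a, Finset.mem_filter, Finset.mem_univ, true_and] at hω
  exact ω.classTerm_NW hh hr hω

end ClassTermNW

end ΩG

/-! ## § Cell LS — the lateral cell south of the hole: class directions and the cell law -/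

section LawLS

/-- **The class directions at cell LS** (symmetric in exit/return; junk `0` on the excluded and degenerate patterns):
`E`: {S,W} ↦ `e^{i(3 * θ / 8 + π)}`; `W`: {E,S} ↦ `e^{i(3 * θ / 8)}`. [cite: GlazmanManolescu2019, Lemma 2.1 (statement, "in the form given in [Gl]")] [cite: Glazman2015WeightedSAW, Lemma 3.1, eq. (1) (the weight v(θ))] -/
def dirLS (θ : ℝ) : Side → Side → Side → ℂ
  | .E, .S, .W => Complex.exp ((((3 * θ / 8 + π : ℝ)) : ℂ) * Complex.I)
  | .E, .W, .S => Complex.exp ((((3 * θ / 8 + π : ℝ)) : ℂ) * Complex.I)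
  | .W, .E, .S => Complex.exp ((((3 * θ / 8 : ℝ)) : ℂ) * Complex.I)
  | .W, .S, .E => Complex.exp ((((3 * θ / 8 : ℝ)) : ℂ) * Complex.I)
  | _, _, _ => 0

/-- The class directions at cell LS are symmetric in the exit and return sides. [folklore] -/
private theorem dirLS_swap (θ : ℝ) (z₀ z₁ z₂ : Side) : dirLS θ z₀ z₂ z₁ = dirLS θ z₀ z₁ z₂ := by
  cases z₀ <;> cases z₁ <;> cases z₂ <;> rfl

/-- The prefix turning at angle `θ` at cell LS, by first side (junk `0` on sides that do not occur). [cite: GlazmanManolescu2019, Lemma 2.1 (proof: [Gl])] -/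
def turnAtLS (_θ : ℝ) : Side → ℝ
  | .N => 0
  | .E => -π
  | .S => 0
  | .W => 2 * π

/-- Cell LS, first side `E`, class `{S, W}`: `phase(WP)·ε·backBracket = v(θ)·e^{i(3 * θ / 8 + π)}` (private: the same
identity recurs at every cell with the same pinned turning; the public form is `dir_term_LS`). [cite: Glazman2015WeightedSAW, Lemma 3.1, eq. (1) (the weight v(θ))] [cite: GlazmanManolescu2019, Lemma 2.1 (proof: [Gl])] -/
private theorem dir_term_LS_E_S_W (θ : ℝ) :
    phase (-π) * ((chordSign .E .S .W : ℂ) * backBracket θ .E .S .W .N) =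
      (weightV θ : ℂ) * Complex.exp ((((3 * θ / 8 + π : ℝ)) : ℂ) * Complex.I) := by
  have hcs : ((chordSign .E .S .W : ℤ) : ℂ) = 1 := by
    rw [show chordSign .E .S .W = 1 by decide]; simp
  rw [backBracket_E_S_W_N, phase, hcs]
  have f : -(Complex.exp ((((-(5 / 8 * (-π))) : ℝ) : ℂ) * Complex.I) * Complex.exp ((((3 * θ / 8 - 5 * π / 8 : ℝ)) : ℂ) * Complex.I)) = Complex.exp ((((3 * θ / 8 + π : ℝ)) : ℂ) * Complex.I) := by
    rw [cexp_mul_cexpR, neg_cexpR]; exact cexp_I_eq_of_intR _ _ (0) (by push_cast; ring)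
  linear_combination (weightV θ : ℂ) * f

/-- Cell LS, first side `W`, class `{E, S}`: `phase(WP)·ε·backBracket = v(θ)·e^{i(3 * θ / 8)}` (private: the same
identity recurs at every cell with the same pinned turning; the public form is `dir_term_LS`). [cite: Glazman2015WeightedSAW, Lemma 3.1, eq. (1) (the weight v(θ))] [cite: GlazmanManolescu2019, Lemma 2.1 (proof: [Gl])] -/
private theorem dir_term_LS_W_E_S (θ : ℝ) :
    phase (2 * π) * ((chordSign .W .E .S : ℂ) * backBracket θ .W .E .S .N) =
      (weightV θ : ℂ) * Complex.exp ((((3 * θ / 8 : ℝ)) : ℂ) * Complex.I) := by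
  have hcs : ((chordSign .W .E .S : ℤ) : ℂ) = 1 := by
    rw [show chordSign .W .E .S = 1 by decide]; simp
  rw [backBracket_W_E_S_N, phase, hcs]
  have f : -(Complex.I * (Complex.exp ((((-(5 / 8 * (2 * π))) : ℝ) : ℂ) * Complex.I) * Complex.exp ((((3 * θ / 8 - π / 4 : ℝ)) : ℂ) * Complex.I))) = Complex.exp ((((3 * θ / 8 : ℝ)) : ℂ) * Complex.I) := by
    rw [cexp_mul_cexpR, I_mul_cexpR, neg_cexpR]; exact cexp_I_eq_of_intR _ _ (0) (by push_cast; ring)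
  linear_combination (weightV θ : ℂ) * f

/-- The directly listed realizable patterns at cell LS. [folklore] -/
def dirPatternsLS : List (Side × Side × Side) := [(.E, .S, .W), (.W, .E, .S)]

/-- ★ The class term algebra at cell LS, listed patterns. [cite: GlazmanManolescu2019, Lemma 2.1 (statement, "in the form given in [Gl]")] [cite: Glazman2015WeightedSAW, Lemma 3.1, eq. (1) (the weight v(θ))] -/
theorem dir_term_LS_of_mem (θ : ℝ) {z₀ z₁ z₂ z₃ : Side} (hmem : (z₀, z₁, z₂) ∈ dirPatternsLS)
    (h3 : z₃ ≠ z₀ ∧ z₃ ≠ z₁ ∧ z₃ ≠ z₂) :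
    phase (turnAtLS θ z₀) * ((chordSign z₀ z₁ z₂ : ℂ) * backBracket θ z₀ z₁ z₂ z₃) = (weightV θ : ℂ) * dirLS θ z₀ z₁ z₂ := by
  obtain ⟨h3a, h3b, h3c⟩ := h3
  simp only [dirPatternsLS, List.mem_cons, Prod.mk.injEq, List.mem_nil_iff, or_false] at hmem
  rcases hmem with ⟨rfl, rfl, rfl⟩ | ⟨rfl, rfl, rfl⟩
  · obtain rfl : z₃ = .N := by revert h3a h3b h3c; cases z₃ <;> simp
    exact dir_term_LS_E_S_W θ
  · obtain rfl : z₃ = .N := by revert h3a h3b h3c; cases z₃ <;> simp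
    exact dir_term_LS_W_E_S θ

/-- Every admissible pattern at cell LS is listed directly or reversed. [folklore] -/
private theorem dirPatternsLS_cover : ∀ a b c : Side, a ≠ b → a ≠ c → b ≠ c → a ≠ .N → b ≠ .N → c ≠ .N → (a = .E ∨ a = .W) →
    (a, b, c) ∈ dirPatternsLS ∨ (a, c, b) ∈ dirPatternsLS := by decide

/-- ★★ **The class term algebra at cell LS, all realizable patterns.** [cite: GlazmanManolescu2019, Lemma 2.1 (statement, "in the form given in [Gl]")] [cite: Glazman2015WeightedSAW, Lemma 3.1, eq. (1) (the weight v(θ))] -/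
theorem dir_term_LS (θ : ℝ) {z₀ z₁ z₂ z₃ : Side} (h01 : z₀ ≠ z₁) (h02 : z₀ ≠ z₂) (h12 : z₁ ≠ z₂)
    (h3 : z₃ ≠ z₀ ∧ z₃ ≠ z₁ ∧ z₃ ≠ z₂) (hN : z₀ ≠ .N ∧ z₁ ≠ .N ∧ z₂ ≠ .N) (hEW : z₀ = .E ∨ z₀ = .W) :
    phase (turnAtLS θ z₀) * ((chordSign z₀ z₁ z₂ : ℂ) * backBracket θ z₀ z₁ z₂ z₃) = (weightV θ : ℂ) * dirLS θ z₀ z₁ z₂ := by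
  rcases dirPatternsLS_cover _ _ _ h01 h02 h12 hN.1 hN.2.1 hN.2.2 hEW with hd | hd
  · exact dir_term_LS_of_mem θ hd h3
  · rw [← ΩG.chordSign_mul_backBracket_swap θ h01 h02 (Ne.symm h3.1) h12 (Ne.symm h3.2.1) (Ne.symm h3.2.2),
      ← dirLS_swap]
    exact dir_term_LS_of_mem θ hd ⟨h3.1, h3.2.2, h3.2.1⟩

/-- The realizable class directions at cell LS have modulus `1`. [cite: Glazman2015WeightedSAW, Lemma 3.1, eq. (1) (the weight v(θ))] -/
theorem norm_dirLS {θ : ℝ} {z₀ z₁ z₂ : Side} (h01 : z₀ ≠ z₁) (h02 : z₀ ≠ z₂) (h12 : z₁ ≠ z₂) (hN : z₀ ≠ .N ∧ z₁ ≠ .N ∧ z₂ ≠ .N) (hEW : z₀ = .E ∨ z₀ = .W) :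
    ‖dirLS θ z₀ z₁ z₂‖ = 1 := by
  obtain ⟨hN0, hN1, hN2⟩ := hN
  cases z₀ <;> cases z₁ <;> cases z₂ <;> simp only [dirLS] <;>
    first
    | exact absurd rfl h01
    | exact absurd rfl h02
    | exact absurd rfl h12
    | exact absurd rfl hN0
    | exact absurd rfl hN1
    | exact absurd rfl hN2
    | (exfalso; rcases hEW with e | e <;> exact absurd e (by decide))
    | exact Complex.norm_exp_ofReal_mul_I _

end LawLS

/-! ### Cones at cell LS -/

section ConeLS

/-- ★ **The `E` cone at cell LS**: after rotation by `e^{i(-(9 * π / 8))}` every class direction of a walk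
that entered from `E` has positive real part (`θ ∈ [π/3, 2π/3]`). [cite: Glazman2015WeightedSAW, Lemma 3.1, eq. (1) (the weight v(θ))] -/
theorem re_rot_dirLS_pos_E {θ : ℝ} (hθ : θ ∈ Set.Icc (π / 3) (2 * π / 3)) {z₀ z₁ z₂ : Side}
    (h01 : z₀ ≠ z₁) (h02 : z₀ ≠ z₂) (h12 : z₁ ≠ z₂) (hN : z₀ ≠ .N ∧ z₁ ≠ .N ∧ z₂ ≠ .N) (hEW : z₀ = .E ∨ z₀ = .W) (hz : z₀ = .E) :
    0 < (Complex.exp ((((-(9 * π / 8) : ℝ)) : ℂ) * Complex.I) * dirLS θ z₀ z₁ z₂).re := by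
  have hπ := Real.pi_pos
  obtain ⟨h1, h2⟩ := hθ
  have c1 : 0 < (Complex.exp ((((-(9 * π / 8) : ℝ)) : ℂ) * Complex.I) * Complex.exp ((((3 * θ / 8 + π : ℝ)) : ℂ) * Complex.I)).re := by
    rw [re_cexp_mul_cexpR]; exact Real.cos_pos_of_mem_Ioo ⟨by linarith, by linarith⟩
  cases z₀ <;> cases z₁ <;> cases z₂ <;> simp only [dirLS] <;>
    first
    | exact absurd rfl h01
    | exact absurd rfl h02
    | exact absurd rfl h12
    | exact absurd rfl hN.1
    | exact absurd rfl hN.2.1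
    | exact absurd rfl hN.2.2
    | (exfalso; rcases hEW with e | e <;> exact absurd e (by decide))
    | (exfalso; exact absurd hz (by decide))
    | exact c1

/-- ★ **The `W` cone at cell LS**: after rotation by `e^{i(-(π / 8))}` every class direction of a walk
that entered from `W` has positive real part (`θ ∈ [π/3, 2π/3]`). [cite: Glazman2015WeightedSAW, Lemma 3.1, eq. (1) (the weight v(θ))] -/
theorem re_rot_dirLS_pos_W {θ : ℝ} (hθ : θ ∈ Set.Icc (π / 3) (2 * π / 3)) {z₀ z₁ z₂ : Side}
    (h01 : z₀ ≠ z₁) (h02 : z₀ ≠ z₂) (h12 : z₁ ≠ z₂) (hN : z₀ ≠ .N ∧ z₁ ≠ .N ∧ z₂ ≠ .N) (hEW : z₀ = .E ∨ z₀ = .W) (hz : z₀ = .W) :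
    0 < (Complex.exp ((((-(π / 8) : ℝ)) : ℂ) * Complex.I) * dirLS θ z₀ z₁ z₂).re := by
  have hπ := Real.pi_pos
  obtain ⟨h1, h2⟩ := hθ
  have c1 : 0 < (Complex.exp ((((-(π / 8) : ℝ)) : ℂ) * Complex.I) * Complex.exp ((((3 * θ / 8 : ℝ)) : ℂ) * Complex.I)).re := by
    rw [re_cexp_mul_cexpR]; exact Real.cos_pos_of_mem_Ioo ⟨by linarith, by linarith⟩
  cases z₀ <;> cases z₁ <;> cases z₂ <;> simp only [dirLS] <;>
    first
    | exact absurd rfl h01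
    | exact absurd rfl h02
    | exact absurd rfl h12
    | exact absurd rfl hN.1
    | exact absurd rfl hN.2.1
    | exact absurd rfl hN.2.2
    | (exfalso; rcases hEW with e | e <;> exact absurd e (by decide))
    | (exfalso; exact absurd hz (by decide))
    | exact c1

end ConeLS

namespace ΩG

section ClassTermLS

variable {D : Set Face} {w : Face}

open Classical in
/-- **The class term of a walk at cell LS**: for a WOUND class-`B2a` walk, its exterior weight times its class direction;
else `0`. [cite: GlazmanManolescu2019, Lemma 2.1 (statement, "in the form given in [Gl]")] [cite: Glazman2015WeightedSAW, Lemma 3.1 (proof, pp. 6–7)] -/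
noncomputable def classTermLS (θ : ℝ) (hr : RootedFace D (w.side .W) (latS w)) (ω : ΩG D (w.side .W) (latS w)) : ℂ :=
  if h : ω.IsB2a then
    (if ω.WE (fun _ => θ) ≠ excursionWinding θ ω.2.firstSideG (ω.z1 hr h) ω.1 then
      (ω.2.extWeight (fun _ => θ) (latS w) : ℂ) * dirLS θ ω.2.firstSideG (ω.z1 hr h) ω.1 else 0)
  else 0

/-- ★★★ **THE CLASS TERM AT CELL LS IS EXPLICIT**: `classTerm = v(θ) · classTermLS`. [cite: GlazmanManolescu2019, Lemma 2.1 (statement, "in the form given in [Gl]")] [cite: Glazman2015WeightedSAW, Lemma 3.1 (proof, pp. 6–7)] [cite: Hopf1935, Nr. 2 (Umlaufsatz, p. 53) and Nr. 4 eq. (22) (curves with corners, pp. 60–61)] -/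
theorem classTerm_LS (hh : holeFaceW w ∉ D) {θ : ℝ} (ω : ΩG D (w.side .W) (latS w))
    (hr : RootedFace D (w.side .W) (latS w)) (h : ω.IsB2a) :
    ω.classTerm (fun _ => θ) hr = (weightV θ : ℂ) * classTermLS θ hr ω := by
  rcases ω.classTerm_dichotomy hr h θ with ⟨hWE, h0⟩ | ⟨hWE, hct⟩
  · rw [h0, classTermLS, dif_pos h, if_neg (fun H => H hWE)]; simp
  · obtain ⟨hz01, hz02, hz12⟩ := ω.firstSide_exit_return_distinct hr h
    have h3 := ω.z₃_spec hr h
    have hN := LS_sides_ne_N hh hr h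
    have hEW := LS_firstSide_eq_E_or_W hh hr h
    have hWP : ω.WP (fun _ => θ) = turnAtLS θ ω.2.firstSideG := by
      rcases hEW with hz | hz
      · rw [(WP_LS_eq_of_wound hh hr h θ hWE).1 hz, hz]; rfl
      · rw [(WP_LS_eq_of_wound hh hr h θ hWE).2 hz, hz]; rfl
    rw [hct, classTermLS, dif_pos h, if_pos hWE, hWP, mul_assoc, mul_assoc,
      dir_term_LS θ hz01 hz02 hz12 ⟨h3.1, h3.2.1, h3.2.2⟩ hN hEW]
    ring

/-- The modulus of the class term of a class-`B2a` walk at cell LS is at most its exterior weight. [cite: GlazmanManolescu2019, eq. (1) (the weights are non-negative)] -/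
theorem norm_classTermLS_le (hh : holeFaceW w ∉ D) {θ : ℝ} (hθ : θ ∈ Set.Icc (π / 3) (2 * π / 3))
    (hr : RootedFace D (w.side .W) (latS w)) (ω : ΩG D (w.side .W) (latS w)) (h : ω.IsB2a) :
    ‖classTermLS θ hr ω‖ ≤ ω.2.extWeight (fun _ => θ) (latS w) := by
  have hext : 0 ≤ ω.2.extWeight (fun _ => θ) (latS w) := Finset.prod_nonneg fun _ _ => localWeight_nonneg hθ _
  unfold classTermLS
  rw [dif_pos h]
  split_ifs with hWE
  · obtain ⟨hz01, hz02, hz12⟩ := ω.firstSide_exit_return_distinct hr h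
    have hN := LS_sides_ne_N hh hr h
    have hEW := LS_firstSide_eq_E_or_W hh hr h
    rw [norm_mul, norm_dirLS hz01 hz02 hz12 hN hEW, mul_one, Complex.norm_real, Real.norm_eq_abs, abs_of_nonneg hext]
  · simpa using hext


/-- ★ The rotated class term at cell LS of a wound walk entering from `E` has positive real part;
an unwound walk contributes `0`. [cite: GlazmanManolescu2019, Lemma 2.1 (statement, "in the form given in [Gl]")] [cite: Glazman2015WeightedSAW, Lemma 3.1, eq. (1) (the weight v(θ))] -/
theorem re_rot_classTermLS_E (hh : holeFaceW w ∉ D) {θ : ℝ} (hθ : θ ∈ Set.Ioo (π / 3) (2 * π / 3))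
    (hr : RootedFace D (w.side .W) (latS w)) (ω : ΩG D (w.side .W) (latS w)) (h : ω.IsB2a) (hz : ω.2.firstSideG = .E) :
    0 ≤ (Complex.exp ((((-(9 * π / 8) : ℝ)) : ℂ) * Complex.I) * classTermLS θ hr ω).re ∧
      (ω.WE (fun _ => θ) ≠ excursionWinding θ ω.2.firstSideG (ω.z1 hr h) ω.1 →
        0 < (Complex.exp ((((-(9 * π / 8) : ℝ)) : ℂ) * Complex.I) * classTermLS θ hr ω).re) := by
  have hθ' : θ ∈ Set.Icc (π / 3) (2 * π / 3) := Set.Ioo_subset_Icc_self hθ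
  obtain ⟨hz01, hz02, hz12⟩ := ω.firstSide_exit_return_distinct hr h
  have hN := LS_sides_ne_N hh hr h
  have hEW := LS_firstSide_eq_E_or_W hh hr h
  have hext : 0 < ω.2.extWeight (fun _ => θ) (latS w) := Finset.prod_pos fun g _ => localWeight_kindsIn_posR hθ ω.2 g
  have hdir := re_rot_dirLS_pos_E hθ' hz01 hz02 hz12 hN hEW hz
  have key : ∀ hw : ω.WE (fun _ => θ) ≠ excursionWinding θ ω.2.firstSideG (ω.z1 hr h) ω.1,
      (Complex.exp ((((-(9 * π / 8) : ℝ)) : ℂ) * Complex.I) * classTermLS θ hr ω).re =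
        ω.2.extWeight (fun _ => θ) (latS w) *
          (Complex.exp ((((-(9 * π / 8) : ℝ)) : ℂ) * Complex.I) * dirLS θ ω.2.firstSideG (ω.z1 hr h) ω.1).re := by
    intro hw
    rw [classTermLS, dif_pos h, if_pos hw, show Complex.exp ((((-(9 * π / 8) : ℝ)) : ℂ) * Complex.I) *
        ((ω.2.extWeight (fun _ => θ) (latS w) : ℂ) * dirLS θ ω.2.firstSideG (ω.z1 hr h) ω.1) =
        (ω.2.extWeight (fun _ => θ) (latS w) : ℂ) *
          (Complex.exp ((((-(9 * π / 8) : ℝ)) : ℂ) * Complex.I) * dirLS θ ω.2.firstSideG (ω.z1 hr h) ω.1) by ring,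
      Complex.re_ofReal_mul]
  constructor
  · by_cases hw : ω.WE (fun _ => θ) ≠ excursionWinding θ ω.2.firstSideG (ω.z1 hr h) ω.1
    · rw [key hw]; exact (mul_pos hext hdir).le
    · rw [classTermLS, dif_pos h, if_neg hw, mul_zero, Complex.zero_re]
  · intro hw
    rw [key hw]; exact mul_pos hext hdir

/-- ★ The rotated class term at cell LS of a wound walk entering from `W` has positive real part;
an unwound walk contributes `0`. [cite: GlazmanManolescu2019, Lemma 2.1 (statement, "in the form given in [Gl]")] [cite: Glazman2015WeightedSAW, Lemma 3.1, eq. (1) (the weight v(θ))] -/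
theorem re_rot_classTermLS_W (hh : holeFaceW w ∉ D) {θ : ℝ} (hθ : θ ∈ Set.Ioo (π / 3) (2 * π / 3))
    (hr : RootedFace D (w.side .W) (latS w)) (ω : ΩG D (w.side .W) (latS w)) (h : ω.IsB2a) (hz : ω.2.firstSideG = .W) :
    0 ≤ (Complex.exp ((((-(π / 8) : ℝ)) : ℂ) * Complex.I) * classTermLS θ hr ω).re ∧
      (ω.WE (fun _ => θ) ≠ excursionWinding θ ω.2.firstSideG (ω.z1 hr h) ω.1 →
        0 < (Complex.exp ((((-(π / 8) : ℝ)) : ℂ) * Complex.I) * classTermLS θ hr ω).re) := by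
  have hθ' : θ ∈ Set.Icc (π / 3) (2 * π / 3) := Set.Ioo_subset_Icc_self hθ
  obtain ⟨hz01, hz02, hz12⟩ := ω.firstSide_exit_return_distinct hr h
  have hN := LS_sides_ne_N hh hr h
  have hEW := LS_firstSide_eq_E_or_W hh hr h
  have hext : 0 < ω.2.extWeight (fun _ => θ) (latS w) := Finset.prod_pos fun g _ => localWeight_kindsIn_posR hθ ω.2 g
  have hdir := re_rot_dirLS_pos_W hθ' hz01 hz02 hz12 hN hEW hz
  have key : ∀ hw : ω.WE (fun _ => θ) ≠ excursionWinding θ ω.2.firstSideG (ω.z1 hr h) ω.1,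
      (Complex.exp ((((-(π / 8) : ℝ)) : ℂ) * Complex.I) * classTermLS θ hr ω).re =
        ω.2.extWeight (fun _ => θ) (latS w) *
          (Complex.exp ((((-(π / 8) : ℝ)) : ℂ) * Complex.I) * dirLS θ ω.2.firstSideG (ω.z1 hr h) ω.1).re := by
    intro hw
    rw [classTermLS, dif_pos h, if_pos hw, show Complex.exp ((((-(π / 8) : ℝ)) : ℂ) * Complex.I) *
        ((ω.2.extWeight (fun _ => θ) (latS w) : ℂ) * dirLS θ ω.2.firstSideG (ω.z1 hr h) ω.1) =
        (ω.2.extWeight (fun _ => θ) (latS w) : ℂ) *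
          (Complex.exp ((((-(π / 8) : ℝ)) : ℂ) * Complex.I) * dirLS θ ω.2.firstSideG (ω.z1 hr h) ω.1) by ring,
      Complex.re_ofReal_mul]
  constructor
  · by_cases hw : ω.WE (fun _ => θ) ≠ excursionWinding θ ω.2.firstSideG (ω.z1 hr h) ω.1
    · rw [key hw]; exact (mul_pos hext hdir).le
    · rw [classTermLS, dif_pos h, if_neg hw, mul_zero, Complex.zero_re]
  · intro hw
    rw [key hw]; exact mul_pos hext hdir

variable [Finite D]

/-- ★★ The grouped sum at cell LS. [cite: GlazmanManolescu2019, Lemma 2.1 (statement, "in the form given in [Gl]")] [cite: Glazman2015WeightedSAW, Lemma 3.1 (proof, pp. 6–7)] -/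
theorem sum_classTerm_LS (hh : holeFaceW w ∉ D) {θ : ℝ} (hr : RootedFace D (w.side .W) (latS w)) :
    ∑ ω ∈ setB2a D (w.side .W) (latS w), ω.classTerm (fun _ => θ) hr =
      (weightV θ : ℂ) * ∑ ω ∈ setB2a D (w.side .W) (latS w), classTermLS θ hr ω := by
  rw [Finset.mul_sum]
  refine Finset.sum_congr rfl fun ω hω => ?_
  simp only [setB2a, Finset.mem_filter, Finset.mem_univ, true_and] at hω
  exact ω.classTerm_LS hh hr hω

end ClassTermLS

end ΩG

/-! ## § Cell LN — the lateral cell north of the hole (the lateral file's cell): class directions and the cell law -/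

section LawLN

/-- **The class directions at cell LN** (symmetric in exit/return; junk `0` on the excluded and degenerate patterns):
`E`: {N,W} ↦ `e^{i(3 * θ / 8 - 3 * π / 8)}`; `W`: {E,N} ↦ `e^{i(3 * θ / 8 + 5 * π / 8)}`. [cite: GlazmanManolescu2019, Lemma 2.1 (statement, "in the form given in [Gl]")] [cite: Glazman2015WeightedSAW, Lemma 3.1, eq. (1) (the weight v(θ))] -/
def dirLN (θ : ℝ) : Side → Side → Side → ℂ
  | .E, .N, .W => Complex.exp ((((3 * θ / 8 - 3 * π / 8 : ℝ)) : ℂ) * Complex.I)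
  | .E, .W, .N => Complex.exp ((((3 * θ / 8 - 3 * π / 8 : ℝ)) : ℂ) * Complex.I)
  | .W, .E, .N => Complex.exp ((((3 * θ / 8 + 5 * π / 8 : ℝ)) : ℂ) * Complex.I)
  | .W, .N, .E => Complex.exp ((((3 * θ / 8 + 5 * π / 8 : ℝ)) : ℂ) * Complex.I)
  | _, _, _ => 0

/-- The class directions at cell LN are symmetric in the exit and return sides. [folklore] -/
private theorem dirLN_swap (θ : ℝ) (z₀ z₁ z₂ : Side) : dirLN θ z₀ z₂ z₁ = dirLN θ z₀ z₁ z₂ := by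
  cases z₀ <;> cases z₁ <;> cases z₂ <;> rfl

/-- The prefix turning at angle `θ` at cell LN, by first side (junk `0` on sides that do not occur). [cite: GlazmanManolescu2019, Lemma 2.1 (proof: [Gl])] -/
def turnAtLN (_θ : ℝ) : Side → ℝ
  | .N => 0
  | .E => π
  | .S => 0
  | .W => -(2 * π)

/-- Cell LN, first side `E`, class `{N, W}`: `phase(WP)·ε·backBracket = v(θ)·e^{i(3 * θ / 8 - 3 * π / 8)}` (private: the same
identity recurs at every cell with the same pinned turning; the public form is `dir_term_LN`). [cite: Glazman2015WeightedSAW, Lemma 3.1, eq. (1) (the weight v(θ))] [cite: GlazmanManolescu2019, Lemma 2.1 (proof: [Gl])] -/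
private theorem dir_term_LN_E_N_W (θ : ℝ) :
    phase (π) * ((chordSign .E .N .W : ℂ) * backBracket θ .E .N .W .S) =
      (weightV θ : ℂ) * Complex.exp ((((3 * θ / 8 - 3 * π / 8 : ℝ)) : ℂ) * Complex.I) := by
  have hcs : ((chordSign .E .N .W : ℤ) : ℂ) = -1 := by
    rw [show chordSign .E .N .W = -1 by decide]; simp
  rw [backBracket_E_N_W_S, phase, hcs]
  have f : -(Complex.exp ((((-(5 / 8 * (π))) : ℝ) : ℂ) * Complex.I) * Complex.exp ((((3 * θ / 8 + 5 * π / 4 : ℝ)) : ℂ) * Complex.I)) = Complex.exp ((((3 * θ / 8 - 3 * π / 8 : ℝ)) : ℂ) * Complex.I) := by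
    rw [cexp_mul_cexpR, neg_cexpR]; exact cexp_I_eq_of_intR _ _ (1) (by push_cast; ring)
  linear_combination (weightV θ : ℂ) * f

/-- Cell LN, first side `W`, class `{E, N}`: `phase(WP)·ε·backBracket = v(θ)·e^{i(3 * θ / 8 + 5 * π / 8)}` (private: the same
identity recurs at every cell with the same pinned turning; the public form is `dir_term_LN`). [cite: Glazman2015WeightedSAW, Lemma 3.1, eq. (1) (the weight v(θ))] [cite: GlazmanManolescu2019, Lemma 2.1 (proof: [Gl])] -/
private theorem dir_term_LN_W_E_N (θ : ℝ) :
    phase (-(2 * π)) * ((chordSign .W .E .N : ℂ) * backBracket θ .W .E .N .S) =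
      (weightV θ : ℂ) * Complex.exp ((((3 * θ / 8 + 5 * π / 8 : ℝ)) : ℂ) * Complex.I) := by
  have hcs : ((chordSign .W .E .N : ℤ) : ℂ) = -1 := by
    rw [show chordSign .W .E .N = -1 by decide]; simp
  rw [backBracket_W_E_N_S, phase, hcs]
  have f : -(Complex.I * (Complex.exp ((((-(5 / 8 * (-(2 * π)))) : ℝ) : ℂ) * Complex.I) * Complex.exp ((((3 * θ / 8 - π / 8 : ℝ)) : ℂ) * Complex.I))) = Complex.exp ((((3 * θ / 8 + 5 * π / 8 : ℝ)) : ℂ) * Complex.I) := by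
    rw [cexp_mul_cexpR, I_mul_cexpR, neg_cexpR]; exact cexp_I_eq_of_intR _ _ (1) (by push_cast; ring)
  linear_combination (weightV θ : ℂ) * f

/-- The directly listed realizable patterns at cell LN. [folklore] -/
def dirPatternsLN : List (Side × Side × Side) := [(.E, .N, .W), (.W, .E, .N)]

/-- ★ The class term algebra at cell LN, listed patterns. [cite: GlazmanManolescu2019, Lemma 2.1 (statement, "in the form given in [Gl]")] [cite: Glazman2015WeightedSAW, Lemma 3.1, eq. (1) (the weight v(θ))] -/
theorem dir_term_LN_of_mem (θ : ℝ) {z₀ z₁ z₂ z₃ : Side} (hmem : (z₀, z₁, z₂) ∈ dirPatternsLN)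
    (h3 : z₃ ≠ z₀ ∧ z₃ ≠ z₁ ∧ z₃ ≠ z₂) :
    phase (turnAtLN θ z₀) * ((chordSign z₀ z₁ z₂ : ℂ) * backBracket θ z₀ z₁ z₂ z₃) = (weightV θ : ℂ) * dirLN θ z₀ z₁ z₂ := by
  obtain ⟨h3a, h3b, h3c⟩ := h3
  simp only [dirPatternsLN, List.mem_cons, Prod.mk.injEq, List.mem_nil_iff, or_false] at hmem
  rcases hmem with ⟨rfl, rfl, rfl⟩ | ⟨rfl, rfl, rfl⟩
  · obtain rfl : z₃ = .S := by revert h3a h3b h3c; cases z₃ <;> simp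
    exact dir_term_LN_E_N_W θ
  · obtain rfl : z₃ = .S := by revert h3a h3b h3c; cases z₃ <;> simp
    exact dir_term_LN_W_E_N θ

/-- Every admissible pattern at cell LN is listed directly or reversed. [folklore] -/
private theorem dirPatternsLN_cover : ∀ a b c : Side, a ≠ b → a ≠ c → b ≠ c → a ≠ .S → b ≠ .S → c ≠ .S → (a = .E ∨ a = .W) →
    (a, b, c) ∈ dirPatternsLN ∨ (a, c, b) ∈ dirPatternsLN := by decide

/-- ★★ **The class term algebra at cell LN, all realizable patterns.** [cite: GlazmanManolescu2019, Lemma 2.1 (statement, "in the form given in [Gl]")] [cite: Glazman2015WeightedSAW, Lemma 3.1, eq. (1) (the weight v(θ))] -/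
theorem dir_term_LN (θ : ℝ) {z₀ z₁ z₂ z₃ : Side} (h01 : z₀ ≠ z₁) (h02 : z₀ ≠ z₂) (h12 : z₁ ≠ z₂)
    (h3 : z₃ ≠ z₀ ∧ z₃ ≠ z₁ ∧ z₃ ≠ z₂) (hN : z₀ ≠ .S ∧ z₁ ≠ .S ∧ z₂ ≠ .S) (hEW : z₀ = .E ∨ z₀ = .W) :
    phase (turnAtLN θ z₀) * ((chordSign z₀ z₁ z₂ : ℂ) * backBracket θ z₀ z₁ z₂ z₃) = (weightV θ : ℂ) * dirLN θ z₀ z₁ z₂ := by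
  rcases dirPatternsLN_cover _ _ _ h01 h02 h12 hN.1 hN.2.1 hN.2.2 hEW with hd | hd
  · exact dir_term_LN_of_mem θ hd h3
  · rw [← ΩG.chordSign_mul_backBracket_swap θ h01 h02 (Ne.symm h3.1) h12 (Ne.symm h3.2.1) (Ne.symm h3.2.2),
      ← dirLN_swap]
    exact dir_term_LN_of_mem θ hd ⟨h3.1, h3.2.2, h3.2.1⟩

/-- The realizable class directions at cell LN have modulus `1`. [cite: Glazman2015WeightedSAW, Lemma 3.1, eq. (1) (the weight v(θ))] -/
theorem norm_dirLN {θ : ℝ} {z₀ z₁ z₂ : Side} (h01 : z₀ ≠ z₁) (h02 : z₀ ≠ z₂) (h12 : z₁ ≠ z₂) (hN : z₀ ≠ .S ∧ z₁ ≠ .S ∧ z₂ ≠ .S) (hEW : z₀ = .E ∨ z₀ = .W) :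
    ‖dirLN θ z₀ z₁ z₂‖ = 1 := by
  obtain ⟨hN0, hN1, hN2⟩ := hN
  cases z₀ <;> cases z₁ <;> cases z₂ <;> simp only [dirLN] <;>
    first
    | exact absurd rfl h01
    | exact absurd rfl h02
    | exact absurd rfl h12
    | exact absurd rfl hN0
    | exact absurd rfl hN1
    | exact absurd rfl hN2
    | (exfalso; rcases hEW with e | e <;> exact absurd e (by decide))
    | exact Complex.norm_exp_ofReal_mul_I _

end LawLN

/-! ### Cones at cell LN -/

section ConeLN

/-- ★ **The `E` cone at cell LN**: after rotation by `e^{i(3 * π / 16)}` every class direction of a walk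
that entered from `E` has positive real part (`θ ∈ [π/3, 2π/3]`). [cite: Glazman2015WeightedSAW, Lemma 3.1, eq. (1) (the weight v(θ))] -/
theorem re_rot_dirLN_pos_E {θ : ℝ} (hθ : θ ∈ Set.Icc (π / 3) (2 * π / 3)) {z₀ z₁ z₂ : Side}
    (h01 : z₀ ≠ z₁) (h02 : z₀ ≠ z₂) (h12 : z₁ ≠ z₂) (hN : z₀ ≠ .S ∧ z₁ ≠ .S ∧ z₂ ≠ .S) (hEW : z₀ = .E ∨ z₀ = .W) (hz : z₀ = .E) :
    0 < (Complex.exp ((((3 * π / 16 : ℝ)) : ℂ) * Complex.I) * dirLN θ z₀ z₁ z₂).re := by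
  have hπ := Real.pi_pos
  obtain ⟨h1, h2⟩ := hθ
  have c1 : 0 < (Complex.exp ((((3 * π / 16 : ℝ)) : ℂ) * Complex.I) * Complex.exp ((((3 * θ / 8 - 3 * π / 8 : ℝ)) : ℂ) * Complex.I)).re := by
    rw [re_cexp_mul_cexpR]; exact Real.cos_pos_of_mem_Ioo ⟨by linarith, by linarith⟩
  cases z₀ <;> cases z₁ <;> cases z₂ <;> simp only [dirLN] <;>
    first
    | exact absurd rfl h01
    | exact absurd rfl h02
    | exact absurd rfl h12
    | exact absurd rfl hN.1
    | exact absurd rfl hN.2.1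
    | exact absurd rfl hN.2.2
    | (exfalso; rcases hEW with e | e <;> exact absurd e (by decide))
    | (exfalso; exact absurd hz (by decide))
    | exact c1

/-- ★ **The `W` cone at cell LN**: after rotation by `e^{i(-(13 * π / 16))}` every class direction of a walk
that entered from `W` has positive real part (`θ ∈ [π/3, 2π/3]`). [cite: Glazman2015WeightedSAW, Lemma 3.1, eq. (1) (the weight v(θ))] -/
theorem re_rot_dirLN_pos_W {θ : ℝ} (hθ : θ ∈ Set.Icc (π / 3) (2 * π / 3)) {z₀ z₁ z₂ : Side}
    (h01 : z₀ ≠ z₁) (h02 : z₀ ≠ z₂) (h12 : z₁ ≠ z₂) (hN : z₀ ≠ .S ∧ z₁ ≠ .S ∧ z₂ ≠ .S) (hEW : z₀ = .E ∨ z₀ = .W) (hz : z₀ = .W) :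
    0 < (Complex.exp ((((-(13 * π / 16) : ℝ)) : ℂ) * Complex.I) * dirLN θ z₀ z₁ z₂).re := by
  have hπ := Real.pi_pos
  obtain ⟨h1, h2⟩ := hθ
  have c1 : 0 < (Complex.exp ((((-(13 * π / 16) : ℝ)) : ℂ) * Complex.I) * Complex.exp ((((3 * θ / 8 + 5 * π / 8 : ℝ)) : ℂ) * Complex.I)).re := by
    rw [re_cexp_mul_cexpR]; exact Real.cos_pos_of_mem_Ioo ⟨by linarith, by linarith⟩
  cases z₀ <;> cases z₁ <;> cases z₂ <;> simp only [dirLN] <;>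
    first
    | exact absurd rfl h01
    | exact absurd rfl h02
    | exact absurd rfl h12
    | exact absurd rfl hN.1
    | exact absurd rfl hN.2.1
    | exact absurd rfl hN.2.2
    | (exfalso; rcases hEW with e | e <;> exact absurd e (by decide))
    | (exfalso; exact absurd hz (by decide))
    | exact c1

end ConeLN

namespace ΩG

section ClassTermLN

variable {D : Set Face} {w : Face}

open Classical in
/-- **The class term of a walk at cell LN**: for a WOUND class-`B2a` walk, its exterior weight times its class direction;
else `0`. [cite: GlazmanManolescu2019, Lemma 2.1 (statement, "in the form given in [Gl]")] [cite: Glazman2015WeightedSAW, Lemma 3.1 (proof, pp. 6–7)] -/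
noncomputable def classTermLN (θ : ℝ) (hr : RootedFace D (w.side .W) (latN w)) (ω : ΩG D (w.side .W) (latN w)) : ℂ :=
  if h : ω.IsB2a then
    (if ω.WE (fun _ => θ) ≠ excursionWinding θ ω.2.firstSideG (ω.z1 hr h) ω.1 then
      (ω.2.extWeight (fun _ => θ) (latN w) : ℂ) * dirLN θ ω.2.firstSideG (ω.z1 hr h) ω.1 else 0)
  else 0

/-- ★★★ **THE CLASS TERM AT CELL LN IS EXPLICIT**: `classTerm = v(θ) · classTermLN`. [cite: GlazmanManolescu2019, Lemma 2.1 (statement, "in the form given in [Gl]")] [cite: Glazman2015WeightedSAW, Lemma 3.1 (proof, pp. 6–7)] [cite: Hopf1935, Nr. 2 (Umlaufsatz, p. 53) and Nr. 4 eq. (22) (curves with corners, pp. 60–61)] -/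
theorem classTerm_LN (hh : holeFaceW w ∉ D) {θ : ℝ} (ω : ΩG D (w.side .W) (latN w))
    (hr : RootedFace D (w.side .W) (latN w)) (h : ω.IsB2a) :
    ω.classTerm (fun _ => θ) hr = (weightV θ : ℂ) * classTermLN θ hr ω := by
  rcases ω.classTerm_dichotomy hr h θ with ⟨hWE, h0⟩ | ⟨hWE, hct⟩
  · rw [h0, classTermLN, dif_pos h, if_neg (fun H => H hWE)]; simp
  · obtain ⟨hz01, hz02, hz12⟩ := ω.firstSide_exit_return_distinct hr h
    have h3 := ω.z₃_spec hr h
    have hN := LN_sides_ne_S hh hr h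
    have hEW := LN_firstSide_eq_E_or_W hh hr h
    have hWP : ω.WP (fun _ => θ) = turnAtLN θ ω.2.firstSideG := by
      rcases hEW with hz | hz
      · rw [(WP_LN_eq_of_wound hh hr h θ hWE).1 hz, hz]; rfl
      · rw [(WP_LN_eq_of_wound hh hr h θ hWE).2 hz, hz]; rfl
    rw [hct, classTermLN, dif_pos h, if_pos hWE, hWP, mul_assoc, mul_assoc,
      dir_term_LN θ hz01 hz02 hz12 ⟨h3.1, h3.2.1, h3.2.2⟩ hN hEW]
    ring

/-- The modulus of the class term of a class-`B2a` walk at cell LN is at most its exterior weight. [cite: GlazmanManolescu2019, eq. (1) (the weights are non-negative)] -/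
theorem norm_classTermLN_le (hh : holeFaceW w ∉ D) {θ : ℝ} (hθ : θ ∈ Set.Icc (π / 3) (2 * π / 3))
    (hr : RootedFace D (w.side .W) (latN w)) (ω : ΩG D (w.side .W) (latN w)) (h : ω.IsB2a) :
    ‖classTermLN θ hr ω‖ ≤ ω.2.extWeight (fun _ => θ) (latN w) := by
  have hext : 0 ≤ ω.2.extWeight (fun _ => θ) (latN w) := Finset.prod_nonneg fun _ _ => localWeight_nonneg hθ _
  unfold classTermLN
  rw [dif_pos h]
  split_ifs with hWE
  · obtain ⟨hz01, hz02, hz12⟩ := ω.firstSide_exit_return_distinct hr h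
    have hN := LN_sides_ne_S hh hr h
    have hEW := LN_firstSide_eq_E_or_W hh hr h
    rw [norm_mul, norm_dirLN hz01 hz02 hz12 hN hEW, mul_one, Complex.norm_real, Real.norm_eq_abs, abs_of_nonneg hext]
  · simpa using hext


/-- ★ The rotated class term at cell LN of a wound walk entering from `E` has positive real part;
an unwound walk contributes `0`. [cite: GlazmanManolescu2019, Lemma 2.1 (statement, "in the form given in [Gl]")] [cite: Glazman2015WeightedSAW, Lemma 3.1, eq. (1) (the weight v(θ))] -/
theorem re_rot_classTermLN_E (hh : holeFaceW w ∉ D) {θ : ℝ} (hθ : θ ∈ Set.Ioo (π / 3) (2 * π / 3))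
    (hr : RootedFace D (w.side .W) (latN w)) (ω : ΩG D (w.side .W) (latN w)) (h : ω.IsB2a) (hz : ω.2.firstSideG = .E) :
    0 ≤ (Complex.exp ((((3 * π / 16 : ℝ)) : ℂ) * Complex.I) * classTermLN θ hr ω).re ∧
      (ω.WE (fun _ => θ) ≠ excursionWinding θ ω.2.firstSideG (ω.z1 hr h) ω.1 →
        0 < (Complex.exp ((((3 * π / 16 : ℝ)) : ℂ) * Complex.I) * classTermLN θ hr ω).re) := by
  have hθ' : θ ∈ Set.Icc (π / 3) (2 * π / 3) := Set.Ioo_subset_Icc_self hθ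
  obtain ⟨hz01, hz02, hz12⟩ := ω.firstSide_exit_return_distinct hr h
  have hN := LN_sides_ne_S hh hr h
  have hEW := LN_firstSide_eq_E_or_W hh hr h
  have hext : 0 < ω.2.extWeight (fun _ => θ) (latN w) := Finset.prod_pos fun g _ => localWeight_kindsIn_posR hθ ω.2 g
  have hdir := re_rot_dirLN_pos_E hθ' hz01 hz02 hz12 hN hEW hz
  have key : ∀ hw : ω.WE (fun _ => θ) ≠ excursionWinding θ ω.2.firstSideG (ω.z1 hr h) ω.1,
      (Complex.exp ((((3 * π / 16 : ℝ)) : ℂ) * Complex.I) * classTermLN θ hr ω).re =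
        ω.2.extWeight (fun _ => θ) (latN w) *
          (Complex.exp ((((3 * π / 16 : ℝ)) : ℂ) * Complex.I) * dirLN θ ω.2.firstSideG (ω.z1 hr h) ω.1).re := by
    intro hw
    rw [classTermLN, dif_pos h, if_pos hw, show Complex.exp ((((3 * π / 16 : ℝ)) : ℂ) * Complex.I) *
        ((ω.2.extWeight (fun _ => θ) (latN w) : ℂ) * dirLN θ ω.2.firstSideG (ω.z1 hr h) ω.1) =
        (ω.2.extWeight (fun _ => θ) (latN w) : ℂ) *
          (Complex.exp ((((3 * π / 16 : ℝ)) : ℂ) * Complex.I) * dirLN θ ω.2.firstSideG (ω.z1 hr h) ω.1) by ring,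
      Complex.re_ofReal_mul]
  constructor
  · by_cases hw : ω.WE (fun _ => θ) ≠ excursionWinding θ ω.2.firstSideG (ω.z1 hr h) ω.1
    · rw [key hw]; exact (mul_pos hext hdir).le
    · rw [classTermLN, dif_pos h, if_neg hw, mul_zero, Complex.zero_re]
  · intro hw
    rw [key hw]; exact mul_pos hext hdir

/-- ★ The rotated class term at cell LN of a wound walk entering from `W` has positive real part;
an unwound walk contributes `0`. [cite: GlazmanManolescu2019, Lemma 2.1 (statement, "in the form given in [Gl]")] [cite: Glazman2015WeightedSAW, Lemma 3.1, eq. (1) (the weight v(θ))] -/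
theorem re_rot_classTermLN_W (hh : holeFaceW w ∉ D) {θ : ℝ} (hθ : θ ∈ Set.Ioo (π / 3) (2 * π / 3))
    (hr : RootedFace D (w.side .W) (latN w)) (ω : ΩG D (w.side .W) (latN w)) (h : ω.IsB2a) (hz : ω.2.firstSideG = .W) :
    0 ≤ (Complex.exp ((((-(13 * π / 16) : ℝ)) : ℂ) * Complex.I) * classTermLN θ hr ω).re ∧
      (ω.WE (fun _ => θ) ≠ excursionWinding θ ω.2.firstSideG (ω.z1 hr h) ω.1 →
        0 < (Complex.exp ((((-(13 * π / 16) : ℝ)) : ℂ) * Complex.I) * classTermLN θ hr ω).re) := by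
  have hθ' : θ ∈ Set.Icc (π / 3) (2 * π / 3) := Set.Ioo_subset_Icc_self hθ
  obtain ⟨hz01, hz02, hz12⟩ := ω.firstSide_exit_return_distinct hr h
  have hN := LN_sides_ne_S hh hr h
  have hEW := LN_firstSide_eq_E_or_W hh hr h
  have hext : 0 < ω.2.extWeight (fun _ => θ) (latN w) := Finset.prod_pos fun g _ => localWeight_kindsIn_posR hθ ω.2 g
  have hdir := re_rot_dirLN_pos_W hθ' hz01 hz02 hz12 hN hEW hz
  have key : ∀ hw : ω.WE (fun _ => θ) ≠ excursionWinding θ ω.2.firstSideG (ω.z1 hr h) ω.1,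
      (Complex.exp ((((-(13 * π / 16) : ℝ)) : ℂ) * Complex.I) * classTermLN θ hr ω).re =
        ω.2.extWeight (fun _ => θ) (latN w) *
          (Complex.exp ((((-(13 * π / 16) : ℝ)) : ℂ) * Complex.I) * dirLN θ ω.2.firstSideG (ω.z1 hr h) ω.1).re := by
    intro hw
    rw [classTermLN, dif_pos h, if_pos hw, show Complex.exp ((((-(13 * π / 16) : ℝ)) : ℂ) * Complex.I) *
        ((ω.2.extWeight (fun _ => θ) (latN w) : ℂ) * dirLN θ ω.2.firstSideG (ω.z1 hr h) ω.1) =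
        (ω.2.extWeight (fun _ => θ) (latN w) : ℂ) *
          (Complex.exp ((((-(13 * π / 16) : ℝ)) : ℂ) * Complex.I) * dirLN θ ω.2.firstSideG (ω.z1 hr h) ω.1) by ring,
      Complex.re_ofReal_mul]
  constructor
  · by_cases hw : ω.WE (fun _ => θ) ≠ excursionWinding θ ω.2.firstSideG (ω.z1 hr h) ω.1
    · rw [key hw]; exact (mul_pos hext hdir).le
    · rw [classTermLN, dif_pos h, if_neg hw, mul_zero, Complex.zero_re]
  · intro hw
    rw [key hw]; exact mul_pos hext hdir

variable [Finite D]

/-- ★★ The grouped sum at cell LN. [cite: GlazmanManolescu2019, Lemma 2.1 (statement, "in the form given in [Gl]")] [cite: Glazman2015WeightedSAW, Lemma 3.1 (proof, pp. 6–7)] -/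
theorem sum_classTerm_LN (hh : holeFaceW w ∉ D) {θ : ℝ} (hr : RootedFace D (w.side .W) (latN w)) :
    ∑ ω ∈ setB2a D (w.side .W) (latN w), ω.classTerm (fun _ => θ) hr =
      (weightV θ : ℂ) * ∑ ω ∈ setB2a D (w.side .W) (latN w), classTermLN θ hr ω := by
  rw [Finset.mul_sum]
  refine Finset.sum_congr rfl fun ω hω => ?_
  simp only [setB2a, Finset.mem_filter, Finset.mem_univ, true_and] at hω
  exact ω.classTerm_LN hh hr hω

end ClassTermLN

end ΩG

end Literature.Probability.RandomPlanarGeometry.SAW.YangBaxter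

/-! ## § THE CELL LAWS -/

namespace Literature.Barriers.CriticalPhenomena.PlaquetteWalk

open Literature.Probability.RandomPlanarGeometry.SAW.YangBaxter
open Real Complex

/-- ★★★★ **THE CELL LAW AT SE** (the cell south of the root plaquette (`SE` of the hole)): for `θ ∈ [π/3, 2π/3]`, `rootS w ∈ Dl`, `holeFaceW w ∉ dom Dl`:
`VF_D(w.side W, rootS w) = i·v(θ)·Σ_{B2a} classTermSE` — every wound walk contributes its exterior weight along one explicit
unit direction fixed by its first side and class. [cite: GlazmanManolescu2019, Lemma 2.1 (statement, "in the form given in [Gl]")] [cite: Glazman2015WeightedSAW, Lemma 3.1 (proof, pp. 6–7)] [cite: Hopf1935, Nr. 2 (Umlaufsatz, p. 53) and Nr. 4 eq. (22) (curves with corners, pp. 60–61)] -/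
theorem vertexFunctional_printed_SE_eq {θ : ℝ} (hθ : θ ∈ Set.Icc (π / 3) (2 * π / 3))
    (Dl : List Face) (w : Face) (hf : rootS w ∈ Dl) (hh : holeFaceW w ∉ dom Dl)
    (hr : RootedFace (dom Dl) (w.side .W) (rootS w)) :
    vertexFunctional (printedWeights θ) tFiveEighths (ybCoeff θ) Dl (w.side .W) (rootS w) =
      Complex.I * (weightV θ : ℂ) * ∑ ω ∈ ΩG.setB2a (dom Dl) (w.side .W) (rootS w), ΩG.classTermSE θ hr ω := by
  have _ := hf
  rw [vertexFunctional_printed_eq_phase_mul_lem21Defect, ← ΩG.sum_g_eq_lem21Defect,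
    ΩG.sum_g_eq_I_mul_sum_classTerm (fun _ => θ) hr (fun _ => hθ), ΩG.sum_classTerm_SE hh hr, slantPot_sideW]
  have e0 : Complex.exp (((-(5 / 8 * (0 : ℝ)) : ℝ) : ℂ) * Complex.I) = 1 := by simp
  rw [e0, one_mul, mul_assoc]

/-- ★★ The bound at cell SE: `‖VF‖ ≤ v(θ)·Σ_{B2a} extWeight`. [cite: GlazmanManolescu2019, Lemma 2.1 (statement, "in the form given in [Gl]")] [cite: Glazman2015WeightedSAW, Lemma 3.1, eq. (1) (the weight v(θ))] -/
theorem norm_vertexFunctional_printed_SE_le {θ : ℝ} (hθ : θ ∈ Set.Icc (π / 3) (2 * π / 3))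
    (Dl : List Face) (w : Face) (hf : rootS w ∈ Dl) (hh : holeFaceW w ∉ dom Dl)
    (hr : RootedFace (dom Dl) (w.side .W) (rootS w)) :
    ‖vertexFunctional (printedWeights θ) tFiveEighths (ybCoeff θ) Dl (w.side .W) (rootS w)‖ ≤
      weightV θ * ∑ ω ∈ ΩG.setB2a (dom Dl) (w.side .W) (rootS w), ω.2.extWeight (fun _ => θ) (rootS w) := by
  rw [vertexFunctional_printed_SE_eq hθ Dl w hf hh hr, norm_mul, norm_mul, Complex.norm_I, one_mul,
    Complex.norm_real, Real.norm_eq_abs, abs_of_nonneg (weightV_nonneg hθ)]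
  refine mul_le_mul_of_nonneg_left ((norm_sum_le _ _).trans (Finset.sum_le_sum fun ω hω => ?_)) (weightV_nonneg hθ)
  simp only [ΩG.setB2a, Finset.mem_filter, Finset.mem_univ, true_and] at hω
  exact ΩG.norm_classTermSE_le hh hθ hr ω hω

/-- ★★★ **THE `N/E` CONE LAW AT CELL SE** (a sufficient-half instance of the lane's encircling criterion at a cell of
the ring other than the root's own plaquette): on `θ ∈ (π/3, 2π/3)`, if every WOUND class-`B2a` walk at the cell entered from
`N` or `E` and one wound walk exists, then `VF_D(w.side W, cell) ≠ 0`. [cite: GlazmanManolescu2019, Lemma 2.1 (statement, "in the form given in [Gl]")] [cite: Glazman2015WeightedSAW, Lemma 3.1 (proof, pp. 6–7)] [cite: Hopf1935, Nr. 2 (Umlaufsatz, p. 53) and Nr. 4 eq. (22) (curves with corners, pp. 60–61)] -/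
theorem vertexFunctional_printed_SE_ne_zero_of_NE {θ : ℝ} (hθ : θ ∈ Set.Ioo (π / 3) (2 * π / 3))
    (Dl : List Face) (w : Face) (hf : rootS w ∈ Dl) (hh : holeFaceW w ∉ dom Dl)
    (hr : RootedFace (dom Dl) (w.side .W) (rootS w))
    (hgrp : ∀ (ω : ΩG (dom Dl) (w.side .W) (rootS w)) (h : ω.IsB2a),
      ω.WE (fun _ => θ) ≠ excursionWinding θ ω.2.firstSideG (ω.z1 hr h) ω.1 → ω.2.firstSideG = .N ∨ ω.2.firstSideG = .E)
    (hex : ∃ (ω : ΩG (dom Dl) (w.side .W) (rootS w)) (h : ω.IsB2a),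
      ω.WE (fun _ => θ) ≠ excursionWinding θ ω.2.firstSideG (ω.z1 hr h) ω.1) :
    vertexFunctional (printedWeights θ) tFiveEighths (ybCoeff θ) Dl (w.side .W) (rootS w) ≠ 0 := by
  classical
  have hθ' := Set.Ioo_subset_Icc_self hθ
  have hv : (weightV θ : ℂ) ≠ 0 := by
    have hθ0 : θ ∈ Set.Ioo 0 π := ⟨by linarith [hθ.1, Real.pi_pos], by linarith [hθ.2, Real.pi_pos]⟩
    exact_mod_cast (weightV_pos_of_mem_Ioo hθ0).ne'
  rw [vertexFunctional_printed_SE_eq hθ' Dl w hf hh hr]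
  refine mul_ne_zero (mul_ne_zero Complex.I_ne_zero hv) fun h0 => ?_
  set ρ : ℂ := Complex.exp ((((3 * π / 4 : ℝ)) : ℂ) * Complex.I) with hρ
  have hsum : 0 < (ρ * ∑ ω ∈ ΩG.setB2a (dom Dl) (w.side .W) (rootS w), ΩG.classTermSE θ hr ω).re := by
    rw [Finset.mul_sum, Complex.re_sum]
    obtain ⟨ω₀, h₀, hW₀⟩ := hex
    have hmem : ω₀ ∈ ΩG.setB2a (dom Dl) (w.side .W) (rootS w) := by
      simp only [ΩG.setB2a, Finset.mem_filter, Finset.mem_univ, true_and]; exact h₀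
    have hterm : ∀ ω ∈ ΩG.setB2a (dom Dl) (w.side .W) (rootS w), 0 ≤ (ρ * ΩG.classTermSE θ hr ω).re := by
      intro ω hω
      simp only [ΩG.setB2a, Finset.mem_filter, Finset.mem_univ, true_and] at hω
      have hB : ω.IsB2a := hω
      by_cases hw : ω.WE (fun _ => θ) ≠ excursionWinding θ ω.2.firstSideG (ω.z1 hr hB) ω.1
      · exact (ΩG.re_rot_classTermSE_NE hh hθ hr ω hB (hgrp ω hB hw)).1
      · rw [ΩG.classTermSE, dif_pos hB, if_neg hw, mul_zero, Complex.zero_re]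
    refine lt_of_lt_of_le ?_ (Finset.single_le_sum hterm hmem)
    exact (ΩG.re_rot_classTermSE_NE hh hθ hr ω₀ h₀ (hgrp ω₀ h₀ hW₀)).2 hW₀
  rw [h0, mul_zero, Complex.zero_re] at hsum
  exact lt_irrefl _ hsum

/-- ★★★ **THE `S/W` CONE LAW AT CELL SE** (a sufficient-half instance of the lane's encircling criterion at a cell of
the ring other than the root's own plaquette): on `θ ∈ (π/3, 2π/3)`, if every WOUND class-`B2a` walk at the cell entered from
`S` or `W` and one wound walk exists, then `VF_D(w.side W, cell) ≠ 0`. [cite: GlazmanManolescu2019, Lemma 2.1 (statement, "in the form given in [Gl]")] [cite: Glazman2015WeightedSAW, Lemma 3.1 (proof, pp. 6–7)] [cite: Hopf1935, Nr. 2 (Umlaufsatz, p. 53) and Nr. 4 eq. (22) (curves with corners, pp. 60–61)] -/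
theorem vertexFunctional_printed_SE_ne_zero_of_SW {θ : ℝ} (hθ : θ ∈ Set.Ioo (π / 3) (2 * π / 3))
    (Dl : List Face) (w : Face) (hf : rootS w ∈ Dl) (hh : holeFaceW w ∉ dom Dl)
    (hr : RootedFace (dom Dl) (w.side .W) (rootS w))
    (hgrp : ∀ (ω : ΩG (dom Dl) (w.side .W) (rootS w)) (h : ω.IsB2a),
      ω.WE (fun _ => θ) ≠ excursionWinding θ ω.2.firstSideG (ω.z1 hr h) ω.1 → ω.2.firstSideG = .S ∨ ω.2.firstSideG = .W)
    (hex : ∃ (ω : ΩG (dom Dl) (w.side .W) (rootS w)) (h : ω.IsB2a),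
      ω.WE (fun _ => θ) ≠ excursionWinding θ ω.2.firstSideG (ω.z1 hr h) ω.1) :
    vertexFunctional (printedWeights θ) tFiveEighths (ybCoeff θ) Dl (w.side .W) (rootS w) ≠ 0 := by
  classical
  have hθ' := Set.Ioo_subset_Icc_self hθ
  have hv : (weightV θ : ℂ) ≠ 0 := by
    have hθ0 : θ ∈ Set.Ioo 0 π := ⟨by linarith [hθ.1, Real.pi_pos], by linarith [hθ.2, Real.pi_pos]⟩
    exact_mod_cast (weightV_pos_of_mem_Ioo hθ0).ne'
  rw [vertexFunctional_printed_SE_eq hθ' Dl w hf hh hr]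
  refine mul_ne_zero (mul_ne_zero Complex.I_ne_zero hv) fun h0 => ?_
  set ρ : ℂ := Complex.exp ((((-(π / 4) : ℝ)) : ℂ) * Complex.I) with hρ
  have hsum : 0 < (ρ * ∑ ω ∈ ΩG.setB2a (dom Dl) (w.side .W) (rootS w), ΩG.classTermSE θ hr ω).re := by
    rw [Finset.mul_sum, Complex.re_sum]
    obtain ⟨ω₀, h₀, hW₀⟩ := hex
    have hmem : ω₀ ∈ ΩG.setB2a (dom Dl) (w.side .W) (rootS w) := by
      simp only [ΩG.setB2a, Finset.mem_filter, Finset.mem_univ, true_and]; exact h₀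
    have hterm : ∀ ω ∈ ΩG.setB2a (dom Dl) (w.side .W) (rootS w), 0 ≤ (ρ * ΩG.classTermSE θ hr ω).re := by
      intro ω hω
      simp only [ΩG.setB2a, Finset.mem_filter, Finset.mem_univ, true_and] at hω
      have hB : ω.IsB2a := hω
      by_cases hw : ω.WE (fun _ => θ) ≠ excursionWinding θ ω.2.firstSideG (ω.z1 hr hB) ω.1
      · exact (ΩG.re_rot_classTermSE_SW hh hθ hr ω hB (hgrp ω hB hw)).1
      · rw [ΩG.classTermSE, dif_pos hB, if_neg hw, mul_zero, Complex.zero_re]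
    refine lt_of_lt_of_le ?_ (Finset.single_le_sum hterm hmem)
    exact (ΩG.re_rot_classTermSE_SW hh hθ hr ω₀ h₀ (hgrp ω₀ h₀ hW₀)).2 hW₀
  rw [h0, mul_zero, Complex.zero_re] at hsum
  exact lt_irrefl _ hsum

/-- ★★★★ **THE CELL LAW AT NE** (the cell north of the root plaquette (`NE` of the hole)): for `θ ∈ [π/3, 2π/3]`, `rootN w ∈ Dl`, `holeFaceW w ∉ dom Dl`:
`VF_D(w.side W, rootN w) = i·v(θ)·Σ_{B2a} classTermNE` — every wound walk contributes its exterior weight along one explicit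
unit direction fixed by its first side and class. [cite: GlazmanManolescu2019, Lemma 2.1 (statement, "in the form given in [Gl]")] [cite: Glazman2015WeightedSAW, Lemma 3.1 (proof, pp. 6–7)] [cite: Hopf1935, Nr. 2 (Umlaufsatz, p. 53) and Nr. 4 eq. (22) (curves with corners, pp. 60–61)] -/
theorem vertexFunctional_printed_NE_eq {θ : ℝ} (hθ : θ ∈ Set.Icc (π / 3) (2 * π / 3))
    (Dl : List Face) (w : Face) (hf : rootN w ∈ Dl) (hh : holeFaceW w ∉ dom Dl)
    (hr : RootedFace (dom Dl) (w.side .W) (rootN w)) :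
    vertexFunctional (printedWeights θ) tFiveEighths (ybCoeff θ) Dl (w.side .W) (rootN w) =
      Complex.I * (weightV θ : ℂ) * ∑ ω ∈ ΩG.setB2a (dom Dl) (w.side .W) (rootN w), ΩG.classTermNE θ hr ω := by
  have _ := hf
  rw [vertexFunctional_printed_eq_phase_mul_lem21Defect, ← ΩG.sum_g_eq_lem21Defect,
    ΩG.sum_g_eq_I_mul_sum_classTerm (fun _ => θ) hr (fun _ => hθ), ΩG.sum_classTerm_NE hh hr, slantPot_sideW]
  have e0 : Complex.exp (((-(5 / 8 * (0 : ℝ)) : ℝ) : ℂ) * Complex.I) = 1 := by simp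
  rw [e0, one_mul, mul_assoc]

/-- ★★ The bound at cell NE: `‖VF‖ ≤ v(θ)·Σ_{B2a} extWeight`. [cite: GlazmanManolescu2019, Lemma 2.1 (statement, "in the form given in [Gl]")] [cite: Glazman2015WeightedSAW, Lemma 3.1, eq. (1) (the weight v(θ))] -/
theorem norm_vertexFunctional_printed_NE_le {θ : ℝ} (hθ : θ ∈ Set.Icc (π / 3) (2 * π / 3))
    (Dl : List Face) (w : Face) (hf : rootN w ∈ Dl) (hh : holeFaceW w ∉ dom Dl)
    (hr : RootedFace (dom Dl) (w.side .W) (rootN w)) :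
    ‖vertexFunctional (printedWeights θ) tFiveEighths (ybCoeff θ) Dl (w.side .W) (rootN w)‖ ≤
      weightV θ * ∑ ω ∈ ΩG.setB2a (dom Dl) (w.side .W) (rootN w), ω.2.extWeight (fun _ => θ) (rootN w) := by
  rw [vertexFunctional_printed_NE_eq hθ Dl w hf hh hr, norm_mul, norm_mul, Complex.norm_I, one_mul,
    Complex.norm_real, Real.norm_eq_abs, abs_of_nonneg (weightV_nonneg hθ)]
  refine mul_le_mul_of_nonneg_left ((norm_sum_le _ _).trans (Finset.sum_le_sum fun ω hω => ?_)) (weightV_nonneg hθ)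
  simp only [ΩG.setB2a, Finset.mem_filter, Finset.mem_univ, true_and] at hω
  exact ΩG.norm_classTermNE_le hh hθ hr ω hω

/-- ★★★ **THE `S/E` CONE LAW AT CELL NE** (a sufficient-half instance of the lane's encircling criterion at a cell of
the ring other than the root's own plaquette): on `θ ∈ (π/3, 2π/3)`, if every WOUND class-`B2a` walk at the cell entered from
`S` or `E` and one wound walk exists, then `VF_D(w.side W, cell) ≠ 0`. [cite: GlazmanManolescu2019, Lemma 2.1 (statement, "in the form given in [Gl]")] [cite: Glazman2015WeightedSAW, Lemma 3.1 (proof, pp. 6–7)] [cite: Hopf1935, Nr. 2 (Umlaufsatz, p. 53) and Nr. 4 eq. (22) (curves with corners, pp. 60–61)] -/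
theorem vertexFunctional_printed_NE_ne_zero_of_SE {θ : ℝ} (hθ : θ ∈ Set.Ioo (π / 3) (2 * π / 3))
    (Dl : List Face) (w : Face) (hf : rootN w ∈ Dl) (hh : holeFaceW w ∉ dom Dl)
    (hr : RootedFace (dom Dl) (w.side .W) (rootN w))
    (hgrp : ∀ (ω : ΩG (dom Dl) (w.side .W) (rootN w)) (h : ω.IsB2a),
      ω.WE (fun _ => θ) ≠ excursionWinding θ ω.2.firstSideG (ω.z1 hr h) ω.1 → ω.2.firstSideG = .S ∨ ω.2.firstSideG = .E)
    (hex : ∃ (ω : ΩG (dom Dl) (w.side .W) (rootN w)) (h : ω.IsB2a),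
      ω.WE (fun _ => θ) ≠ excursionWinding θ ω.2.firstSideG (ω.z1 hr h) ω.1) :
    vertexFunctional (printedWeights θ) tFiveEighths (ybCoeff θ) Dl (w.side .W) (rootN w) ≠ 0 := by
  classical
  have hθ' := Set.Ioo_subset_Icc_self hθ
  have hv : (weightV θ : ℂ) ≠ 0 := by
    have hθ0 : θ ∈ Set.Ioo 0 π := ⟨by linarith [hθ.1, Real.pi_pos], by linarith [hθ.2, Real.pi_pos]⟩
    exact_mod_cast (weightV_pos_of_mem_Ioo hθ0).ne'
  rw [vertexFunctional_printed_NE_eq hθ' Dl w hf hh hr]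
  refine mul_ne_zero (mul_ne_zero Complex.I_ne_zero hv) fun h0 => ?_
  set ρ : ℂ := Complex.exp ((((π / 4 : ℝ)) : ℂ) * Complex.I) with hρ
  have hsum : 0 < (ρ * ∑ ω ∈ ΩG.setB2a (dom Dl) (w.side .W) (rootN w), ΩG.classTermNE θ hr ω).re := by
    rw [Finset.mul_sum, Complex.re_sum]
    obtain ⟨ω₀, h₀, hW₀⟩ := hex
    have hmem : ω₀ ∈ ΩG.setB2a (dom Dl) (w.side .W) (rootN w) := by
      simp only [ΩG.setB2a, Finset.mem_filter, Finset.mem_univ, true_and]; exact h₀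
    have hterm : ∀ ω ∈ ΩG.setB2a (dom Dl) (w.side .W) (rootN w), 0 ≤ (ρ * ΩG.classTermNE θ hr ω).re := by
      intro ω hω
      simp only [ΩG.setB2a, Finset.mem_filter, Finset.mem_univ, true_and] at hω
      have hB : ω.IsB2a := hω
      by_cases hw : ω.WE (fun _ => θ) ≠ excursionWinding θ ω.2.firstSideG (ω.z1 hr hB) ω.1
      · exact (ΩG.re_rot_classTermNE_SE hh hθ hr ω hB (hgrp ω hB hw)).1
      · rw [ΩG.classTermNE, dif_pos hB, if_neg hw, mul_zero, Complex.zero_re]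
    refine lt_of_lt_of_le ?_ (Finset.single_le_sum hterm hmem)
    exact (ΩG.re_rot_classTermNE_SE hh hθ hr ω₀ h₀ (hgrp ω₀ h₀ hW₀)).2 hW₀
  rw [h0, mul_zero, Complex.zero_re] at hsum
  exact lt_irrefl _ hsum

/-- ★★★ **THE `N/W` CONE LAW AT CELL NE** (a sufficient-half instance of the lane's encircling criterion at a cell of
the ring other than the root's own plaquette): on `θ ∈ (π/3, 2π/3)`, if every WOUND class-`B2a` walk at the cell entered from
`N` or `W` and one wound walk exists, then `VF_D(w.side W, cell) ≠ 0`. [cite: GlazmanManolescu2019, Lemma 2.1 (statement, "in the form given in [Gl]")] [cite: Glazman2015WeightedSAW, Lemma 3.1 (proof, pp. 6–7)] [cite: Hopf1935, Nr. 2 (Umlaufsatz, p. 53) and Nr. 4 eq. (22) (curves with corners, pp. 60–61)] -/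
theorem vertexFunctional_printed_NE_ne_zero_of_NW {θ : ℝ} (hθ : θ ∈ Set.Ioo (π / 3) (2 * π / 3))
    (Dl : List Face) (w : Face) (hf : rootN w ∈ Dl) (hh : holeFaceW w ∉ dom Dl)
    (hr : RootedFace (dom Dl) (w.side .W) (rootN w))
    (hgrp : ∀ (ω : ΩG (dom Dl) (w.side .W) (rootN w)) (h : ω.IsB2a),
      ω.WE (fun _ => θ) ≠ excursionWinding θ ω.2.firstSideG (ω.z1 hr h) ω.1 → ω.2.firstSideG = .N ∨ ω.2.firstSideG = .W)
    (hex : ∃ (ω : ΩG (dom Dl) (w.side .W) (rootN w)) (h : ω.IsB2a),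
      ω.WE (fun _ => θ) ≠ excursionWinding θ ω.2.firstSideG (ω.z1 hr h) ω.1) :
    vertexFunctional (printedWeights θ) tFiveEighths (ybCoeff θ) Dl (w.side .W) (rootN w) ≠ 0 := by
  classical
  have hθ' := Set.Ioo_subset_Icc_self hθ
  have hv : (weightV θ : ℂ) ≠ 0 := by
    have hθ0 : θ ∈ Set.Ioo 0 π := ⟨by linarith [hθ.1, Real.pi_pos], by linarith [hθ.2, Real.pi_pos]⟩
    exact_mod_cast (weightV_pos_of_mem_Ioo hθ0).ne'
  rw [vertexFunctional_printed_NE_eq hθ' Dl w hf hh hr]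
  refine mul_ne_zero (mul_ne_zero Complex.I_ne_zero hv) fun h0 => ?_
  set ρ : ℂ := Complex.exp ((((-(3 * π / 4) : ℝ)) : ℂ) * Complex.I) with hρ
  have hsum : 0 < (ρ * ∑ ω ∈ ΩG.setB2a (dom Dl) (w.side .W) (rootN w), ΩG.classTermNE θ hr ω).re := by
    rw [Finset.mul_sum, Complex.re_sum]
    obtain ⟨ω₀, h₀, hW₀⟩ := hex
    have hmem : ω₀ ∈ ΩG.setB2a (dom Dl) (w.side .W) (rootN w) := by
      simp only [ΩG.setB2a, Finset.mem_filter, Finset.mem_univ, true_and]; exact h₀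
    have hterm : ∀ ω ∈ ΩG.setB2a (dom Dl) (w.side .W) (rootN w), 0 ≤ (ρ * ΩG.classTermNE θ hr ω).re := by
      intro ω hω
      simp only [ΩG.setB2a, Finset.mem_filter, Finset.mem_univ, true_and] at hω
      have hB : ω.IsB2a := hω
      by_cases hw : ω.WE (fun _ => θ) ≠ excursionWinding θ ω.2.firstSideG (ω.z1 hr hB) ω.1
      · exact (ΩG.re_rot_classTermNE_NW hh hθ hr ω hB (hgrp ω hB hw)).1
      · rw [ΩG.classTermNE, dif_pos hB, if_neg hw, mul_zero, Complex.zero_re]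
    refine lt_of_lt_of_le ?_ (Finset.single_le_sum hterm hmem)
    exact (ΩG.re_rot_classTermNE_NW hh hθ hr ω₀ h₀ (hgrp ω₀ h₀ hW₀)).2 hW₀
  rw [h0, mul_zero, Complex.zero_re] at hsum
  exact lt_irrefl _ hsum

/-- ★★★★ **THE CELL LAW AT NW** (the `NW` diagonal cell of the hole): for `θ ∈ [π/3, 2π/3]`, `farNW w ∈ Dl`, `holeFaceW w ∉ dom Dl`:
`VF_D(w.side W, farNW w) = i·v(θ)·Σ_{B2a} classTermNW` — every wound walk contributes its exterior weight along one explicit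
unit direction fixed by its first side and class. [cite: GlazmanManolescu2019, Lemma 2.1 (statement, "in the form given in [Gl]")] [cite: Glazman2015WeightedSAW, Lemma 3.1 (proof, pp. 6–7)] [cite: Hopf1935, Nr. 2 (Umlaufsatz, p. 53) and Nr. 4 eq. (22) (curves with corners, pp. 60–61)] -/
theorem vertexFunctional_printed_NW_eq {θ : ℝ} (hθ : θ ∈ Set.Icc (π / 3) (2 * π / 3))
    (Dl : List Face) (w : Face) (hf : farNW w ∈ Dl) (hh : holeFaceW w ∉ dom Dl)
    (hr : RootedFace (dom Dl) (w.side .W) (farNW w)) :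
    vertexFunctional (printedWeights θ) tFiveEighths (ybCoeff θ) Dl (w.side .W) (farNW w) =
      Complex.I * (weightV θ : ℂ) * ∑ ω ∈ ΩG.setB2a (dom Dl) (w.side .W) (farNW w), ΩG.classTermNW θ hr ω := by
  have _ := hf
  rw [vertexFunctional_printed_eq_phase_mul_lem21Defect, ← ΩG.sum_g_eq_lem21Defect,
    ΩG.sum_g_eq_I_mul_sum_classTerm (fun _ => θ) hr (fun _ => hθ), ΩG.sum_classTerm_NW hh hr, slantPot_sideW]
  have e0 : Complex.exp (((-(5 / 8 * (0 : ℝ)) : ℝ) : ℂ) * Complex.I) = 1 := by simp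
  rw [e0, one_mul, mul_assoc]

/-- ★★ The bound at cell NW: `‖VF‖ ≤ v(θ)·Σ_{B2a} extWeight`. [cite: GlazmanManolescu2019, Lemma 2.1 (statement, "in the form given in [Gl]")] [cite: Glazman2015WeightedSAW, Lemma 3.1, eq. (1) (the weight v(θ))] -/
theorem norm_vertexFunctional_printed_NW_le {θ : ℝ} (hθ : θ ∈ Set.Icc (π / 3) (2 * π / 3))
    (Dl : List Face) (w : Face) (hf : farNW w ∈ Dl) (hh : holeFaceW w ∉ dom Dl)
    (hr : RootedFace (dom Dl) (w.side .W) (farNW w)) :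
    ‖vertexFunctional (printedWeights θ) tFiveEighths (ybCoeff θ) Dl (w.side .W) (farNW w)‖ ≤
      weightV θ * ∑ ω ∈ ΩG.setB2a (dom Dl) (w.side .W) (farNW w), ω.2.extWeight (fun _ => θ) (farNW w) := by
  rw [vertexFunctional_printed_NW_eq hθ Dl w hf hh hr, norm_mul, norm_mul, Complex.norm_I, one_mul,
    Complex.norm_real, Real.norm_eq_abs, abs_of_nonneg (weightV_nonneg hθ)]
  refine mul_le_mul_of_nonneg_left ((norm_sum_le _ _).trans (Finset.sum_le_sum fun ω hω => ?_)) (weightV_nonneg hθ)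
  simp only [ΩG.setB2a, Finset.mem_filter, Finset.mem_univ, true_and] at hω
  exact ΩG.norm_classTermNW_le hh hθ hr ω hω

/-- ★★★ **THE `S/W` CONE LAW AT CELL NW** (a sufficient-half instance of the lane's encircling criterion at a cell of
the ring other than the root's own plaquette): on `θ ∈ (π/3, 2π/3)`, if every WOUND class-`B2a` walk at the cell entered from
`S` or `W` and one wound walk exists, then `VF_D(w.side W, cell) ≠ 0`. [cite: GlazmanManolescu2019, Lemma 2.1 (statement, "in the form given in [Gl]")] [cite: Glazman2015WeightedSAW, Lemma 3.1 (proof, pp. 6–7)] [cite: Hopf1935, Nr. 2 (Umlaufsatz, p. 53) and Nr. 4 eq. (22) (curves with corners, pp. 60–61)] -/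
theorem vertexFunctional_printed_NW_ne_zero_of_SW {θ : ℝ} (hθ : θ ∈ Set.Ioo (π / 3) (2 * π / 3))
    (Dl : List Face) (w : Face) (hf : farNW w ∈ Dl) (hh : holeFaceW w ∉ dom Dl)
    (hr : RootedFace (dom Dl) (w.side .W) (farNW w))
    (hgrp : ∀ (ω : ΩG (dom Dl) (w.side .W) (farNW w)) (h : ω.IsB2a),
      ω.WE (fun _ => θ) ≠ excursionWinding θ ω.2.firstSideG (ω.z1 hr h) ω.1 → ω.2.firstSideG = .S ∨ ω.2.firstSideG = .W)
    (hex : ∃ (ω : ΩG (dom Dl) (w.side .W) (farNW w)) (h : ω.IsB2a),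
      ω.WE (fun _ => θ) ≠ excursionWinding θ ω.2.firstSideG (ω.z1 hr h) ω.1) :
    vertexFunctional (printedWeights θ) tFiveEighths (ybCoeff θ) Dl (w.side .W) (farNW w) ≠ 0 := by
  classical
  have hθ' := Set.Ioo_subset_Icc_self hθ
  have hv : (weightV θ : ℂ) ≠ 0 := by
    have hθ0 : θ ∈ Set.Ioo 0 π := ⟨by linarith [hθ.1, Real.pi_pos], by linarith [hθ.2, Real.pi_pos]⟩
    exact_mod_cast (weightV_pos_of_mem_Ioo hθ0).ne'
  rw [vertexFunctional_printed_NW_eq hθ' Dl w hf hh hr]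
  refine mul_ne_zero (mul_ne_zero Complex.I_ne_zero hv) fun h0 => ?_
  set ρ : ℂ := Complex.exp ((((-(7 * π / 8) : ℝ)) : ℂ) * Complex.I) with hρ
  have hsum : 0 < (ρ * ∑ ω ∈ ΩG.setB2a (dom Dl) (w.side .W) (farNW w), ΩG.classTermNW θ hr ω).re := by
    rw [Finset.mul_sum, Complex.re_sum]
    obtain ⟨ω₀, h₀, hW₀⟩ := hex
    have hmem : ω₀ ∈ ΩG.setB2a (dom Dl) (w.side .W) (farNW w) := by
      simp only [ΩG.setB2a, Finset.mem_filter, Finset.mem_univ, true_and]; exact h₀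
    have hterm : ∀ ω ∈ ΩG.setB2a (dom Dl) (w.side .W) (farNW w), 0 ≤ (ρ * ΩG.classTermNW θ hr ω).re := by
      intro ω hω
      simp only [ΩG.setB2a, Finset.mem_filter, Finset.mem_univ, true_and] at hω
      have hB : ω.IsB2a := hω
      by_cases hw : ω.WE (fun _ => θ) ≠ excursionWinding θ ω.2.firstSideG (ω.z1 hr hB) ω.1
      · exact (ΩG.re_rot_classTermNW_SW hh hθ hr ω hB (hgrp ω hB hw)).1
      · rw [ΩG.classTermNW, dif_pos hB, if_neg hw, mul_zero, Complex.zero_re]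
    refine lt_of_lt_of_le ?_ (Finset.single_le_sum hterm hmem)
    exact (ΩG.re_rot_classTermNW_SW hh hθ hr ω₀ h₀ (hgrp ω₀ h₀ hW₀)).2 hW₀
  rw [h0, mul_zero, Complex.zero_re] at hsum
  exact lt_irrefl _ hsum

/-- ★★★ **THE `N/E` CONE LAW AT CELL NW** (a sufficient-half instance of the lane's encircling criterion at a cell of
the ring other than the root's own plaquette): on `θ ∈ (π/3, 2π/3)`, if every WOUND class-`B2a` walk at the cell entered from
`N` or `E` and one wound walk exists, then `VF_D(w.side W, cell) ≠ 0`. [cite: GlazmanManolescu2019, Lemma 2.1 (statement, "in the form given in [Gl]")] [cite: Glazman2015WeightedSAW, Lemma 3.1 (proof, pp. 6–7)] [cite: Hopf1935, Nr. 2 (Umlaufsatz, p. 53) and Nr. 4 eq. (22) (curves with corners, pp. 60–61)] -/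
theorem vertexFunctional_printed_NW_ne_zero_of_NEgrp {θ : ℝ} (hθ : θ ∈ Set.Ioo (π / 3) (2 * π / 3))
    (Dl : List Face) (w : Face) (hf : farNW w ∈ Dl) (hh : holeFaceW w ∉ dom Dl)
    (hr : RootedFace (dom Dl) (w.side .W) (farNW w))
    (hgrp : ∀ (ω : ΩG (dom Dl) (w.side .W) (farNW w)) (h : ω.IsB2a),
      ω.WE (fun _ => θ) ≠ excursionWinding θ ω.2.firstSideG (ω.z1 hr h) ω.1 → ω.2.firstSideG = .N ∨ ω.2.firstSideG = .E)
    (hex : ∃ (ω : ΩG (dom Dl) (w.side .W) (farNW w)) (h : ω.IsB2a),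
      ω.WE (fun _ => θ) ≠ excursionWinding θ ω.2.firstSideG (ω.z1 hr h) ω.1) :
    vertexFunctional (printedWeights θ) tFiveEighths (ybCoeff θ) Dl (w.side .W) (farNW w) ≠ 0 := by
  classical
  have hθ' := Set.Ioo_subset_Icc_self hθ
  have hv : (weightV θ : ℂ) ≠ 0 := by
    have hθ0 : θ ∈ Set.Ioo 0 π := ⟨by linarith [hθ.1, Real.pi_pos], by linarith [hθ.2, Real.pi_pos]⟩
    exact_mod_cast (weightV_pos_of_mem_Ioo hθ0).ne'
  rw [vertexFunctional_printed_NW_eq hθ' Dl w hf hh hr]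
  refine mul_ne_zero (mul_ne_zero Complex.I_ne_zero hv) fun h0 => ?_
  set ρ : ℂ := Complex.exp ((((π / 8 : ℝ)) : ℂ) * Complex.I) with hρ
  have hsum : 0 < (ρ * ∑ ω ∈ ΩG.setB2a (dom Dl) (w.side .W) (farNW w), ΩG.classTermNW θ hr ω).re := by
    rw [Finset.mul_sum, Complex.re_sum]
    obtain ⟨ω₀, h₀, hW₀⟩ := hex
    have hmem : ω₀ ∈ ΩG.setB2a (dom Dl) (w.side .W) (farNW w) := by
      simp only [ΩG.setB2a, Finset.mem_filter, Finset.mem_univ, true_and]; exact h₀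
    have hterm : ∀ ω ∈ ΩG.setB2a (dom Dl) (w.side .W) (farNW w), 0 ≤ (ρ * ΩG.classTermNW θ hr ω).re := by
      intro ω hω
      simp only [ΩG.setB2a, Finset.mem_filter, Finset.mem_univ, true_and] at hω
      have hB : ω.IsB2a := hω
      by_cases hw : ω.WE (fun _ => θ) ≠ excursionWinding θ ω.2.firstSideG (ω.z1 hr hB) ω.1
      · exact (ΩG.re_rot_classTermNW_NEgrp hh hθ hr ω hB (hgrp ω hB hw)).1
      · rw [ΩG.classTermNW, dif_pos hB, if_neg hw, mul_zero, Complex.zero_re]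
    refine lt_of_lt_of_le ?_ (Finset.single_le_sum hterm hmem)
    exact (ΩG.re_rot_classTermNW_NEgrp hh hθ hr ω₀ h₀ (hgrp ω₀ h₀ hW₀)).2 hW₀
  rw [h0, mul_zero, Complex.zero_re] at hsum
  exact lt_irrefl _ hsum

/-- ★★★★ **THE CELL LAW AT LS** (the lateral cell south of the hole): for `θ ∈ [π/3, 2π/3]`, `latS w ∈ Dl`, `holeFaceW w ∉ dom Dl`:
`VF_D(w.side W, latS w) = i·v(θ)·Σ_{B2a} classTermLS` — every wound walk contributes its exterior weight along one explicit
unit direction fixed by its first side and class. [cite: GlazmanManolescu2019, Lemma 2.1 (statement, "in the form given in [Gl]")] [cite: Glazman2015WeightedSAW, Lemma 3.1 (proof, pp. 6–7)] [cite: Hopf1935, Nr. 2 (Umlaufsatz, p. 53) and Nr. 4 eq. (22) (curves with corners, pp. 60–61)] -/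
theorem vertexFunctional_printed_LS_eq {θ : ℝ} (hθ : θ ∈ Set.Icc (π / 3) (2 * π / 3))
    (Dl : List Face) (w : Face) (hf : latS w ∈ Dl) (hh : holeFaceW w ∉ dom Dl)
    (hr : RootedFace (dom Dl) (w.side .W) (latS w)) :
    vertexFunctional (printedWeights θ) tFiveEighths (ybCoeff θ) Dl (w.side .W) (latS w) =
      Complex.I * (weightV θ : ℂ) * ∑ ω ∈ ΩG.setB2a (dom Dl) (w.side .W) (latS w), ΩG.classTermLS θ hr ω := by
  have _ := hf
  rw [vertexFunctional_printed_eq_phase_mul_lem21Defect, ← ΩG.sum_g_eq_lem21Defect,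
    ΩG.sum_g_eq_I_mul_sum_classTerm (fun _ => θ) hr (fun _ => hθ), ΩG.sum_classTerm_LS hh hr, slantPot_sideW]
  have e0 : Complex.exp (((-(5 / 8 * (0 : ℝ)) : ℝ) : ℂ) * Complex.I) = 1 := by simp
  rw [e0, one_mul, mul_assoc]

/-- ★★ The bound at cell LS: `‖VF‖ ≤ v(θ)·Σ_{B2a} extWeight`. [cite: GlazmanManolescu2019, Lemma 2.1 (statement, "in the form given in [Gl]")] [cite: Glazman2015WeightedSAW, Lemma 3.1, eq. (1) (the weight v(θ))] -/
theorem norm_vertexFunctional_printed_LS_le {θ : ℝ} (hθ : θ ∈ Set.Icc (π / 3) (2 * π / 3))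
    (Dl : List Face) (w : Face) (hf : latS w ∈ Dl) (hh : holeFaceW w ∉ dom Dl)
    (hr : RootedFace (dom Dl) (w.side .W) (latS w)) :
    ‖vertexFunctional (printedWeights θ) tFiveEighths (ybCoeff θ) Dl (w.side .W) (latS w)‖ ≤
      weightV θ * ∑ ω ∈ ΩG.setB2a (dom Dl) (w.side .W) (latS w), ω.2.extWeight (fun _ => θ) (latS w) := by
  rw [vertexFunctional_printed_LS_eq hθ Dl w hf hh hr, norm_mul, norm_mul, Complex.norm_I, one_mul,
    Complex.norm_real, Real.norm_eq_abs, abs_of_nonneg (weightV_nonneg hθ)]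
  refine mul_le_mul_of_nonneg_left ((norm_sum_le _ _).trans (Finset.sum_le_sum fun ω hω => ?_)) (weightV_nonneg hθ)
  simp only [ΩG.setB2a, Finset.mem_filter, Finset.mem_univ, true_and] at hω
  exact ΩG.norm_classTermLS_le hh hθ hr ω hω

/-- ★★★ **THE `E` CONE LAW AT CELL LS** (a sufficient-half instance of the lane's encircling criterion at a cell of
the ring other than the root's own plaquette): on `θ ∈ (π/3, 2π/3)`, if every WOUND class-`B2a` walk at the cell entered from
`E` and one wound walk exists, then `VF_D(w.side W, cell) ≠ 0`. [cite: GlazmanManolescu2019, Lemma 2.1 (statement, "in the form given in [Gl]")] [cite: Glazman2015WeightedSAW, Lemma 3.1 (proof, pp. 6–7)] [cite: Hopf1935, Nr. 2 (Umlaufsatz, p. 53) and Nr. 4 eq. (22) (curves with corners, pp. 60–61)] -/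
theorem vertexFunctional_printed_LS_ne_zero_of_E {θ : ℝ} (hθ : θ ∈ Set.Ioo (π / 3) (2 * π / 3))
    (Dl : List Face) (w : Face) (hf : latS w ∈ Dl) (hh : holeFaceW w ∉ dom Dl)
    (hr : RootedFace (dom Dl) (w.side .W) (latS w))
    (hgrp : ∀ (ω : ΩG (dom Dl) (w.side .W) (latS w)) (h : ω.IsB2a),
      ω.WE (fun _ => θ) ≠ excursionWinding θ ω.2.firstSideG (ω.z1 hr h) ω.1 → ω.2.firstSideG = .E)
    (hex : ∃ (ω : ΩG (dom Dl) (w.side .W) (latS w)) (h : ω.IsB2a),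
      ω.WE (fun _ => θ) ≠ excursionWinding θ ω.2.firstSideG (ω.z1 hr h) ω.1) :
    vertexFunctional (printedWeights θ) tFiveEighths (ybCoeff θ) Dl (w.side .W) (latS w) ≠ 0 := by
  classical
  have hθ' := Set.Ioo_subset_Icc_self hθ
  have hv : (weightV θ : ℂ) ≠ 0 := by
    have hθ0 : θ ∈ Set.Ioo 0 π := ⟨by linarith [hθ.1, Real.pi_pos], by linarith [hθ.2, Real.pi_pos]⟩
    exact_mod_cast (weightV_pos_of_mem_Ioo hθ0).ne'
  rw [vertexFunctional_printed_LS_eq hθ' Dl w hf hh hr]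
  refine mul_ne_zero (mul_ne_zero Complex.I_ne_zero hv) fun h0 => ?_
  set ρ : ℂ := Complex.exp ((((-(9 * π / 8) : ℝ)) : ℂ) * Complex.I) with hρ
  have hsum : 0 < (ρ * ∑ ω ∈ ΩG.setB2a (dom Dl) (w.side .W) (latS w), ΩG.classTermLS θ hr ω).re := by
    rw [Finset.mul_sum, Complex.re_sum]
    obtain ⟨ω₀, h₀, hW₀⟩ := hex
    have hmem : ω₀ ∈ ΩG.setB2a (dom Dl) (w.side .W) (latS w) := by
      simp only [ΩG.setB2a, Finset.mem_filter, Finset.mem_univ, true_and]; exact h₀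
    have hterm : ∀ ω ∈ ΩG.setB2a (dom Dl) (w.side .W) (latS w), 0 ≤ (ρ * ΩG.classTermLS θ hr ω).re := by
      intro ω hω
      simp only [ΩG.setB2a, Finset.mem_filter, Finset.mem_univ, true_and] at hω
      have hB : ω.IsB2a := hω
      by_cases hw : ω.WE (fun _ => θ) ≠ excursionWinding θ ω.2.firstSideG (ω.z1 hr hB) ω.1
      · exact (ΩG.re_rot_classTermLS_E hh hθ hr ω hB (hgrp ω hB hw)).1
      · rw [ΩG.classTermLS, dif_pos hB, if_neg hw, mul_zero, Complex.zero_re]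
    refine lt_of_lt_of_le ?_ (Finset.single_le_sum hterm hmem)
    exact (ΩG.re_rot_classTermLS_E hh hθ hr ω₀ h₀ (hgrp ω₀ h₀ hW₀)).2 hW₀
  rw [h0, mul_zero, Complex.zero_re] at hsum
  exact lt_irrefl _ hsum

/-- ★★★ **THE `W` CONE LAW AT CELL LS** (a sufficient-half instance of the lane's encircling criterion at a cell of
the ring other than the root's own plaquette): on `θ ∈ (π/3, 2π/3)`, if every WOUND class-`B2a` walk at the cell entered from
`W` and one wound walk exists, then `VF_D(w.side W, cell) ≠ 0`. [cite: GlazmanManolescu2019, Lemma 2.1 (statement, "in the form given in [Gl]")] [cite: Glazman2015WeightedSAW, Lemma 3.1 (proof, pp. 6–7)] [cite: Hopf1935, Nr. 2 (Umlaufsatz, p. 53) and Nr. 4 eq. (22) (curves with corners, pp. 60–61)] -/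
theorem vertexFunctional_printed_LS_ne_zero_of_W {θ : ℝ} (hθ : θ ∈ Set.Ioo (π / 3) (2 * π / 3))
    (Dl : List Face) (w : Face) (hf : latS w ∈ Dl) (hh : holeFaceW w ∉ dom Dl)
    (hr : RootedFace (dom Dl) (w.side .W) (latS w))
    (hgrp : ∀ (ω : ΩG (dom Dl) (w.side .W) (latS w)) (h : ω.IsB2a),
      ω.WE (fun _ => θ) ≠ excursionWinding θ ω.2.firstSideG (ω.z1 hr h) ω.1 → ω.2.firstSideG = .W)
    (hex : ∃ (ω : ΩG (dom Dl) (w.side .W) (latS w)) (h : ω.IsB2a),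
      ω.WE (fun _ => θ) ≠ excursionWinding θ ω.2.firstSideG (ω.z1 hr h) ω.1) :
    vertexFunctional (printedWeights θ) tFiveEighths (ybCoeff θ) Dl (w.side .W) (latS w) ≠ 0 := by
  classical
  have hθ' := Set.Ioo_subset_Icc_self hθ
  have hv : (weightV θ : ℂ) ≠ 0 := by
    have hθ0 : θ ∈ Set.Ioo 0 π := ⟨by linarith [hθ.1, Real.pi_pos], by linarith [hθ.2, Real.pi_pos]⟩
    exact_mod_cast (weightV_pos_of_mem_Ioo hθ0).ne'
  rw [vertexFunctional_printed_LS_eq hθ' Dl w hf hh hr]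
  refine mul_ne_zero (mul_ne_zero Complex.I_ne_zero hv) fun h0 => ?_
  set ρ : ℂ := Complex.exp ((((-(π / 8) : ℝ)) : ℂ) * Complex.I) with hρ
  have hsum : 0 < (ρ * ∑ ω ∈ ΩG.setB2a (dom Dl) (w.side .W) (latS w), ΩG.classTermLS θ hr ω).re := by
    rw [Finset.mul_sum, Complex.re_sum]
    obtain ⟨ω₀, h₀, hW₀⟩ := hex
    have hmem : ω₀ ∈ ΩG.setB2a (dom Dl) (w.side .W) (latS w) := by
      simp only [ΩG.setB2a, Finset.mem_filter, Finset.mem_univ, true_and]; exact h₀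
    have hterm : ∀ ω ∈ ΩG.setB2a (dom Dl) (w.side .W) (latS w), 0 ≤ (ρ * ΩG.classTermLS θ hr ω).re := by
      intro ω hω
      simp only [ΩG.setB2a, Finset.mem_filter, Finset.mem_univ, true_and] at hω
      have hB : ω.IsB2a := hω
      by_cases hw : ω.WE (fun _ => θ) ≠ excursionWinding θ ω.2.firstSideG (ω.z1 hr hB) ω.1
      · exact (ΩG.re_rot_classTermLS_W hh hθ hr ω hB (hgrp ω hB hw)).1
      · rw [ΩG.classTermLS, dif_pos hB, if_neg hw, mul_zero, Complex.zero_re]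
    refine lt_of_lt_of_le ?_ (Finset.single_le_sum hterm hmem)
    exact (ΩG.re_rot_classTermLS_W hh hθ hr ω₀ h₀ (hgrp ω₀ h₀ hW₀)).2 hW₀
  rw [h0, mul_zero, Complex.zero_re] at hsum
  exact lt_irrefl _ hsum

/-- ★★★★ **THE CELL LAW AT LN** (the lateral cell north of the hole (the lateral file's cell)): for `θ ∈ [π/3, 2π/3]`, `latN w ∈ Dl`, `holeFaceW w ∉ dom Dl`:
`VF_D(w.side W, latN w) = i·v(θ)·Σ_{B2a} classTermLN` — every wound walk contributes its exterior weight along one explicit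
unit direction fixed by its first side and class. [cite: GlazmanManolescu2019, Lemma 2.1 (statement, "in the form given in [Gl]")] [cite: Glazman2015WeightedSAW, Lemma 3.1 (proof, pp. 6–7)] [cite: Hopf1935, Nr. 2 (Umlaufsatz, p. 53) and Nr. 4 eq. (22) (curves with corners, pp. 60–61)] -/
theorem vertexFunctional_printed_LN_eq {θ : ℝ} (hθ : θ ∈ Set.Icc (π / 3) (2 * π / 3))
    (Dl : List Face) (w : Face) (hf : latN w ∈ Dl) (hh : holeFaceW w ∉ dom Dl)
    (hr : RootedFace (dom Dl) (w.side .W) (latN w)) :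
    vertexFunctional (printedWeights θ) tFiveEighths (ybCoeff θ) Dl (w.side .W) (latN w) =
      Complex.I * (weightV θ : ℂ) * ∑ ω ∈ ΩG.setB2a (dom Dl) (w.side .W) (latN w), ΩG.classTermLN θ hr ω := by
  have _ := hf
  rw [vertexFunctional_printed_eq_phase_mul_lem21Defect, ← ΩG.sum_g_eq_lem21Defect,
    ΩG.sum_g_eq_I_mul_sum_classTerm (fun _ => θ) hr (fun _ => hθ), ΩG.sum_classTerm_LN hh hr, slantPot_sideW]
  have e0 : Complex.exp (((-(5 / 8 * (0 : ℝ)) : ℝ) : ℂ) * Complex.I) = 1 := by simp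
  rw [e0, one_mul, mul_assoc]

/-- ★★ The bound at cell LN: `‖VF‖ ≤ v(θ)·Σ_{B2a} extWeight`. [cite: GlazmanManolescu2019, Lemma 2.1 (statement, "in the form given in [Gl]")] [cite: Glazman2015WeightedSAW, Lemma 3.1, eq. (1) (the weight v(θ))] -/
theorem norm_vertexFunctional_printed_LN_le {θ : ℝ} (hθ : θ ∈ Set.Icc (π / 3) (2 * π / 3))
    (Dl : List Face) (w : Face) (hf : latN w ∈ Dl) (hh : holeFaceW w ∉ dom Dl)
    (hr : RootedFace (dom Dl) (w.side .W) (latN w)) :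
    ‖vertexFunctional (printedWeights θ) tFiveEighths (ybCoeff θ) Dl (w.side .W) (latN w)‖ ≤
      weightV θ * ∑ ω ∈ ΩG.setB2a (dom Dl) (w.side .W) (latN w), ω.2.extWeight (fun _ => θ) (latN w) := by
  rw [vertexFunctional_printed_LN_eq hθ Dl w hf hh hr, norm_mul, norm_mul, Complex.norm_I, one_mul,
    Complex.norm_real, Real.norm_eq_abs, abs_of_nonneg (weightV_nonneg hθ)]
  refine mul_le_mul_of_nonneg_left ((norm_sum_le _ _).trans (Finset.sum_le_sum fun ω hω => ?_)) (weightV_nonneg hθ)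
  simp only [ΩG.setB2a, Finset.mem_filter, Finset.mem_univ, true_and] at hω
  exact ΩG.norm_classTermLN_le hh hθ hr ω hω

/-- ★★★ **THE `E` CONE LAW AT CELL LN** (a sufficient-half instance of the lane's encircling criterion at a cell of
the ring other than the root's own plaquette): on `θ ∈ (π/3, 2π/3)`, if every WOUND class-`B2a` walk at the cell entered from
`E` and one wound walk exists, then `VF_D(w.side W, cell) ≠ 0`. [cite: GlazmanManolescu2019, Lemma 2.1 (statement, "in the form given in [Gl]")] [cite: Glazman2015WeightedSAW, Lemma 3.1 (proof, pp. 6–7)] [cite: Hopf1935, Nr. 2 (Umlaufsatz, p. 53) and Nr. 4 eq. (22) (curves with corners, pp. 60–61)] -/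
theorem vertexFunctional_printed_LN_ne_zero_of_E {θ : ℝ} (hθ : θ ∈ Set.Ioo (π / 3) (2 * π / 3))
    (Dl : List Face) (w : Face) (hf : latN w ∈ Dl) (hh : holeFaceW w ∉ dom Dl)
    (hr : RootedFace (dom Dl) (w.side .W) (latN w))
    (hgrp : ∀ (ω : ΩG (dom Dl) (w.side .W) (latN w)) (h : ω.IsB2a),
      ω.WE (fun _ => θ) ≠ excursionWinding θ ω.2.firstSideG (ω.z1 hr h) ω.1 → ω.2.firstSideG = .E)
    (hex : ∃ (ω : ΩG (dom Dl) (w.side .W) (latN w)) (h : ω.IsB2a),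
      ω.WE (fun _ => θ) ≠ excursionWinding θ ω.2.firstSideG (ω.z1 hr h) ω.1) :
    vertexFunctional (printedWeights θ) tFiveEighths (ybCoeff θ) Dl (w.side .W) (latN w) ≠ 0 := by
  classical
  have hθ' := Set.Ioo_subset_Icc_self hθ
  have hv : (weightV θ : ℂ) ≠ 0 := by
    have hθ0 : θ ∈ Set.Ioo 0 π := ⟨by linarith [hθ.1, Real.pi_pos], by linarith [hθ.2, Real.pi_pos]⟩
    exact_mod_cast (weightV_pos_of_mem_Ioo hθ0).ne'
  rw [vertexFunctional_printed_LN_eq hθ' Dl w hf hh hr]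
  refine mul_ne_zero (mul_ne_zero Complex.I_ne_zero hv) fun h0 => ?_
  set ρ : ℂ := Complex.exp ((((3 * π / 16 : ℝ)) : ℂ) * Complex.I) with hρ
  have hsum : 0 < (ρ * ∑ ω ∈ ΩG.setB2a (dom Dl) (w.side .W) (latN w), ΩG.classTermLN θ hr ω).re := by
    rw [Finset.mul_sum, Complex.re_sum]
    obtain ⟨ω₀, h₀, hW₀⟩ := hex
    have hmem : ω₀ ∈ ΩG.setB2a (dom Dl) (w.side .W) (latN w) := by
      simp only [ΩG.setB2a, Finset.mem_filter, Finset.mem_univ, true_and]; exact h₀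
    have hterm : ∀ ω ∈ ΩG.setB2a (dom Dl) (w.side .W) (latN w), 0 ≤ (ρ * ΩG.classTermLN θ hr ω).re := by
      intro ω hω
      simp only [ΩG.setB2a, Finset.mem_filter, Finset.mem_univ, true_and] at hω
      have hB : ω.IsB2a := hω
      by_cases hw : ω.WE (fun _ => θ) ≠ excursionWinding θ ω.2.firstSideG (ω.z1 hr hB) ω.1
      · exact (ΩG.re_rot_classTermLN_E hh hθ hr ω hB (hgrp ω hB hw)).1
      · rw [ΩG.classTermLN, dif_pos hB, if_neg hw, mul_zero, Complex.zero_re]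
    refine lt_of_lt_of_le ?_ (Finset.single_le_sum hterm hmem)
    exact (ΩG.re_rot_classTermLN_E hh hθ hr ω₀ h₀ (hgrp ω₀ h₀ hW₀)).2 hW₀
  rw [h0, mul_zero, Complex.zero_re] at hsum
  exact lt_irrefl _ hsum

/-- ★★★ **THE `W` CONE LAW AT CELL LN** (a sufficient-half instance of the lane's encircling criterion at a cell of
the ring other than the root's own plaquette): on `θ ∈ (π/3, 2π/3)`, if every WOUND class-`B2a` walk at the cell entered from
`W` and one wound walk exists, then `VF_D(w.side W, cell) ≠ 0`. [cite: GlazmanManolescu2019, Lemma 2.1 (statement, "in the form given in [Gl]")] [cite: Glazman2015WeightedSAW, Lemma 3.1 (proof, pp. 6–7)] [cite: Hopf1935, Nr. 2 (Umlaufsatz, p. 53) and Nr. 4 eq. (22) (curves with corners, pp. 60–61)] -/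
theorem vertexFunctional_printed_LN_ne_zero_of_W {θ : ℝ} (hθ : θ ∈ Set.Ioo (π / 3) (2 * π / 3))
    (Dl : List Face) (w : Face) (hf : latN w ∈ Dl) (hh : holeFaceW w ∉ dom Dl)
    (hr : RootedFace (dom Dl) (w.side .W) (latN w))
    (hgrp : ∀ (ω : ΩG (dom Dl) (w.side .W) (latN w)) (h : ω.IsB2a),
      ω.WE (fun _ => θ) ≠ excursionWinding θ ω.2.firstSideG (ω.z1 hr h) ω.1 → ω.2.firstSideG = .W)
    (hex : ∃ (ω : ΩG (dom Dl) (w.side .W) (latN w)) (h : ω.IsB2a),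
      ω.WE (fun _ => θ) ≠ excursionWinding θ ω.2.firstSideG (ω.z1 hr h) ω.1) :
    vertexFunctional (printedWeights θ) tFiveEighths (ybCoeff θ) Dl (w.side .W) (latN w) ≠ 0 := by
  classical
  have hθ' := Set.Ioo_subset_Icc_self hθ
  have hv : (weightV θ : ℂ) ≠ 0 := by
    have hθ0 : θ ∈ Set.Ioo 0 π := ⟨by linarith [hθ.1, Real.pi_pos], by linarith [hθ.2, Real.pi_pos]⟩
    exact_mod_cast (weightV_pos_of_mem_Ioo hθ0).ne'
  rw [vertexFunctional_printed_LN_eq hθ' Dl w hf hh hr]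
  refine mul_ne_zero (mul_ne_zero Complex.I_ne_zero hv) fun h0 => ?_
  set ρ : ℂ := Complex.exp ((((-(13 * π / 16) : ℝ)) : ℂ) * Complex.I) with hρ
  have hsum : 0 < (ρ * ∑ ω ∈ ΩG.setB2a (dom Dl) (w.side .W) (latN w), ΩG.classTermLN θ hr ω).re := by
    rw [Finset.mul_sum, Complex.re_sum]
    obtain ⟨ω₀, h₀, hW₀⟩ := hex
    have hmem : ω₀ ∈ ΩG.setB2a (dom Dl) (w.side .W) (latN w) := by
      simp only [ΩG.setB2a, Finset.mem_filter, Finset.mem_univ, true_and]; exact h₀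
    have hterm : ∀ ω ∈ ΩG.setB2a (dom Dl) (w.side .W) (latN w), 0 ≤ (ρ * ΩG.classTermLN θ hr ω).re := by
      intro ω hω
      simp only [ΩG.setB2a, Finset.mem_filter, Finset.mem_univ, true_and] at hω
      have hB : ω.IsB2a := hω
      by_cases hw : ω.WE (fun _ => θ) ≠ excursionWinding θ ω.2.firstSideG (ω.z1 hr hB) ω.1
      · exact (ΩG.re_rot_classTermLN_W hh hθ hr ω hB (hgrp ω hB hw)).1
      · rw [ΩG.classTermLN, dif_pos hB, if_neg hw, mul_zero, Complex.zero_re]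
    refine lt_of_lt_of_le ?_ (Finset.single_le_sum hterm hmem)
    exact (ΩG.re_rot_classTermLN_W hh hθ hr ω₀ h₀ (hgrp ω₀ h₀ hW₀)).2 hW₀
  rw [h0, mul_zero, Complex.zero_re] at hsum
  exact lt_irrefl _ hsum

end Literature.Barriers.CriticalPhenomena.PlaquetteWalk
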